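import Literature.Analysis.FluidPDE.AxisymQuotientEquationsJ
import Literature.Analysis.FluidPDE.IsometryInvariance
import Literature.Analysis.FluidPDE.NewtonKernel
import Literature.Analysis.FluidPDE.SereginZajaczkowski2007L42VorticityProofs
import Literature.Analysis.FluidPDE.NSLocalLerayFarFieldTrace
import Literature.Analysis.FluidPDE.WholeSpaceIBP
import Literature.Analysis.FluidPDE.AxisymNoSwirlLocalMaxPrinciple
import Literature.Analysis.FluidPDE.AxisymHouLiVariables
import Literature.Analysis.FluidPDE.HouLiSpaceTime
import Literature.Analysis.FluidPDE.AxisymPoloidalCutoff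
import Literature.Analysis.FluidPDE.Wei2016PoloidalCurl
import Literature.Analysis.FluidPDE.CollapseDebris
import Literature.Analysis.FluidPDE.AxisymGradientField
import Literature.Analysis.FluidPDE.SqIntegralBalance
import Literature.Analysis.Calculus.HardyLogarithmic
import Literature.Analysis.Calculus.PlanarPolarIntegral
import Literature.Analysis.FluidPDE.SuitableWeakProofs
import Literature.Analysis.FluidPDE.BiotSavartCurlPair
import Literature.Analysis.FluidPDE.Seregin2022LogSwirlOriginStep4Assembly
import HarnessLib

/-!
# Seregin 2022 local regularity of axisymmetric solutions, file 4 of 6: Step 3 for the LOCAL smooth class (balance, equations, integrated form, a-priori absorption, key estimate, joint continuity of the smooth families) (re-homed proofs)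

**G. Seregin, *A note on local regularity of axisymmetric solutions to the Navier–Stokes equations*, J. Math. Fluid Mech. 24
(2022), Paper 27 = arXiv:2201.00153, Theorem 1.2 via §2 from the swirl decay (2.2) [Seregin2022LocalAxisym]: for a suitable weak
solution in the unit parabolic cylinder `Q = 𝒞 × ]-1,0[`, axisymmetric, with `v ∈ L_{2,∞}(Q)`, `∇v ∈ L₂(Q)`, `q ∈ L_{3/2}(Q)` and
`|v_θ(x,t)| ≤ C₁ |x'|⁻¹ / ln³(e/|x'|)` off the axis, the origin is a regular point.**  The named fact
`Literature.Analysis.FluidPDE.seregin2022_logSwirl_regularAtOrigin` (`Seregin2022LogSwirlCriterion.lean`) is PROVED in the tree by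
the Navier–Stokes cell's `AxisymmetricKatoGlobal` line (Steps 1–4 of §2: reduction to a first singular time and a clean slab with a
smooth axisymmetric representative, the product cut-off, the Leray logarithmic Hardy inequality (Lemma 2.2), Lemma 2.1 and the
Chen–Fang–Zhang / Lei–Zhang elliptic bounds for `u_r/r`, the `η⁶`-weighted energy estimates of `Γ = ω_θ/r` and `Φ = ω_r/r` with
the swirl source absorbed through (2.2), the key estimate, the Step-4 assembly `C(R) ≤ C R^{3/2} → 0` and ε-regularity) — until now
Summits-side only (`Summits/NavierStokesRegularity/NavierStokesRegularity/Theorems/AxisymmetricExtremalityAxisymmetricKatoGlobalStubSereginLogSwirlOrigin.lean`,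
`seregin2022_logSwirl_regularAtOrigin_holds := stub_sereginLogSwirlOrigin`).  RE-HOMED into `Literature/` by the Hodge foundations
lane (`lit-hodgefound`, prover p20, generation 39) as SIX files: verbatim DECLARATION-LEVEL ports (the 312 declarations the
discharge needs, in dependency order; each Part header lists the declarations of its source module that are NOT carried) of 55
Summits modules `Summits/NavierStokesRegularity/NavierStokesRegularity/Theorems/AxisymmetricExtremalityAxisymmetricKatoGlobalStub*.lean`,
namespaces `Summit.NavierStokesRegularity.NavierStokesRegularity.Theorems.AxisymmetricKatoGlobal{.EulerScaling,.Registered}` re-rooted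
to `Literature.Analysis.SereginLogSwirlOrigin{.EulerScaling,.Registered}` (a root outside `Literature.Analysis.FluidPDE` on purpose:
namespace-prefix resolution would otherwise shadow the cone's lemmas by same-named `FluidPDE` lemmas); the sources' `local notation`
`ℝ³` is expanded textually; imports from `Literature/` and Mathlib only; no `sorry`, no new axiom, NO named fact (D-0026).
PROVENANCE CONVENTION: docstrings are carried byte-for-byte; declarations the cell cites keep their cites; `[folklore]`-tagged and
untagged declarations (the cell's own lemmas) carry the Part's tag `[cite: <Key>, <loc> (source of the ARGUMENT this module
implements; this declaration is the cell's own lemma or plumbing, NOT a printed statement)]`, because the gate does not admit a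
public Literature theorem without a cite tag.

THIS FILE (4 of 6) ports: …StubSereginLogSwirlOriginStep3LocalBalance, …StubSereginLogSwirlOriginStep3LocalEquations, …StubSereginLogSwirlOriginStep3LocalEquationsPhi, …StubSereginLogSwirlOriginStep3LocalIntegrated, …StubSereginLogSwirlOriginStep3LocalApriori, …StubSereginLogSwirlOriginStep3LocalKeyEstimate0, …StubSereginLogSwirlOriginStep3LocalFamilies.
-/

noncomputable section

/-!
## Part 1 — port of `Summits/NavierStokesRegularity/NavierStokesRegularity/Theorems/AxisymmetricExtremalityAxisymmetricKatoGlobalStubSereginLogSwirlOriginStep3LocalBalance.lean` (4 declarations kept)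

# Seregin 2022, §2 Step 3 for the LOCAL smooth class (IV): the weighted energy `∫(η³G)²`, its
# time derivative and the time-integrated localised energy inequality for a family `G` that is
# only continuous in time with an a.e.-in-`x` time derivative — crux stmt-NavierStokesRegularity-15453
# (`AxisymmetricExtremality.AxisymmetricKatoGlobal`), line registered, support for stub `stub_sereginLogSwirlOrigin`

Support file (`--supports stmt-NavierStokesRegularity-15453`; theorems only, everything proved)
toward the registered stub `stub_sereginLogSwirlOrigin` = the named fact
`Literature.Analysis.FluidPDE.seregin2022_logSwirl_regularAtOrigin` (G. Seregin, J. Math. Fluid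
Mech. 24 (2022), Paper 27 = arXiv:2201.00153, §2). The sibling `…Step3Balance` supplies the time
layer of Step 3 ("the key estimate can be derived by more or less standard arguments", arXiv
p. 7: `½∂ₜ∫(Gη³)²`, integration in time) for families `G` JOINTLY SMOOTH on `S × ℝ³` — the
regularity of `Γ = ω_θ/r`, `Φ = ω_r/r` along a whole-space classical solution. For the local
Seregin–Zajaczkowski class (the smooth representative of a suitable weak solution near its regular
points: `C^∞` slices, spatial derivatives jointly continuous, NO time derivative of the velocity)
the vorticity is only `C¹` in time, and `Γ`, `Φ` have classical time derivatives off the axis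
(`…Step3LocalClass`: `∂ₜΓ = ΔΓ + 2q_Γ − DΓ[u] − 2(u_θ/r)Φ` etc. for `cylRadius x ≠ 0`). This file
redoes the time layer at that regularity: `ζ = η³` jointly smooth and vanishing off a fixed
compact `K` as before, but `G` merely jointly CONTINUOUS on `S × ℝ³` together with a jointly
continuous `G'` which is the time derivative of `G(·, x)` for ALMOST EVERY `x` (the axis is
Lebesgue-null):

* `hasDerivAt_integral_cutoff_sq_of_ae` — `d/dt ∫(ζG)² = 2∫ζ∂ₜζG² + 2∫ζ²GG'` (differentiation
  under the integral sign with an a.e. derivative hypothesis, Mathlib's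
  `hasDerivAt_integral_of_dominated_loc_of_deriv_le`, dominated on `[t − δ, t + δ] × K` by the
  maximum of the continuous derivative density);
* `integral_cutoff_sq_sub_eq_of_ae` — the balance `E(t₂) − E(t₁) = ∫_{t₁}^{t₂}(…)` on
  `[t₁, t₂] ⊆ S` with a continuous density (`continuousOn_integral_of_support_subset`);
* `integral_cutoff_sq_add_le_of_forall_le_of_ae` (registered sub-goal) — **from the fixed-time
  to the integrated localised energy inequality** at this regularity: if at every `t ∈ S`
  `∫ζ²GG' + ν∫|∇(ζG)|² ≤ ∫ζG²Dζ[b] + ν∫G²|∇ζ|² − 2ν∫ζG²q_ζ + ∫ζ²GR` (the shape of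
  `integral_cutoff_energy_le`), with `G`, `D_xG`, `G'`, `b`, `R` jointly continuous, then for
  `[t₁, t₂] ⊆ S`
  `E(t₂) + 2ν∫_{t₁}^{t₂}∫|∇(ζG)|² ≤ E(t₁) + ∫_{t₁}^{t₂}[2∫ζ∂ₜζG² + 2∫ζG²Dζ[b] + 2ν∫G²|∇ζ|² − 4ν∫ζG²q_ζ + 2∫ζ²GR]`,
  `E(t) = ∫(ζG)²(t)` — verbatim the conclusion of the smooth `integral_cutoff_sq_add_le_of_forall_le`.

## Mathlib / tree search

Tree: `hasDerivAt_integral_cutoff_sq`, `integral_cutoff_sq_sub_eq`,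
`integral_cutoff_sq_add_le_of_forall_le`, `continuousOn_integral_cutoff` (`…Step3Balance`, the
jointly smooth versions), `continuousOn_integral_of_support_subset`,
`IsSmoothSpaceTimeOn.hasDerivAt_timeLine`, `timeDerivWithin_eq_deriv` (`SpaceTimeCalculus`),
`IsSmoothSpaceTimeOn.timeDerivWithin / .fderiv_slice / .radDerivQuot_family / .continuousOn`,
`integrable_sq_mul_mul` (`…Step3CutoffCalculus`), `fderiv_eq_zero_of_forall_notMem`
(`…CutoffDivCurl`). Mathlib: `hasDerivAt_integral_of_dominated_loc_of_deriv_le`,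
`IsCompact.exists_bound_of_continuousOn`, `IntegrableOn.integrable_indicator`,
`intervalIntegral.integral_eq_sub_of_hasDerivAt`, `intervalIntegral.integral_mono_on`.
`lean search 'cutoff_sq.*_of_ae|_of_ae_hasDerivAt' --decl`: no matches (2026-08-17).

## References

* G. Seregin, J. Math. Fluid Mech. 24 (2022), Paper No. 27 = arXiv:2201.00153, §2 Step 3
  (arXiv pp. 6–7). [`Seregin2022LocalAxisym`]

Not carried from this source module (not needed by the declarations re-homed here; their consumers are Summits-side): `integral_cutoff_sq_add_le_of_forall_le_of_ae`.
-/

section Part1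

open _root_.MeasureTheory _root_.Set _root_.Filter _root_.Topology _root_.Function intervalIntegral _root_.Metric
open scoped _root_.ENNReal _root_.ContDiff
open Literature.Analysis.FluidPDE

namespace Literature.Analysis.SereginLogSwirlOrigin.EulerScaling

/-! ### Slices of jointly continuous families -/

section Slices

variable {Φ : ℝ → EuclideanSpace ℝ (Fin 3) → ℝ} {S : Set ℝ}

/-- A slice of a jointly continuous family is continuous. [folklore]
[cite: Seregin2022LocalAxisym, §2 proof of Thm. 1.2, Step 3 (arXiv:2201.00153 pp. 4–7) (source of the ARGUMENT this module implements; this declaration is the cell’s own lemma or plumbing, NOT a printed statement)] -/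
theorem continuous_slice_of_continuousOn_uncurry (hΦ : ContinuousOn (uncurry Φ) (S ×ˢ univ))
    {s : ℝ} (hs : s ∈ S) : Continuous (Φ s) :=
  hΦ.comp_continuous (Continuous.prodMk_right s) fun x => ⟨hs, mem_univ x⟩

/-- A compact time-neighbourhood inside an open time set. [folklore]
[cite: Seregin2022LocalAxisym, §2 proof of Thm. 1.2, Step 3 (arXiv:2201.00153 pp. 4–7) (source of the ARGUMENT this module implements; this declaration is the cell’s own lemma or plumbing, NOT a printed statement)] -/
theorem exists_Icc_subset_of_isOpen (hS : IsOpen S) {t : ℝ} (ht : t ∈ S) :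
    ∃ δ > 0, Icc (t - δ) (t + δ) ⊆ S := by
  obtain ⟨r, hr, hrS⟩ := Metric.isOpen_iff.1 hS t ht
  refine ⟨r / 2, by positivity, fun s hs => hrS ?_⟩
  rw [Metric.mem_ball, Real.dist_eq, abs_lt]
  constructor <;> linarith [hs.1, hs.2]

end Slices

/-! ### The weighted energy and its time derivative, a.e. time-differentiable data -/

section Balance

variable {S : Set ℝ} {ζ G G' : ℝ → EuclideanSpace ℝ (Fin 3) → ℝ} {K : Set (EuclideanSpace ℝ (Fin 3))}

/-- **The derivative of the weighted energy `∫(ζG)²`, for `G` continuous in time with an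
a.e.-in-`x` time derivative.** Let `S` be open, `ζ` jointly smooth on `S × ℝ³` and vanishing
off a fixed compact `K`, and `G`, `G'` jointly continuous on `S × ℝ³` with
`d/ds G(s, x) = G'(s, x)` at every `s ∈ S` for almost every `x`. Then for `t ∈ S`,
`d/dt ∫ (ζ t · G t)² = 2∫ ζ ∂ₜζ G² + 2∫ ζ² G G'` (`∂ₜζ = timeDerivWithin S ζ`). This is the
passage `∫ η⁶ G ∂ₜG = ½∂ₜ∫(η³G)² − ½∫G²∂ₜη⁶` of Seregin 2022, §2 Step 3, at the regularity of
the local class (the vorticity of the smooth representative is `C¹` in time, `Γ`, `Φ` are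
differentiable in time off the Lebesgue-null axis). [cite: Seregin2022LocalAxisym, §2 Step 3 (arXiv:2201.00153 p. 6, the terms ½∂ₜ∫(Gη³)² and ½∫G²∂ₜη⁶)] -/
theorem hasDerivAt_integral_cutoff_sq_of_ae (hS : IsOpen S) (hζ : IsSmoothSpaceTimeOn S ζ)
    (hK : IsCompact K) (hsupp : ∀ t ∈ S, ∀ x ∉ K, ζ t x = 0)
    (hG : ContinuousOn (uncurry G) (S ×ˢ univ)) (hG' : ContinuousOn (uncurry G') (S ×ˢ univ))
    (hder : ∀ᵐ x ∂(volume : Measure (EuclideanSpace ℝ (Fin 3))), ∀ s ∈ S,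
      HasDerivAt (fun s' => G s' x) (G' s x) s)
    {t : ℝ} (ht : t ∈ S) :
    HasDerivAt (fun s => ∫ x, (ζ s x * G s x) ^ 2)
      (2 * (∫ x, ζ t x * timeDerivWithin S ζ t x * G t x ^ 2) +
        2 * ∫ x, ζ t x ^ 2 * G t x * G' t x) t := by
  have hU : UniqueDiffOn ℝ S := hS.uniqueDiffOn
  obtain ⟨δ, hδ, hIcc⟩ := exists_Icc_subset_of_isOpen hS ht
  have hJS : Ioo (t - δ) (t + δ) ⊆ S := Ioo_subset_Icc_self.trans hIcc
  have hJn : Ioo (t - δ) (t + δ) ∈ 𝓝 t := Ioo_mem_nhds (by linarith) (by linarith)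
  -- the data and their joint continuity
  have hζc : ContinuousOn (uncurry ζ) (S ×ˢ univ) := hζ.continuousOn
  have hζ'c : ContinuousOn (uncurry (timeDerivWithin S ζ)) (S ×ˢ univ) :=
    (hζ.timeDerivWithin hU).continuousOn
  have hFc : ContinuousOn (fun z : ℝ × EuclideanSpace ℝ (Fin 3) =>
      (ζ z.1 z.2 * G z.1 z.2) * (ζ z.1 z.2 * G z.1 z.2)) (S ×ˢ univ) := (hζc.mul hG).mul (hζc.mul hG)
  have hF'c : ContinuousOn (fun z : ℝ × EuclideanSpace ℝ (Fin 3) =>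
      2 * (ζ z.1 z.2 * timeDerivWithin S ζ z.1 z.2 * G z.1 z.2 ^ 2) +
        2 * (ζ z.1 z.2 ^ 2 * G z.1 z.2 * G' z.1 z.2)) (S ×ˢ univ) :=
    (continuousOn_const.mul ((hζc.mul hζ'c).mul (hG.pow 2))).add
      (continuousOn_const.mul (((hζc.pow 2).mul hG).mul hG'))
  -- a uniform bound on `[t - δ, t + δ] × K`
  obtain ⟨B, hB⟩ := (isCompact_Icc.prod hK).exists_bound_of_continuousOn
    (hF'c.mono (prod_mono hIcc (subset_univ _)))
  have hmain := hasDerivAt_integral_of_dominated_loc_of_deriv_le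
    (μ := (volume : Measure (EuclideanSpace ℝ (Fin 3))))
    (F := fun s x => (ζ s x * G s x) * (ζ s x * G s x))
    (F' := fun s x => 2 * (ζ s x * timeDerivWithin S ζ s x * G s x ^ 2) +
      2 * (ζ s x ^ 2 * G s x * G' s x))
    (x₀ := t) (bound := K.indicator fun _ => B) hJn ?_ ?_ ?_ ?_ ?_ ?_
  · -- conclusion: split the integral of the derivative density
    have hfun : (fun s => ∫ x, (ζ s x * G s x) ^ 2) =
        fun s => ∫ x, (ζ s x * G s x) * (ζ s x * G s x) := by
      funext s
      exact integral_congr_ae (Eventually.of_forall fun x => by simp only; ring)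
    rw [hfun]
    refine hmain.2.congr_deriv ?_
    have cζ : Continuous (ζ t) := (hζ.contDiff_slice ht).continuous
    have cζ' : Continuous (timeDerivWithin S ζ t) :=
      ((hζ.timeDerivWithin hU).contDiff_slice ht).continuous
    have cG : Continuous (G t) := continuous_slice_of_continuousOn_uncurry hG ht
    have cG' : Continuous (G' t) := continuous_slice_of_continuousOn_uncurry hG' ht
    have hζcpt : HasCompactSupport (ζ t) := HasCompactSupport.intro hK (hsupp t ht)
    have i1 : Integrable (fun x => ζ t x * timeDerivWithin S ζ t x * G t x ^ 2) :=
      (((cζ.mul cζ').mul (cG.pow 2))).integrable_of_hasCompactSupport (hζcpt.mul_right).mul_right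
    have i2 : Integrable (fun x => ζ t x ^ 2 * G t x * G' t x) :=
      integrable_sq_mul_mul cζ hζcpt cG cG'
    rw [integral_add (i1.const_mul 2) (i2.const_mul 2), MeasureTheory.integral_const_mul,
      MeasureTheory.integral_const_mul]
  · -- measurability of the slices near `t`
    filter_upwards [hS.mem_nhds ht] with s hs
    exact (continuous_slice_of_continuousOn_uncurry
      (Φ := fun s x => (ζ s x * G s x) * (ζ s x * G s x)) hFc hs).aestronglyMeasurable
  · -- integrability at `t`
    have c := continuous_slice_of_continuousOn_uncurry
      (Φ := fun s x => (ζ s x * G s x) * (ζ s x * G s x)) hFc ht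
    refine c.integrable_of_hasCompactSupport (HasCompactSupport.intro hK fun x hx => ?_)
    simp [hsupp t ht x hx]
  · exact (continuous_slice_of_continuousOn_uncurry (Φ := fun s x =>
      2 * (ζ s x * timeDerivWithin S ζ s x * G s x ^ 2) + 2 * (ζ s x ^ 2 * G s x * G' s x))
      hF'c ht).aestronglyMeasurable
  · -- domination
    refine Eventually.of_forall fun x s hs => ?_
    by_cases hx : x ∈ K
    · rw [indicator_of_mem hx]
      exact hB (s, x) ⟨Ioo_subset_Icc_self hs, hx⟩
    · rw [indicator_of_notMem hx]
      simp [hsupp s (hJS hs) x hx]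
  · exact (integrableOn_const (hK.measure_lt_top.ne)).integrable_indicator hK.measurableSet
  · -- the a.e. time derivative of the density
    filter_upwards [hder] with x hx s hs
    have hsS : s ∈ S := hJS hs
    have hζd : HasDerivAt (fun s' => ζ s' x) (timeDerivWithin S ζ s x) s := by
      rw [timeDerivWithin_eq_deriv hS hsS ζ x]
      exact hζ.hasDerivAt_timeLine hS hsS x
    have h := ((hζd.mul (hx s hsS)).mul (hζd.mul (hx s hsS)))
    refine h.congr_deriv ?_
    simp only [Pi.mul_apply]
    ring

/-- **The weighted energy balance on a time interval**, a.e. time-differentiable data: under the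
hypotheses of `hasDerivAt_integral_cutoff_sq_of_ae`, for `t₁ ≤ t₂` with `[t₁, t₂] ⊆ S`,
`∫ (ζG)²(t₂) − ∫ (ζG)²(t₁) = ∫_{t₁}^{t₂} (2∫ ζ∂ₜζ G² + 2∫ ζ²G G') dt`, the density being
continuous on `S`. [cite: Seregin2022LocalAxisym, §2 Step 3 (arXiv:2201.00153 p. 7, integration in time of the key differential inequality)] -/
theorem integral_cutoff_sq_sub_eq_of_ae (hS : IsOpen S) (hζ : IsSmoothSpaceTimeOn S ζ)
    (hK : IsCompact K) (hsupp : ∀ t ∈ S, ∀ x ∉ K, ζ t x = 0)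
    (hG : ContinuousOn (uncurry G) (S ×ˢ univ)) (hG' : ContinuousOn (uncurry G') (S ×ˢ univ))
    (hder : ∀ᵐ x ∂(volume : Measure (EuclideanSpace ℝ (Fin 3))), ∀ s ∈ S,
      HasDerivAt (fun s' => G s' x) (G' s x) s)
    {t₁ t₂ : ℝ} (h12 : t₁ ≤ t₂) (hsub : Icc t₁ t₂ ⊆ S) :
    ContinuousOn (fun t => 2 * (∫ x, ζ t x * timeDerivWithin S ζ t x * G t x ^ 2) +
        2 * ∫ x, ζ t x ^ 2 * G t x * G' t x) S ∧
    (∫ x, (ζ t₂ x * G t₂ x) ^ 2) - ∫ x, (ζ t₁ x * G t₁ x) ^ 2 =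
      ∫ t in t₁..t₂, (2 * (∫ x, ζ t x * timeDerivWithin S ζ t x * G t x ^ 2) +
        2 * ∫ x, ζ t x ^ 2 * G t x * G' t x) := by
  have hU : UniqueDiffOn ℝ S := hS.uniqueDiffOn
  have hζc : ContinuousOn (uncurry ζ) (S ×ˢ univ) := hζ.continuousOn
  have hζ'c : ContinuousOn (uncurry (timeDerivWithin S ζ)) (S ×ˢ univ) :=
    (hζ.timeDerivWithin hU).continuousOn
  have c1 : ContinuousOn (fun t => ∫ x, ζ t x * timeDerivWithin S ζ t x * G t x ^ 2) S := by
    have hc : ContinuousOn (fun z : ℝ × EuclideanSpace ℝ (Fin 3) =>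
        ζ z.1 z.2 * timeDerivWithin S ζ z.1 z.2 * G z.1 z.2 ^ 2) (S ×ˢ univ) :=
      (hζc.mul hζ'c).mul (hG.pow 2)
    exact continuousOn_integral_cutoff (Ψ := fun t x => ζ t x * timeDerivWithin S ζ t x * G t x ^ 2)
      hK hc fun t ht x hx => by simp [hsupp t ht x hx]
  have c2 : ContinuousOn (fun t => ∫ x, ζ t x ^ 2 * G t x * G' t x) S := by
    have hc : ContinuousOn (fun z : ℝ × EuclideanSpace ℝ (Fin 3) =>
        ζ z.1 z.2 ^ 2 * G z.1 z.2 * G' z.1 z.2) (S ×ˢ univ) := ((hζc.pow 2).mul hG).mul hG'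
    exact continuousOn_integral_cutoff (Ψ := fun t x => ζ t x ^ 2 * G t x * G' t x)
      hK hc fun t ht x hx => by simp [hsupp t ht x hx]
  have hcont : ContinuousOn (fun t => 2 * (∫ x, ζ t x * timeDerivWithin S ζ t x * G t x ^ 2) +
      2 * ∫ x, ζ t x ^ 2 * G t x * G' t x) S :=
    (continuousOn_const.mul c1).add (continuousOn_const.mul c2)
  refine ⟨hcont, ?_⟩
  rw [intervalIntegral.integral_eq_sub_of_hasDerivAt]
  · intro t ht
    rw [uIcc_of_le h12] at ht
    exact hasDerivAt_integral_cutoff_sq_of_ae hS hζ hK hsupp hG hG' hder (hsub ht)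
  · exact (hcont.mono hsub).intervalIntegrable_of_Icc h12

end Balance

/-! ### From the fixed-time inequality to the integrated one, a.e. time-differentiable data -/

section Integrated

end Integrated

end Literature.Analysis.SereginLogSwirlOrigin.EulerScaling

end Part1

/-!
## Part 2 — port of `Summits/NavierStokesRegularity/NavierStokesRegularity/Theorems/AxisymmetricExtremalityAxisymmetricKatoGlobalStubSereginLogSwirlOriginStep3LocalEquations.lean` (6 declarations kept)

# Seregin 2022, §2 Step 3 for the LOCAL smooth class (I): the vorticity right-hand side and the
# equation of `Γ = ω_θ/r` as an identity of smooth functions — crux stmt-NavierStokesRegularity-15453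
# (`AxisymmetricExtremality.AxisymmetricKatoGlobal`), line registered, support for stub `stub_sereginLogSwirlOrigin`

Support file (`--supports stmt-NavierStokesRegularity-15453`; theorems only, everything proved)
toward the registered stub `stub_sereginLogSwirlOrigin` = the named fact
`Literature.Analysis.FluidPDE.seregin2022_logSwirl_regularAtOrigin` (G. Seregin, J. Math. Fluid
Mech. 24 (2022), Paper 27 = arXiv:2201.00153, §2). Step 3 (arXiv p. 6) rests on the two equations
`∂ₜΦ + (v − 2x'/|x'|²)·∇Φ − ΔΦ − ω·∇(v_r/r) = 0`, `∂ₜΓ + (v − 2x'/|x'|²)·∇Γ − ΔΓ + 2(v_θ/r)Φ = 0`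
(`Φ = ω_r/r`, `Γ = ω_θ/r`). The landed Step-3 chain (`…Step3Gamma` … `…Step3KeyUnconditional`)
takes them from the tree's `IsClassicalNSSolutionOn.angVortQuot_eq` / `.radVelQuot_curl_eq`,
i.e. for WHOLE-SPACE classical solutions (velocity and pressure jointly `C^∞` on `S × ℝ³`, the
time derivative being `angVortQuot (∂ₜv)`). The final reduction of the fact
(`seregin2022_logSwirl_regularAtOrigin_of_cleanRepr`, `…FinalReduction`) however only provides a
representative `V` in the Seregin–Zajaczkowski class `IsSmoothAxisymmetricSolutionOn (parCylOpens ẑ R) V q`: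
a suitable weak solution on an open cylinder whose slices are `C^∞` there with all SPATIAL
derivatives jointly continuous — no time derivative of `V`, no regular pressure. This file and
its two sequels (`…Step3LocalEquationsPhi`, `…Step3LocalClass`) port the two equations to that
class.

The mechanism (no pressure, no `∂ₜV`): the tree's
`vorticity_classical_of_isDistributionalNSSolutionOn` gives for such a class, on any open
product `I × U` inside the cylinder, the CLASSICAL vorticity equation in the pointwise form
`d/ds (curl V(s))(x)|ₛ₌ₜ = W(t, x)`, `W = Δω − Dω[V] + DV[ω]`, `ω = curl V`. The whole content
of the `Γ`/`Φ` equations is then SPATIAL algebra at a fixed time — the computation inside the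
proofs of `angVortQuot_eq_of_ne`, `radVelQuot_curl_eq_of_ne`, which uses the vorticity equation
and axisymmetry only (not `div v = 0`, not the momentum equation). This file:

* `isAxisymmetric_vorticityRHS`, `contDiff_vorticityRHS` — for an axisymmetric `u ∈ C^∞(ℝ³)`
  the field `W = νΔω − Dω[u] + Du[ω]` is axisymmetric and `C^∞`, so its smooth quotients
  `angVelQuot W = radQuot (swirl W)` ("`∂ₜΓ`") and `radVelQuot W` ("`∂ₜΦ`") make sense
  (`laplacian_conj_linearIsometryEquiv`, `convect_conj_linearIsometryEquiv`);
* `angVelQuot_vorticityRHS_eq_of_ne`, `angVelQuot_vorticityRHS_eq` (registered sub-goal) —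
  **the `Γ`-equation as an identity of smooth functions on `ℝ³`**:
  `angVelQuot W + DΓ[u] = ν(ΔΓ + 2q_Γ) − 2(u_θ/r)Φ` everywhere
  (`Γ = angVortQuot u`, `Φ = radVelQuot (curl u)`, `u_θ/r = angVelQuot u`, `q = radDerivQuot`,
  `2q_Γ = (2x'/|x'|²)·∇Γ`). Off the axis it is the algebra of `angVortQuot_eq_of_ne` with
  `∂ₜ swirl ω` replaced by `swirl W = ⟪Jx, W⟫`
  (`⟪Jx, W⟫ + D(swirl ω)[u] = 2⟪Ju, ω⟫ + ν⟪Jx, Δω⟫`); on the axis by continuity.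

The sequels prove the `Φ`-equation, the identification `∂ₜΓ = angVelQuot W`,
`∂ₜΦ = radVelQuot W` off the axis along a family whose vorticity time lines solve the vorticity
equation, and the specialisation to the Seregin–Zajaczkowski class.

## Mathlib / tree search

Tree: the algebra of `IsClassicalNSSolutionOn.angVortQuot_eq_of_ne` (`AxisymQuotientEquationsOmega`:
`laplacian_swirl`, `IsAxisymmetric.partialDeriv_eR_swirl`, `cylRadius_sq_mul_inner_rotGen`,
`template_quotient_eq`, `fderiv_apply_horizontal_eq`, `eq_of_eq_off_ker`), `fderiv_swirl_apply`,
`IsAxisymmetric.inner_rotGen_convect_curl`, `laplacian_conj_linearIsometryEquiv`,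
`convect_conj_linearIsometryEquiv` (`IsometryInvariance`; the tree's `IsAxisymmetric.laplacian_rotZ`,
`.convect_rotZ` in `KNSSSwirlFromVorticity` are the one-field cases), `contDiff_laplacian`
(`NewtonKernel`), `IsAxisymmetric.cylRadius_sq_mul_angVelQuot / _angVortQuot / _radVelQuot`
(`AxisymHouLiVariables`), `SereginZajaczkowski2007.inner_horizontal_left` (`…L42VorticityProofs`). `lean search 'vorticityRHS' --decl`: only the unrelated
`inv_cylRadius_mul_inner_rotGen_vorticityRHS` (SZ2007 (4.5) on an off-axis shell),
`inner_vorticityRHS_eq`, `enstrophyC2_norm_iteratedFDeriv_vorticityRHS_le` (2026-08-17).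

## References

* G. Seregin, J. Math. Fluid Mech. 24 (2022), Paper No. 27 = arXiv:2201.00153, §2 Step 3
  (arXiv p. 6, the equations of `Φ` and `Γ`). [`Seregin2022LocalAxisym`]
* Z. Lei, Q. S. Zhang, Pacific J. Math. 289 (2017) = arXiv:1505.02628, (1.4). [`LeiZhang2017`]
-/

section Part2

open _root_.MeasureTheory _root_.Set _root_.Function _root_.Filter _root_.Topology _root_.InnerProductSpace WithLp
open scoped RealInnerProductSpace Laplacian _root_.ContDiff
open Literature.Analysis.FluidPDE

namespace Literature.Analysis.SereginLogSwirlOrigin.EulerScaling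

/-! ### The vorticity right-hand side `W = νΔω − Dω[u] + Du[ω]` of an axisymmetric field -/

section RHS

variable {u : EuclideanSpace ℝ (Fin 3) → EuclideanSpace ℝ (Fin 3)}

/-- The Laplacian of an axisymmetric vector field is axisymmetric
(`laplacian_conj_linearIsometryEquiv`). [folklore]
[cite: Seregin2022LocalAxisym, §2 proof of Thm. 1.2, Step 3 (arXiv:2201.00153 pp. 4–7) (source of the ARGUMENT this module implements; this declaration is the cell’s own lemma or plumbing, NOT a printed statement)] -/
theorem laplacian_rotZ_of_isAxisymmetric (hax : IsAxisymmetric u) (θ : ℝ)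
    (y : EuclideanSpace ℝ (Fin 3)) : (Δ u) (rotZ θ y) = rotZ θ ((Δ u) y) := by
  have hconj : (fun z => rotZLIE θ (u ((rotZLIE θ).symm z))) = u :=
    funext fun z => by simp [hax.rotZ_apply_rotZ_neg θ z]
  have h := laplacian_conj_linearIsometryEquiv (rotZLIE θ) u (rotZLIE θ y)
  rw [hconj, LinearIsometryEquiv.symm_apply_apply] at h
  simpa using h

/-- The convective derivative `Dw[u]` of two axisymmetric vector fields is axisymmetric
(`convect_conj_linearIsometryEquiv`). [folklore]
[cite: Seregin2022LocalAxisym, §2 proof of Thm. 1.2, Step 3 (arXiv:2201.00153 pp. 4–7) (source of the ARGUMENT this module implements; this declaration is the cell’s own lemma or plumbing, NOT a printed statement)] -/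
theorem convect_rotZ_of_isAxisymmetric {w : EuclideanSpace ℝ (Fin 3) → EuclideanSpace ℝ (Fin 3)}
    (hax : IsAxisymmetric u) (hw : IsAxisymmetric w) (θ : ℝ) (y : EuclideanSpace ℝ (Fin 3)) :
    convect u w (rotZ θ y) = rotZ θ (convect u w y) := by
  have hcu : (fun z => rotZLIE θ (u ((rotZLIE θ).symm z))) = u :=
    funext fun z => by simp [hax.rotZ_apply_rotZ_neg θ z]
  have hcw : (fun z => rotZLIE θ (w ((rotZLIE θ).symm z))) = w :=
    funext fun z => by simp [hw.rotZ_apply_rotZ_neg θ z]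
  have h := convect_conj_linearIsometryEquiv (rotZLIE θ) u w (rotZLIE θ y)
  rw [hcu, hcw, LinearIsometryEquiv.symm_apply_apply] at h
  simpa using h

/-- **The vorticity right-hand side of an axisymmetric field is axisymmetric**:
`W = νΔω − Dω[u] + Du[ω]`, `ω = curl u`, satisfies `W (R_θ y) = R_θ (W y)`. [folklore]
[cite: Seregin2022LocalAxisym, §2 proof of Thm. 1.2, Step 3 (arXiv:2201.00153 pp. 4–7) (source of the ARGUMENT this module implements; this declaration is the cell’s own lemma or plumbing, NOT a printed statement)] -/
theorem isAxisymmetric_vorticityRHS (hax : IsAxisymmetric u) (hu : ContDiff ℝ 1 u) (ν : ℝ) :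
    IsAxisymmetric fun y => ν • (Δ (curl u)) y - fderiv ℝ (curl u) y (u y) +
      fderiv ℝ u y (curl u y) := by
  have haxω : IsAxisymmetric (curl u) := hax.curl (hu.differentiable one_ne_zero)
  intro θ y
  have h1 := laplacian_rotZ_of_isAxisymmetric haxω θ y
  have h2 := convect_rotZ_of_isAxisymmetric hax haxω θ y
  have h3 := convect_rotZ_of_isAxisymmetric haxω hax θ y
  rw [convect_apply, convect_apply] at h2 h3
  show ν • (Δ (curl u)) (rotZ θ y) - fderiv ℝ (curl u) (rotZ θ y) (u (rotZ θ y)) +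
      fderiv ℝ u (rotZ θ y) (curl u (rotZ θ y)) = rotZ θ _
  rw [h1, h2, h3, ← rotZL_apply, ← rotZL_apply, ← rotZL_apply, ← rotZL_apply, map_add, map_sub,
    map_smul]

/-- The vorticity right-hand side of a `C^∞` field is `C^∞`. [folklore]
[cite: Seregin2022LocalAxisym, §2 proof of Thm. 1.2, Step 3 (arXiv:2201.00153 pp. 4–7) (source of the ARGUMENT this module implements; this declaration is the cell’s own lemma or plumbing, NOT a printed statement)] -/
theorem contDiff_vorticityRHS (hu : ContDiff ℝ ∞ u) (ν : ℝ) :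
    ContDiff ℝ ∞ fun y => ν • (Δ (curl u)) y - fderiv ℝ (curl u) y (u y) +
      fderiv ℝ u y (curl u y) := by
  have hω : ContDiff ℝ ∞ (curl u) := contDiff_curl (n := ⊤) (by exact_mod_cast hu)
  have hΔ : ContDiff ℝ ∞ (Δ (curl u)) := contDiff_laplacian (n := ⊤) (by exact_mod_cast hω)
  have h1 : ContDiff ℝ ∞ (fderiv ℝ (curl u)) := hω.fderiv_right (m := ∞) (by simp)
  have h2 : ContDiff ℝ ∞ (fderiv ℝ u) := hu.fderiv_right (m := ∞) (by simp)
  exact ((hΔ.const_smul ν).sub (h1.clm_apply hu)).add (h2.clm_apply hω)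

end RHS

/-! ### The `Γ`- and `Φ`-equations as identities of smooth functions (fixed time) -/

section SliceEquations

variable {u : EuclideanSpace ℝ (Fin 3) → EuclideanSpace ℝ (Fin 3)}

/-- **The `Γ`-equation off the axis, slice form**: with `W = νΔω − Dω[u] + Du[ω]`,
`angVelQuot W x + DΓ(x)[u x] = ν (ΔΓ(x) + 2 q_Γ(x)) − 2 (u_θ/r)(x) Φ(x)` for `cylRadius x ≠ 0`
(`Γ = angVortQuot u`, `Φ = radVelQuot (curl u)`). The algebra of
`IsClassicalNSSolutionOn.angVortQuot_eq_of_ne` with the time derivative `∂ₜ swirl ω` replaced by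
`swirl W = ⟪Jx, W⟫`: `⟪Jx, W⟫ + D(swirl ω)[u] = 2⟪Ju, ω⟫ + ν⟪Jx, Δω⟫` (`fderiv_swirl_apply`,
`IsAxisymmetric.inner_rotGen_convect_curl`), then Lagrange's identity, `laplacian_swirl` and the
template. [cite: Seregin2022LocalAxisym, §2 Step 3 (arXiv:2201.00153 p. 6, the equation of Γ)] -/
theorem angVelQuot_vorticityRHS_eq_of_ne (hu : ContDiff ℝ ∞ u) (hax : IsAxisymmetric u) (ν : ℝ)
    {x : EuclideanSpace ℝ (Fin 3)} (hx : cylRadius x ≠ 0) :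
    angVelQuot (fun y => ν • (Δ (curl u)) y - fderiv ℝ (curl u) y (u y) +
        fderiv ℝ u y (curl u y)) x + fderiv ℝ (angVortQuot u) x (u x) =
      ν * ((Δ (angVortQuot u)) x + 2 * radDerivQuot (angVortQuot u) x) -
        2 * angVelQuot u x * radVelQuot (curl u) x := by
  set W : EuclideanSpace ℝ (Fin 3) → EuclideanSpace ℝ (Fin 3) := fun y =>
    ν • (Δ (curl u)) y - fderiv ℝ (curl u) y (u y) + fderiv ℝ u y (curl u y) with hWdef
  -- regularity
  have hv2 : ContDiff ℝ 2 u := hu.of_le (by norm_cast)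
  have hv3 : ContDiff ℝ 3 u := hu.of_le (by norm_cast)
  have hv5 : ContDiff ℝ 5 u := hu.of_le (by norm_cast)
  have hvd : Differentiable ℝ u := hu.differentiable (by simp)
  have hω : ContDiff ℝ ∞ (curl u) := contDiff_curl (n := ⊤) (by exact_mod_cast hu)
  have hω2 : ContDiff ℝ 2 (curl u) := hω.of_le (by norm_cast)
  have hωd : Differentiable ℝ (curl u) := hω.differentiable (by simp)
  have haxω : IsAxisymmetric (curl u) := hax.curl hvd
  have hW : ContDiff ℝ ∞ W := contDiff_vorticityRHS hu ν
  have hW2 : ContDiff ℝ 2 W := hW.of_le (by norm_cast)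
  have hWax : IsAxisymmetric W := isAxisymmetric_vorticityRHS hax (hu.of_le (by norm_cast)) ν
  have hΩ : ContDiff ℝ 2 (angVortQuot u) := contDiff_angVortQuot (n := 2) hv5
  have hΩax : IsAxisymmetricScalar (angVortQuot u) := hax.isAxisymmetricScalar_angVortQuot hv3
  have hρx : x 0 ^ 2 + x 1 ^ 2 ≠ 0 := by
    rwa [sq_add_sq_eq_cylRadius_sq, pow_ne_zero_iff two_ne_zero]
  -- (i) the "time derivative": `ρ · angVelQuot W = swirl W = ⟪Jx, W⟫`, and the transport algebra
  have ht1 : (x 0 ^ 2 + x 1 ^ 2) * angVelQuot W x = ⟪rotGen x, W x⟫ := by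
    rw [sq_add_sq_eq_cylRadius_sq, hWax.cylRadius_sq_mul_angVelQuot hW2 x]
    exact congrFun (swirl_eq_inner_rotGen W) x
  have hpde : (x 0 ^ 2 + x 1 ^ 2) * angVelQuot W x + fderiv ℝ (swirl (curl u)) x (u x) =
      2 * ⟪rotGen (u x), curl u x⟫ + ν * ⟪rotGen x, (Δ (curl u)) x⟫ := by
    have hstr : ⟪rotGen x, fderiv ℝ u x (curl u x)⟫ = ⟪rotGen (u x), curl u x⟫ := by
      rw [← convect_apply]; exact hax.inner_rotGen_convect_curl (hvd x)
    have hWx : W x = ν • (Δ (curl u)) x - fderiv ℝ (curl u) x (u x) + fderiv ℝ u x (curl u x) :=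
      rfl
    rw [ht1, fderiv_swirl_apply (hωd x) (u x), hWx, inner_add_right, inner_sub_right,
      inner_smul_right, hstr]
    ring
  -- (ii) the viscous term: `⟪Jx, Δω⟫ = Δ Σ − (2/ρ) DΣ[x_h]`, `Σ = swirl ω`
  have hlap := laplacian_swirl hω2 x
  have hrad := haxω.partialDeriv_eR_swirl (hωd x)
  rw [partialDeriv_apply, eR_eq_inv_smul_horizontal, map_smul, smul_eq_mul] at hrad
  have hvisc : ⟪rotGen x, (Δ (curl u)) x⟫ =
      (Δ (swirl (curl u))) x - 2 / (x 0 ^ 2 + x 1 ^ 2) *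
        fderiv ℝ (swirl (curl u)) x
          ((x 0) • EuclideanSpace.single 0 1 + (x 1) • EuclideanSpace.single 1 1) := by
    have e : fderiv ℝ (curl u) x (EuclideanSpace.single 0 1) 1 -
        fderiv ℝ (curl u) x (EuclideanSpace.single 1 1) 0 =
        1 / (x 0 ^ 2 + x 1 ^ 2) * fderiv ℝ (swirl (curl u)) x
          ((x 0) • EuclideanSpace.single 0 1 + (x 1) • EuclideanSpace.single 1 1) := by
      rw [sq_add_sq_eq_cylRadius_sq]
      have h' : fderiv ℝ (swirl (curl u)) x
          ((x 0) • EuclideanSpace.single 0 1 + (x 1) • EuclideanSpace.single 1 1) =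
          cylRadius x ^ 2 * (fderiv ℝ (curl u) x (EuclideanSpace.single 0 1) 1 -
            fderiv ℝ (curl u) x (EuclideanSpace.single 1 1) 0) := by
        have h2 := congrArg (fun y => cylRadius x * y) hrad
        simp only [] at h2
        rw [← mul_assoc, mul_inv_cancel₀ hx, one_mul] at h2
        rw [h2]
        ring
      rw [h']
      field_simp
    rw [hlap, e]
    ring
  -- (iii) the source: Lagrange `ρ ⟪Ju, ω⟫ = ρW · ρΩ − ρΦ · ρJ`
  have hsrc : ⟪rotGen (u x), curl u x⟫ =
      (x 0 ^ 2 + x 1 ^ 2) * (radVelQuot u x * angVortQuot u x -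
        angVelQuot u x * radVelQuot (curl u) x) := by
    have hL := cylRadius_sq_mul_inner_rotGen x (u x) (curl u x)
    rw [SereginZajaczkowski2007.inner_horizontal_left, SereginZajaczkowski2007.inner_horizontal_left,
      ← hax.cylRadius_sq_mul_radVelQuot hv2 x, ← haxω.cylRadius_sq_mul_radVelQuot hω2 x] at hL
    have e1 : ⟪rotGen x, curl u x⟫ = cylRadius x ^ 2 * angVortQuot u x := by
      rw [hax.cylRadius_sq_mul_angVortQuot hv3 x, swirl_eq_inner_rotGen]
    have e2 : ⟪rotGen x, u x⟫ = cylRadius x ^ 2 * angVelQuot u x := by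
      rw [hax.cylRadius_sq_mul_angVelQuot hv2 x, swirl_eq_inner_rotGen]
    rw [e1, e2] at hL
    rw [sq_add_sq_eq_cylRadius_sq]
    have hr2 : cylRadius x ^ 2 ≠ 0 := pow_ne_zero 2 hx
    apply mul_left_cancel₀ hr2
    rw [hL]
    ring
  -- `Σ = ρ Ω` as functions
  have hSig : swirl (curl u) = fun y => (y 0 ^ 2 + y 1 ^ 2) * angVortQuot u y := by
    funext y
    rw [sq_add_sq_eq_cylRadius_sq, hax.cylRadius_sq_mul_angVortQuot hv3 y]
  rw [hvisc, hsrc, hSig] at hpde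
  -- the template, with `R = 2 ρ (WΩ − ΦJ)`
  have key := template_quotient_eq hΩ hρx (ν := ν)
    (R := 2 * ((x 0 ^ 2 + x 1 ^ 2) * (radVelQuot u x * angVortQuot u x -
      angVelQuot u x * radVelQuot (curl u) x))) (c := u x)
    (σ' := angVelQuot W x) (by linarith [hpde])
  rw [fderiv_apply_horizontal_eq hΩ hΩax, ← sq_add_sq_eq_cylRadius_sq,
    ← hax.cylRadius_sq_mul_radVelQuot hv2 x, ← sq_add_sq_eq_cylRadius_sq] at key
  have e1 : 2 * angVortQuot u x * ((x 0 ^ 2 + x 1 ^ 2) * radVelQuot u x) /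
      (x 0 ^ 2 + x 1 ^ 2) = 2 * radVelQuot u x * angVortQuot u x := by
    field_simp
  have e2 : 2 / (x 0 ^ 2 + x 1 ^ 2) * ((x 0 ^ 2 + x 1 ^ 2) * radDerivQuot (angVortQuot u) x) =
      2 * radDerivQuot (angVortQuot u) x := by
    field_simp
  have e3 : 2 * ((x 0 ^ 2 + x 1 ^ 2) * (radVelQuot u x * angVortQuot u x -
      angVelQuot u x * radVelQuot (curl u) x)) / (x 0 ^ 2 + x 1 ^ 2) =
      2 * (radVelQuot u x * angVortQuot u x - angVelQuot u x * radVelQuot (curl u) x) := by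
    field_simp
  rw [e1, e2, e3] at key
  linarith

/-- **Seregin's `Γ`-equation as an identity of smooth functions on `ℝ³`** (Step 3:
"`∂ₜΓ + (v − 2x'/|x'|²)·∇Γ − ΔΓ + 2(v_θ/r)Φ = 0`", with `∂ₜΓ` rendered by the quotient
`angVelQuot W` of the vorticity right-hand side `W = νΔω − Dω[u] + Du[ω]`): for an axisymmetric
`u ∈ C^∞(ℝ³)`, at EVERY `x`,
`angVelQuot W x + DΓ(x)[u x] = ν (ΔΓ(x) + 2 radDerivQuot Γ x) − 2 angVelQuot u x · Φ(x)`
(`Γ = angVortQuot u`, `Φ = radVelQuot (curl u)`). Off the axis `angVelQuot_vorticityRHS_eq_of_ne`,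
on the axis by continuity of both sides. [cite: Seregin2022LocalAxisym, §2 Step 3 (arXiv:2201.00153 p. 6, the equation of Γ)] -/
theorem angVelQuot_vorticityRHS_eq : ∀ (u : EuclideanSpace ℝ (Fin 3) → EuclideanSpace ℝ (Fin 3)) (ν : ℝ), ContDiff ℝ (⊤ : ℕ∞) u → IsAxisymmetric u → ∀ x : EuclideanSpace ℝ (Fin 3), angVelQuot (fun y => ν • (Δ (curl u)) y - fderiv ℝ (curl u) y (u y) + fderiv ℝ u y (curl u y)) x + fderiv ℝ (angVortQuot u) x (u x) = ν * ((Δ (angVortQuot u)) x + 2 * radDerivQuot (angVortQuot u) x) - 2 * angVelQuot u x * radVelQuot (curl u) x := by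
  intro u ν hu hax x
  have hv4 : ContDiff ℝ 4 u := hu.of_le (by norm_cast)
  have hv5 : ContDiff ℝ 5 u := hu.of_le (by norm_cast)
  have hω : ContDiff ℝ ∞ (curl u) := contDiff_curl (n := ⊤) (by exact_mod_cast hu)
  have hω4 : ContDiff ℝ 4 (curl u) := hω.of_le (by norm_cast)
  have hW : ContDiff ℝ ∞ fun y => ν • (Δ (curl u)) y - fderiv ℝ (curl u) y (u y) +
      fderiv ℝ u y (curl u y) := contDiff_vorticityRHS hu ν
  have hW4 : ContDiff ℝ 4 fun y => ν • (Δ (curl u)) y - fderiv ℝ (curl u) y (u y) +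
      fderiv ℝ u y (curl u y) := hW.of_le (by norm_cast)
  have hΩ2 : ContDiff ℝ 2 (angVortQuot u) := contDiff_angVortQuot (n := 2) hv5
  have hΩ' : ContDiff ℝ 2 (angVelQuot fun y => ν • (Δ (curl u)) y - fderiv ℝ (curl u) y (u y) +
      fderiv ℝ u y (curl u y)) := contDiff_angVelQuot (n := 2) hW4
  have hΦ : ContDiff ℝ 2 (angVelQuot u) := contDiff_angVelQuot (n := 2) hv4
  have hJ : ContDiff ℝ 2 (radVelQuot (curl u)) := contDiff_radVelQuot (n := 2) hω4
  have hL : Continuous fun y => angVelQuot (fun y => ν • (Δ (curl u)) y -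
      fderiv ℝ (curl u) y (u y) + fderiv ℝ u y (curl u y)) y +
      fderiv ℝ (angVortQuot u) y (u y) :=
    hΩ'.continuous.add ((hΩ2.continuous_fderiv two_ne_zero).clm_apply hu.continuous)
  have hR : Continuous fun y => ν * ((Δ (angVortQuot u)) y +
      2 * radDerivQuot (angVortQuot u) y) - 2 * angVelQuot u y * radVelQuot (curl u) y := by
    refine (continuous_const.mul ((continuous_laplacian hΩ2).add
      (continuous_const.mul (continuous_radDerivQuot hΩ2)))).sub ?_
    exact (continuous_const.mul hΦ.continuous).mul hJ.continuous
  refine eq_of_eq_off_ker (EuclideanSpace.proj (0 : Fin 3)) ⟨EuclideanSpace.single 0 1, by simp⟩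
    hL hR (fun z hz => ?_) x
  have hz0 : z 0 ≠ 0 := by simpa using hz
  have hzr : cylRadius z ≠ 0 := fun h => hz0 ((cylRadius_eq_zero_iff z).1 h).1
  exact angVelQuot_vorticityRHS_eq_of_ne hu hax ν hzr

end SliceEquations

end Literature.Analysis.SereginLogSwirlOrigin.EulerScaling

end Part2

/-!
## Part 3 — port of `Summits/NavierStokesRegularity/NavierStokesRegularity/Theorems/AxisymmetricExtremalityAxisymmetricKatoGlobalStubSereginLogSwirlOriginStep3LocalEquationsPhi.lean` (4 declarations kept)

# Seregin 2022, §2 Step 3 for the LOCAL smooth class (II): the equation of `Φ = ω_r/r` as an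
# identity of smooth functions, and the time derivatives of `Γ`, `Φ` off the axis from the
# pointwise vorticity equation — crux stmt-NavierStokesRegularity-15453
# (`AxisymmetricExtremality.AxisymmetricKatoGlobal`), line registered, support for stub `stub_sereginLogSwirlOrigin`

Support file (`--supports stmt-NavierStokesRegularity-15453`; theorems only, everything proved)
toward the registered stub `stub_sereginLogSwirlOrigin` = the named fact
`Literature.Analysis.FluidPDE.seregin2022_logSwirl_regularAtOrigin` (G. Seregin, J. Math. Fluid
Mech. 24 (2022), Paper 27 = arXiv:2201.00153, §2), sequel of `…Step3LocalEquations` (see its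
module docstring for the setting: Step 3 for the local Seregin–Zajaczkowski class, where only
the pointwise vorticity equation `d/ds curl V(s) x = W(t, x)`, `W = Δω − Dω[V] + DV[ω]`, is
available). This file:

* `radVelQuot_vorticityRHS_eq_of_ne`, `radVelQuot_vorticityRHS_eq` (registered sub-goal) —
  **the `Φ`-equation as an identity of smooth functions on `ℝ³`**: for an axisymmetric
  `u ∈ C^∞(ℝ³)` and `W = νΔω − Dω[u] + Du[ω]`,
  `radVelQuot W + DΦ[u] = ν(ΔΦ + 2q_Φ) + D(u_r/r)[ω]` everywhere (`Φ = radVelQuot (curl u)`,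
  `u_r/r = radVelQuot u`); the algebra of `IsClassicalNSSolutionOn.radVelQuot_curl_eq_of_ne`
  with `⟪x_h, ∂ₜω⟫` replaced by `⟪x_h, W⟫`, then continuity across the axis;
* `hasDerivAt_angVortQuot_of_ne`, `hasDerivAt_radVelQuot_curl_of_ne` — **the time derivatives
  off the axis**: for a family `v` with `C³` axisymmetric slices on an open time set, if
  `s ↦ curl (v s) x` has derivative `W x` at `t` (`W ∈ C²` axisymmetric), then
  `s ↦ Γ(s, x) = angVortQuot (v s) x` has derivative `angVelQuot W x` and
  `s ↦ Φ(s, x) = radVelQuot (curl (v s)) x` has derivative `radVelQuot W x` at `t`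
  (`cylRadius x ≠ 0`: there `Γ = ⟪Jx, ω⟫/r²`, `Φ = ⟪x_h, ω⟫/r²` along the whole time line).
  Together with the slice identities this is Seregin's pair of equations in time-derivative
  form; the axis is Lebesgue-null, which is all the energy method of Step 3 needs.

## Mathlib / tree search

Tree: the algebra of `IsClassicalNSSolutionOn.radVelQuot_curl_eq_of_ne` (`AxisymQuotientEquationsJ`:
`fderiv_horizontal_inner_apply`, `laplacian_horizontal_inner`,
`IsAxisymmetric.mul_divH_eq_fderiv_horizontal_inner`, `template_quotient_eq`,
`fderiv_apply_horizontal_eq`, `fderiv_rho_apply`, `eq_of_eq_off_ker`),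
`IsAxisymmetric.cylRadius_sq_mul_radVelQuot / _angVortQuot / _angVelQuot`, `swirl_eq_inner_rotGen`,
`isAxisymmetric_vorticityRHS`, `contDiff_vorticityRHS` (`…Step3LocalEquations`). Mathlib:
`HasDerivAt.inner`, `HasDerivAt.congr_of_eventuallyEq`, `HasDerivAt.congr_deriv`.
`lean search 'hasDerivAt_angVortQuot|hasDerivAt_radVelQuot_curl' --decl`: no matches (2026-08-17).

## References

* G. Seregin, J. Math. Fluid Mech. 24 (2022), Paper No. 27 = arXiv:2201.00153, §2 Step 3
  (arXiv p. 6, the equations of `Φ` and `Γ`). [`Seregin2022LocalAxisym`]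
* Z. Lei, Q. S. Zhang, Pacific J. Math. 289 (2017) = arXiv:1505.02628, (1.4). [`LeiZhang2017`]
-/

section Part3

open _root_.MeasureTheory _root_.Set _root_.Function _root_.Filter _root_.Topology _root_.InnerProductSpace WithLp
open scoped RealInnerProductSpace Laplacian _root_.ContDiff
open Literature.Analysis.FluidPDE

namespace Literature.Analysis.SereginLogSwirlOrigin.EulerScaling

/-! ### The `Φ`-equation as an identity of smooth functions (fixed time) -/

section SliceEquations

variable {u : EuclideanSpace ℝ (Fin 3) → EuclideanSpace ℝ (Fin 3)}

/-- **The `Φ`-equation off the axis, slice form**: with `W = νΔω − Dω[u] + Du[ω]`,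
`radVelQuot W x + DΦ(x)[u x] = ν (ΔΦ(x) + 2 q_Φ(x)) + D(u_r/r)(x)[ω x]` for `cylRadius x ≠ 0`
(`Φ = radVelQuot (curl u)`, `u_r/r = radVelQuot u`). The algebra of
`IsClassicalNSSolutionOn.radVelQuot_curl_eq_of_ne` with `⟪x_h, ∂ₜω⟫` replaced by `⟪x_h, W⟫`.
[cite: Seregin2022LocalAxisym, §2 Step 3 (arXiv:2201.00153 p. 6, the equation of Φ)] -/
theorem radVelQuot_vorticityRHS_eq_of_ne (hu : ContDiff ℝ ∞ u) (hax : IsAxisymmetric u) (ν : ℝ)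
    {x : EuclideanSpace ℝ (Fin 3)} (hx : cylRadius x ≠ 0) :
    radVelQuot (fun y => ν • (Δ (curl u)) y - fderiv ℝ (curl u) y (u y) +
        fderiv ℝ u y (curl u y)) x + fderiv ℝ (radVelQuot (curl u)) x (u x) =
      ν * ((Δ (radVelQuot (curl u))) x + 2 * radDerivQuot (radVelQuot (curl u)) x) +
        fderiv ℝ (radVelQuot u) x (curl u x) := by
  set W : EuclideanSpace ℝ (Fin 3) → EuclideanSpace ℝ (Fin 3) := fun y =>
    ν • (Δ (curl u)) y - fderiv ℝ (curl u) y (u y) + fderiv ℝ u y (curl u y) with hWdef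
  -- regularity
  have hv2 : ContDiff ℝ 2 u := hu.of_le (by norm_cast)
  have hv3 : ContDiff ℝ 3 u := hu.of_le (by norm_cast)
  have hvd : Differentiable ℝ u := hu.differentiable (by simp)
  have hω : ContDiff ℝ ∞ (curl u) := contDiff_curl (n := ⊤) (by exact_mod_cast hu)
  have hω2 : ContDiff ℝ 2 (curl u) := hω.of_le (by norm_cast)
  have hω4 : ContDiff ℝ 4 (curl u) := hω.of_le (by norm_cast)
  have hωd : Differentiable ℝ (curl u) := hω.differentiable (by simp)
  have haxω : IsAxisymmetric (curl u) := hax.curl hvd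
  have hW : ContDiff ℝ ∞ W := contDiff_vorticityRHS hu ν
  have hW2 : ContDiff ℝ 2 W := hW.of_le (by norm_cast)
  have hWax : IsAxisymmetric W := isAxisymmetric_vorticityRHS hax (hu.of_le (by norm_cast)) ν
  have hJ : ContDiff ℝ 2 (radVelQuot (curl u)) := contDiff_radVelQuot (n := 2) hω4
  have hJax : IsAxisymmetricScalar (radVelQuot (curl u)) := haxω.isAxisymmetricScalar_radVelQuot hω2
  have hWr : ContDiff ℝ 1 (radVelQuot u) := contDiff_radVelQuot (n := 1) hv3
  have hWrd : Differentiable ℝ (radVelQuot u) := hWr.differentiable one_ne_zero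
  have hρd : Differentiable ℝ (fun y : EuclideanSpace ℝ (Fin 3) => y 0 ^ 2 + y 1 ^ 2) :=
    contDiff_horizSq.differentiable two_ne_zero
  have hρx : x 0 ^ 2 + x 1 ^ 2 ≠ 0 := by
    rwa [sq_add_sq_eq_cylRadius_sq, pow_ne_zero_iff two_ne_zero]
  -- the components of `W x`
  have hφ : x 0 * W x 0 + x 1 * W x 1 =
      x 0 * (ν * (Δ (curl u)) x 0 - fderiv ℝ (curl u) x (u x) 0 + fderiv ℝ u x (curl u x) 0) +
      x 1 * (ν * (Δ (curl u)) x 1 - fderiv ℝ (curl u) x (u x) 1 + fderiv ℝ u x (curl u x) 1) := by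
    simp only [hWdef, PiLp.add_apply, PiLp.sub_apply, PiLp.smul_apply, smul_eq_mul]
  -- (i) the "time derivative": `⟪x_h, W⟫ = ρ radVelQuot W`
  have ht1 : x 0 * W x 0 + x 1 * W x 1 = (x 0 ^ 2 + x 1 ^ 2) * radVelQuot W x := by
    rw [sq_add_sq_eq_cylRadius_sq, hWax.cylRadius_sq_mul_radVelQuot hW2 x]
  -- (ii) transport: `⟪x_h, Dω[u]⟫ = DΣ[u] − ⟪u_h, ω_h⟫`
  have htr := fderiv_horizontal_inner_apply (hωd x) (u x)
  -- (iii) stretching: `⟪x_h, Du[ω]⟫ = DP[ω] − ⟪ω_h, u_h⟫`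
  have hst := fderiv_horizontal_inner_apply (hvd x) (curl u x)
  -- (iv) viscosity: `⟪x_h, Δω⟫ = ΔΣ − (2/ρ) DΣ[x_h]`
  have hlap := laplacian_horizontal_inner hω2 x
  have hdivH := haxω.mul_divH_eq_fderiv_horizontal_inner (hωd x)
  have hvisc : x 0 * (Δ (curl u)) x 0 + x 1 * (Δ (curl u)) x 1 =
      (Δ (fun y : EuclideanSpace ℝ (Fin 3) => y 0 * curl u y 0 + y 1 * curl u y 1)) x -
        2 / (x 0 ^ 2 + x 1 ^ 2) *
          fderiv ℝ (fun y => y 0 * curl u y 0 + y 1 * curl u y 1) x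
            ((x 0) • EuclideanSpace.single 0 1 + (x 1) • EuclideanSpace.single 1 1) := by
    rw [hlap, ← hdivH]
    field_simp
    ring
  -- the equation of `Σ = ⟪x_h, ω⟫`: `ρ(radVelQuot W) + DΣ[u] = ν (ΔΣ − (2/ρ) DΣ[x_h]) + DP[ω]`
  have hpde : (x 0 ^ 2 + x 1 ^ 2) * radVelQuot W x +
      fderiv ℝ (fun y => y 0 * curl u y 0 + y 1 * curl u y 1) x (u x) =
      ν * ((Δ (fun y : EuclideanSpace ℝ (Fin 3) => y 0 * curl u y 0 + y 1 * curl u y 1)) x -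
        2 / (x 0 ^ 2 + x 1 ^ 2) *
          fderiv ℝ (fun y => y 0 * curl u y 0 + y 1 * curl u y 1) x
            ((x 0) • EuclideanSpace.single 0 1 + (x 1) • EuclideanSpace.single 1 1)) +
        fderiv ℝ (fun y => y 0 * u y 0 + y 1 * u y 1) x (curl u x) := by
    rw [← ht1, htr, ← hvisc, hst]
    linear_combination hφ
  -- `Σ = ρ J`, `P = ρ (u_r/r)` as functions
  have hSig : (fun y : EuclideanSpace ℝ (Fin 3) => y 0 * curl u y 0 + y 1 * curl u y 1) =
      fun y => (y 0 ^ 2 + y 1 ^ 2) * radVelQuot (curl u) y := by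
    funext y
    rw [sq_add_sq_eq_cylRadius_sq, haxω.cylRadius_sq_mul_radVelQuot hω2 y]
  have hP : (fun y : EuclideanSpace ℝ (Fin 3) => y 0 * u y 0 + y 1 * u y 1) =
      fun y => (y 0 ^ 2 + y 1 ^ 2) * radVelQuot u y := by
    funext y
    rw [sq_add_sq_eq_cylRadius_sq, hax.cylRadius_sq_mul_radVelQuot hv2 y]
  rw [hSig, hP] at hpde
  -- the template, with `R = DP[ω]`
  have key := template_quotient_eq hJ hρx (ν := ν)
    (R := fderiv ℝ (fun y : EuclideanSpace ℝ (Fin 3) => (y 0 ^ 2 + y 1 ^ 2) * radVelQuot u y) x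
      (curl u x)) (c := u x) (σ' := radVelQuot W x) (by linarith [hpde])
  -- `DP[ω] = ρ (2 J (u_r/r) + D(u_r/r)[ω])`
  have hR : fderiv ℝ (fun y : EuclideanSpace ℝ (Fin 3) => (y 0 ^ 2 + y 1 ^ 2) * radVelQuot u y) x
      (curl u x) = (x 0 ^ 2 + x 1 ^ 2) * (2 * radVelQuot (curl u) x * radVelQuot u x +
        fderiv ℝ (radVelQuot u) x (curl u x)) := by
    rw [fderiv_fun_mul (hρd x) (hWrd x)]
    simp only [_root_.add_apply, _root_.FunLike.coe_smul, Pi.smul_apply, smul_eq_mul,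
      fderiv_rho_apply]
    have e : x 0 * curl u x 0 + x 1 * curl u x 1 = (x 0 ^ 2 + x 1 ^ 2) * radVelQuot (curl u) x := by
      rw [sq_add_sq_eq_cylRadius_sq, haxω.cylRadius_sq_mul_radVelQuot hω2 x]
    rw [e]
    ring
  rw [fderiv_apply_horizontal_eq hJ hJax, ← sq_add_sq_eq_cylRadius_sq,
    ← hax.cylRadius_sq_mul_radVelQuot hv2 x, ← sq_add_sq_eq_cylRadius_sq, hR] at key
  have e1 : 2 * radVelQuot (curl u) x * ((x 0 ^ 2 + x 1 ^ 2) * radVelQuot u x) /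
      (x 0 ^ 2 + x 1 ^ 2) = 2 * radVelQuot (curl u) x * radVelQuot u x := by
    field_simp
  have e2 : 2 / (x 0 ^ 2 + x 1 ^ 2) * ((x 0 ^ 2 + x 1 ^ 2) * radDerivQuot (radVelQuot (curl u)) x) =
      2 * radDerivQuot (radVelQuot (curl u)) x := by
    field_simp
  have e3 : (x 0 ^ 2 + x 1 ^ 2) * (2 * radVelQuot (curl u) x * radVelQuot u x +
      fderiv ℝ (radVelQuot u) x (curl u x)) / (x 0 ^ 2 + x 1 ^ 2) =
      2 * radVelQuot (curl u) x * radVelQuot u x + fderiv ℝ (radVelQuot u) x (curl u x) := by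
    field_simp
  rw [e1, e2, e3] at key
  linarith

/-- **Seregin's `Φ`-equation as an identity of smooth functions on `ℝ³`** (Step 3:
"`∂ₜΦ + (v − 2x'/|x'|²)·∇Φ − ΔΦ − ω·∇(v_r/r) = 0`", with `∂ₜΦ` rendered by `radVelQuot W`,
`W = νΔω − Dω[u] + Du[ω]`): for an axisymmetric `u ∈ C^∞(ℝ³)`, at EVERY `x`,
`radVelQuot W x + DΦ(x)[u x] = ν (ΔΦ(x) + 2 radDerivQuot Φ x) + D(radVelQuot u)(x)[curl u x]`
(`Φ = radVelQuot (curl u)`). [cite: Seregin2022LocalAxisym, §2 Step 3 (arXiv:2201.00153 p. 6, the equation of Φ)] -/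
theorem radVelQuot_vorticityRHS_eq : ∀ (u : EuclideanSpace ℝ (Fin 3) → EuclideanSpace ℝ (Fin 3)) (ν : ℝ), ContDiff ℝ (⊤ : ℕ∞) u → IsAxisymmetric u → ∀ x : EuclideanSpace ℝ (Fin 3), radVelQuot (fun y => ν • (Δ (curl u)) y - fderiv ℝ (curl u) y (u y) + fderiv ℝ u y (curl u y)) x + fderiv ℝ (radVelQuot (curl u)) x (u x) = ν * ((Δ (radVelQuot (curl u))) x + 2 * radDerivQuot (radVelQuot (curl u)) x) + fderiv ℝ (radVelQuot u) x (curl u x) := by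
  intro u ν hu hax x
  have hv3 : ContDiff ℝ 3 u := hu.of_le (by norm_cast)
  have hω : ContDiff ℝ ∞ (curl u) := contDiff_curl (n := ⊤) (by exact_mod_cast hu)
  have hω4 : ContDiff ℝ 4 (curl u) := hω.of_le (by norm_cast)
  have hW : ContDiff ℝ ∞ fun y => ν • (Δ (curl u)) y - fderiv ℝ (curl u) y (u y) +
      fderiv ℝ u y (curl u y) := contDiff_vorticityRHS hu ν
  have hW3 : ContDiff ℝ 3 fun y => ν • (Δ (curl u)) y - fderiv ℝ (curl u) y (u y) +
      fderiv ℝ u y (curl u y) := hW.of_le (by norm_cast)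
  have hJ2 : ContDiff ℝ 2 (radVelQuot (curl u)) := contDiff_radVelQuot (n := 2) hω4
  have hJ' : ContDiff ℝ 1 (radVelQuot fun y => ν • (Δ (curl u)) y - fderiv ℝ (curl u) y (u y) +
      fderiv ℝ u y (curl u y)) := contDiff_radVelQuot (n := 1) hW3
  have hWr : ContDiff ℝ 1 (radVelQuot u) := contDiff_radVelQuot (n := 1) hv3
  have hL : Continuous fun y => radVelQuot (fun y => ν • (Δ (curl u)) y -
      fderiv ℝ (curl u) y (u y) + fderiv ℝ u y (curl u y)) y +
      fderiv ℝ (radVelQuot (curl u)) y (u y) :=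
    hJ'.continuous.add ((hJ2.continuous_fderiv two_ne_zero).clm_apply hu.continuous)
  have hR : Continuous fun y => ν * ((Δ (radVelQuot (curl u))) y +
      2 * radDerivQuot (radVelQuot (curl u)) y) + fderiv ℝ (radVelQuot u) y (curl u y) := by
    refine (continuous_const.mul ((continuous_laplacian hJ2).add
      (continuous_const.mul (continuous_radDerivQuot hJ2)))).add ?_
    exact (hWr.continuous_fderiv one_ne_zero).clm_apply hω.continuous
  refine eq_of_eq_off_ker (EuclideanSpace.proj (0 : Fin 3)) ⟨EuclideanSpace.single 0 1, by simp⟩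
    hL hR (fun z hz => ?_) x
  have hz0 : z 0 ≠ 0 := by simpa using hz
  have hzr : cylRadius z ≠ 0 := fun h => hz0 ((cylRadius_eq_zero_iff z).1 h).1
  exact radVelQuot_vorticityRHS_eq_of_ne hu hax ν hzr

end SliceEquations

/-! ### The time derivatives of `Γ` and `Φ` off the axis from the pointwise vorticity equation -/

section TimeDerivative

variable {S : Set ℝ} {v : ℝ → EuclideanSpace ℝ (Fin 3) → EuclideanSpace ℝ (Fin 3)}
  {W : EuclideanSpace ℝ (Fin 3) → EuclideanSpace ℝ (Fin 3)} {t : ℝ} {x : EuclideanSpace ℝ (Fin 3)}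

/-- **`∂ₜΓ = angVelQuot (∂ₜω)` off the axis.** Let `v` have `C³` axisymmetric slices on an open
time set `S ∋ t`, let `cylRadius x ≠ 0`, and suppose the time line `s ↦ curl (v s) x` of the
vorticity at `x` has derivative `W x` at `t` for an axisymmetric `W ∈ C²` (the vorticity equation:
`W = Δω − Dω[v] + Dv[ω]`). Then `s ↦ Γ(s, x) = angVortQuot (v s) x` has derivative
`angVelQuot W x` at `t`: off the axis `Γ = ⟪Jx, ω⟫/r²` along the whole time line and
`angVelQuot W = ⟪Jx, W⟫/r²`. [folklore]
[cite: Seregin2022LocalAxisym, §2 proof of Thm. 1.2, Step 3 (arXiv:2201.00153 pp. 4–7) (source of the ARGUMENT this module implements; this declaration is the cell’s own lemma or plumbing, NOT a printed statement)] -/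
theorem hasDerivAt_angVortQuot_of_ne (hS : IsOpen S) (hv : ∀ s ∈ S, ContDiff ℝ 3 (v s))
    (hax : ∀ s ∈ S, IsAxisymmetric (v s)) (ht : t ∈ S) (hx : cylRadius x ≠ 0)
    (hW : ContDiff ℝ 2 W) (hWax : IsAxisymmetric W)
    (hder : HasDerivAt (fun s => curl (v s) x) (W x) t) :
    HasDerivAt (fun s => angVortQuot (v s) x) (angVelQuot W x) t := by
  have hr2 : cylRadius x ^ 2 ≠ 0 := pow_ne_zero 2 hx
  have h1 : HasDerivAt (fun s => ⟪rotGen x, curl (v s) x⟫) (⟪rotGen x, W x⟫) t := by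
    simpa using (hasDerivAt_const t (rotGen x)).inner ℝ hder
  have h2 : HasDerivAt (fun s => (cylRadius x ^ 2)⁻¹ * ⟪rotGen x, curl (v s) x⟫)
      ((cylRadius x ^ 2)⁻¹ * ⟪rotGen x, W x⟫) t := h1.const_mul _
  have hval : (cylRadius x ^ 2)⁻¹ * ⟪rotGen x, W x⟫ = angVelQuot W x := by
    have hsw : ⟪rotGen x, W x⟫ = cylRadius x ^ 2 * angVelQuot W x := by
      rw [hWax.cylRadius_sq_mul_angVelQuot hW x]
      exact (congrFun (swirl_eq_inner_rotGen W) x).symm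
    rw [hsw, ← mul_assoc, inv_mul_cancel₀ hr2, one_mul]
  have hev : (fun s => (cylRadius x ^ 2)⁻¹ * ⟪rotGen x, curl (v s) x⟫) =ᶠ[𝓝 t]
      fun s => angVortQuot (v s) x := by
    filter_upwards [hS.mem_nhds ht] with s hs
    have h := (hax s hs).cylRadius_sq_mul_angVortQuot (hv s hs) x
    rw [congrFun (swirl_eq_inner_rotGen (curl (v s))) x] at h
    rw [← h, ← mul_assoc, inv_mul_cancel₀ hr2, one_mul]
  exact (h2.congr_of_eventuallyEq hev.symm).congr_deriv hval

/-- **`∂ₜΦ = radVelQuot (∂ₜω)` off the axis.** Same setting as `hasDerivAt_angVortQuot_of_ne`: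
`s ↦ Φ(s, x) = radVelQuot (curl (v s)) x` has derivative `radVelQuot W x` at `t` (off the axis
`Φ = ⟪x_h, ω⟫/r²`, `radVelQuot W = ⟪x_h, W⟫/r²`). [folklore]
[cite: Seregin2022LocalAxisym, §2 proof of Thm. 1.2, Step 3 (arXiv:2201.00153 pp. 4–7) (source of the ARGUMENT this module implements; this declaration is the cell’s own lemma or plumbing, NOT a printed statement)] -/
theorem hasDerivAt_radVelQuot_curl_of_ne (hS : IsOpen S) (hv : ∀ s ∈ S, ContDiff ℝ 3 (v s))
    (hax : ∀ s ∈ S, IsAxisymmetric (v s)) (ht : t ∈ S) (hx : cylRadius x ≠ 0)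
    (hW : ContDiff ℝ 2 W) (hWax : IsAxisymmetric W)
    (hder : HasDerivAt (fun s => curl (v s) x) (W x) t) :
    HasDerivAt (fun s => radVelQuot (curl (v s)) x) (radVelQuot W x) t := by
  have hr2 : cylRadius x ^ 2 ≠ 0 := pow_ne_zero 2 hx
  have h1 : HasDerivAt (fun s => ⟪(toLp 2 ![x 0, x 1, 0] : EuclideanSpace ℝ (Fin 3)), curl (v s) x⟫)
      (⟪(toLp 2 ![x 0, x 1, 0] : EuclideanSpace ℝ (Fin 3)), W x⟫) t := by
    simpa using (hasDerivAt_const t (toLp 2 ![x 0, x 1, 0] : EuclideanSpace ℝ (Fin 3))).inner ℝ hder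
  have h2 : HasDerivAt (fun s => (cylRadius x ^ 2)⁻¹ *
      ⟪(toLp 2 ![x 0, x 1, 0] : EuclideanSpace ℝ (Fin 3)), curl (v s) x⟫)
      ((cylRadius x ^ 2)⁻¹ * ⟪(toLp 2 ![x 0, x 1, 0] : EuclideanSpace ℝ (Fin 3)), W x⟫) t :=
    h1.const_mul _
  have hval : (cylRadius x ^ 2)⁻¹ * ⟪(toLp 2 ![x 0, x 1, 0] : EuclideanSpace ℝ (Fin 3)), W x⟫ =
      radVelQuot W x := by
    rw [SereginZajaczkowski2007.inner_horizontal_left, ← hWax.cylRadius_sq_mul_radVelQuot hW x, ← mul_assoc,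
      inv_mul_cancel₀ hr2, one_mul]
  have hev : (fun s => (cylRadius x ^ 2)⁻¹ *
      ⟪(toLp 2 ![x 0, x 1, 0] : EuclideanSpace ℝ (Fin 3)), curl (v s) x⟫) =ᶠ[𝓝 t]
      fun s => radVelQuot (curl (v s)) x := by
    filter_upwards [hS.mem_nhds ht] with s hs
    have hω2 : ContDiff ℝ 2 (curl (v s)) := contDiff_curl (n := 2) (by exact_mod_cast hv s hs)
    have haxω : IsAxisymmetric (curl (v s)) :=
      (hax s hs).curl ((hv s hs).differentiable (by norm_cast))
    rw [SereginZajaczkowski2007.inner_horizontal_left, ← haxω.cylRadius_sq_mul_radVelQuot hω2 x, ← mul_assoc,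
      inv_mul_cancel₀ hr2, one_mul]
  exact (h2.congr_of_eventuallyEq hev.symm).congr_deriv hval

end TimeDerivative

end Literature.Analysis.SereginLogSwirlOrigin.EulerScaling

end Part3

/-!
## Part 4 — port of `Summits/NavierStokesRegularity/NavierStokesRegularity/Theorems/AxisymmetricExtremalityAxisymmetricKatoGlobalStubSereginLogSwirlOriginStep3LocalIntegrated.lean` (3 declarations kept)

# Seregin 2022, §2 Step 3 for the LOCAL smooth class (V): localisation of the a.e. time
# derivative to a neighbourhood of the cut-off, the transport term under a LOCAL divergence
# condition, and the fixed-time localised energy inequalities of `Γ`, `Φ` for a smooth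
# axisymmetric slice — crux stmt-NavierStokesRegularity-15453
# (`AxisymmetricExtremality.AxisymmetricKatoGlobal`), line registered, support for stub `stub_sereginLogSwirlOrigin`

Support file (`--supports stmt-NavierStokesRegularity-15453`; theorems only, everything proved)
toward the registered stub `stub_sereginLogSwirlOrigin` = the named fact
`Literature.Analysis.FluidPDE.seregin2022_logSwirl_regularAtOrigin` (G. Seregin, J. Math. Fluid
Mech. 24 (2022), Paper 27 = arXiv:2201.00153, §2), sequel of `…Step3LocalBalance` and
`…Step3LocalEquationsPhi`. In the port of Step 3 to the local Seregin–Zajaczkowski class the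
solution enters through a cut-off globalisation `u = χV` (globally `C^∞` axisymmetric slices),
which solves the vorticity equation and is divergence free only on an open set `W ⊇ supp ζ`
(where `χ = 1`). Accordingly this file provides:

* `integral_cutoff_sq_add_le_of_forall_le_of_ae_on` (registered sub-goal) — the integrated
  localised energy inequality of `…Step3LocalBalance` with the a.e. time-derivative hypothesis
  required only at the points of an open `W ⊇ K` (off `W` nothing: multiply `G`, `G'` by a
  smooth Urysohn function `θ = 1` near `K`, `= 0` off `W` — every integral of the statement
  carries a factor `ζ`, `∇ζ` or `q_ζ`, all vanishing off `K`);
* `integral_sq_mul_mul_fderiv_apply_of_divFreeOn` — the transport term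
  `∫ ζ²G DG[b] = −∫ ζG² Dζ[b]` when `div b = 0` only where `ζ ≠ 0`
  (`∫ θ div b + ∫⟪b, ∇θ⟫ = 0` with `θ = (ζG)²`, `integral_mul_divergence_add_eq_zero_left`);
* `angVortQuot_cutoff_energy_le_local`, `radVelQuot_curl_cutoff_energy_le_local` — **the
  fixed-time localised energy inequalities of Step 3 for a smooth axisymmetric SLICE `u`**
  (arXiv p. 6: "multiply the first equation by `Φη⁶` and the second by `Γη⁶`. After
  integration by parts …", with the axis terms dropped by sign as in `…Step3Gamma`), the
  time derivative rendered by the quotients `angVelQuot W`, `radVelQuot W` of the vorticity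
  right-hand side `W = νΔω − Dω[u] + Du[ω]` (`…Step3LocalEquations(Phi)`:
  `angVelQuot W + DΓ[u] = ν(ΔΓ + 2q_Γ) − 2(u_θ/r)Φ`, `radVelQuot W + DΦ[u] = ν(ΔΦ + 2q_Φ) + D(u_r/r)[ω]`)
  and `div u = 0` only where `ζ ≠ 0`:
  `∫ ζ²Γ (angVelQuot W) + ν∫|∇(ζΓ)|² ≤ ∫ ζΓ²Dζ[u] + ν∫Γ²|∇ζ|² − 2ν∫ζΓ²q_ζ − 2∫ζ²Γ(u_θ/r)Φ`,
  `∫ ζ²Φ (radVelQuot W) + ν∫|∇(ζΦ)|² ≤ ∫ ζΦ²Dζ[u] + ν∫Φ²|∇ζ|² − 2ν∫ζΦ²q_ζ + ∫ζ²Φ D(u_r/r)[ω]`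
  (the generic `integral_cutoff_energy_le` with zero drift, then the local transport identity).
## Mathlib / tree search

Tree: `integral_cutoff_energy_le` (`…Step3Gamma`), `integral_sq_mul_mul_fderiv_apply`
(`…Step3CutoffCalculus`, GLOBAL `div b = 0`), `integral_cutoff_sq_add_le_of_forall_le_of_ae`
(`…Step3LocalBalance`), `angVelQuot_vorticityRHS_eq`, `radVelQuot_vorticityRHS_eq`,
`contDiff_vorticityRHS` (`…Step3LocalEquations(Phi)`), `exists_contDiff_one_nhdsSet_zero_nhdsSet`
(`NSLocalLerayFarFieldTrace`), `integral_mul_divergence_add_eq_zero_left` (`WholeSpaceIBP`),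
`fderiv_eq_zero_of_forall_notMem` (`…CutoffDivCurl`), `integrable_sq_mul_mul`,
`fderiv_mul_apply_of_differentiableAt` (`…Step3CutoffCalculus`). Mathlib:
`InnerProductSpace.toDual_symm_apply` (`⟪∇θ, v⟫ = Dθ v`), `Filter.Eventually.self_of_nhdsSet`.
`lean search 'divFreeOn|cutoff_energy_le_local|_of_ae_on' --decl`: no matches (2026-08-17).

## References

* G. Seregin, J. Math. Fluid Mech. 24 (2022), Paper No. 27 = arXiv:2201.00153, §2 Step 3
  (arXiv pp. 6–7). [`Seregin2022LocalAxisym`]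

Not carried from this source module (not needed by the declarations re-homed here; their consumers are Summits-side): `integral_cutoff_sq_add_le_of_forall_le_of_ae_on`.
-/

section Part4

open _root_.MeasureTheory _root_.Set _root_.Filter _root_.Topology _root_.Function intervalIntegral _root_.Metric
  _root_.InnerProductSpace
open scoped _root_.ENNReal _root_.ContDiff Laplacian RealInnerProductSpace
open Literature.Analysis.FluidPDE

namespace Literature.Analysis.SereginLogSwirlOrigin.EulerScaling

/-! ### The a.e. time derivative is needed only near the cut-off -/

section Localise

end Localise

/-! ### The transport term under a local divergence condition -/

section Transport

variable {ζ G : EuclideanSpace ℝ (Fin 3) → ℝ} {b : EuclideanSpace ℝ (Fin 3) → EuclideanSpace ℝ (Fin 3)}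

/-- **`∫ ζ²G DG[b] = −∫ ζG² Dζ[b]` when `div b = 0` wherever `ζ ≠ 0`** (`ζ ∈ C¹_c`, `G, b ∈ C¹`):
`∫ θ div b + ∫ ⟪b, ∇θ⟫ = 0` for `θ = (ζG)²` (`integral_mul_divergence_add_eq_zero_left`), the
first integrand vanishing identically, and `Dθ[b] = 2ζ²G DG[b] + 2ζG² Dζ[b]`. The local form of
`integral_sq_mul_mul_fderiv_apply` needed for a cut-off globalisation `χV`, divergence free only
where `χ = 1`. [folklore]
[cite: Seregin2022LocalAxisym, §2 proof of Thm. 1.2, Step 3 (arXiv:2201.00153 pp. 4–7) (source of the ARGUMENT this module implements; this declaration is the cell’s own lemma or plumbing, NOT a printed statement)] -/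
theorem integral_sq_mul_mul_fderiv_apply_of_divFreeOn (hζ : ContDiff ℝ 1 ζ) (hζc : HasCompactSupport ζ)
    (hG : ContDiff ℝ 1 G) (hb : ContDiff ℝ 1 b)
    (hdiv : ∀ x, ζ x ≠ 0 → VectorCalculus.divergence b x = 0) :
    ∫ x, ζ x ^ 2 * G x * fderiv ℝ G x (b x) = -∫ x, ζ x * G x ^ 2 * fderiv ℝ ζ x (b x) := by
  have hζd : Differentiable ℝ ζ := hζ.differentiable one_ne_zero
  have hGd : Differentiable ℝ G := hG.differentiable one_ne_zero
  have hF : ContDiff ℝ 1 fun y => (ζ y * G y) * (ζ y * G y) := (hζ.mul hG).mul (hζ.mul hG)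
  have hFc : HasCompactSupport fun y => (ζ y * G y) * (ζ y * G y) :=
    (hζc.mul_right).mul_right
  have h0 := integral_mul_divergence_add_eq_zero_left hF hb hFc
  have hzero : ∫ x, (ζ x * G x) * (ζ x * G x) * VectorCalculus.divergence b x = 0 := by
    refine integral_eq_zero_of_ae (Eventually.of_forall fun x => ?_)
    by_cases hx : ζ x = 0 <;> simp [hx, hdiv x]
  rw [hzero, zero_add] at h0
  have hpt : ∀ x, ⟪b x, gradient (fun y => (ζ y * G y) * (ζ y * G y)) x⟫ =
      2 * (ζ x ^ 2 * G x * fderiv ℝ G x (b x)) + 2 * (ζ x * G x ^ 2 * fderiv ℝ ζ x (b x)) := by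
    intro x
    rw [real_inner_comm, gradient, InnerProductSpace.toDual_symm_apply,
      fderiv_mul_apply_of_differentiableAt ((hζd x).fun_mul (hGd x)) ((hζd x).fun_mul (hGd x)),
      fderiv_mul_apply_of_differentiableAt (hζd x) (hGd x)]
    ring
  have hDb : Continuous fun x => fderiv ℝ G x (b x) := (hG.continuous_fderiv one_ne_zero).clm_apply hb.continuous
  have hDζb : Continuous fun x => fderiv ℝ ζ x (b x) := (hζ.continuous_fderiv one_ne_zero).clm_apply hb.continuous
  have i1 : Integrable (fun x => ζ x ^ 2 * G x * fderiv ℝ G x (b x)) :=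
    integrable_sq_mul_mul hζ.continuous hζc hG.continuous hDb
  have i2 : Integrable (fun x => ζ x * G x ^ 2 * fderiv ℝ ζ x (b x)) :=
    ((hζ.continuous.mul (hG.continuous.pow 2)).mul hDζb).integrable_of_hasCompactSupport (hζc.mul_right).mul_right
  rw [integral_congr_ae (Eventually.of_forall hpt), integral_add (i1.const_mul 2) (i2.const_mul 2),
    MeasureTheory.integral_const_mul, MeasureTheory.integral_const_mul] at h0
  linarith

end Transport

/-! ### The fixed-time localised energy inequalities of `Γ`, `Φ` for a smooth axisymmetric slice -/

section FixedTime

variable {u : EuclideanSpace ℝ (Fin 3) → EuclideanSpace ℝ (Fin 3)} {ζ : EuclideanSpace ℝ (Fin 3) → ℝ} {ν : ℝ}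

/-- **Seregin 2022, §2 Step 3, the localised energy inequality of `Γ = ω_θ/r` at a fixed time,
for a smooth axisymmetric slice** (no solution class, no time): for an axisymmetric
`u ∈ C^∞(ℝ³)` with `div u = 0` where `ζ ≠ 0`, an axisymmetric cut-off `ζ ∈ C²_c`, `ν ≥ 0`, and
the vorticity right-hand side `W = νΔω − Dω[u] + Du[ω]` (whose quotient `angVelQuot W` is `∂ₜΓ`
along a solution, `hasDerivAt_angVortQuot_of_ne`):
`∫ ζ²Γ (angVelQuot W) + ν∫|∇(ζΓ)|² ≤ ∫ ζΓ² Dζ[u] + ν∫ Γ²|∇ζ|² − 2ν∫ ζΓ² q_ζ − 2∫ ζ²Γ (u_θ/r) Φ`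
(`Γ = angVortQuot u`, `Φ = radVelQuot (curl u)`, `u_θ/r = angVelQuot u`; the axis term dropped
by sign). From `integral_cutoff_energy_le` with zero drift and `G' = angVelQuot W + DΓ[u]`
(the slice identity `angVelQuot_vorticityRHS_eq`), and the local transport identity.
[cite: Seregin2022LocalAxisym, §2 Step 3 (arXiv:2201.00153 p. 6, the identity for Γη⁶ with B₁, B₂, B₃)] -/
theorem angVortQuot_cutoff_energy_le_local (hu : ContDiff ℝ ∞ u) (hax : IsAxisymmetric u)
    (hν : 0 ≤ ν) (hζ : ContDiff ℝ 2 ζ) (hζax : IsAxisymmetricScalar ζ) (hζc : HasCompactSupport ζ)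
    (hdiv : ∀ x, ζ x ≠ 0 → VectorCalculus.divergence u x = 0) :
    (∫ x, ζ x ^ 2 * angVortQuot u x * angVelQuot (fun y => ν • (Δ (curl u)) y -
        fderiv ℝ (curl u) y (u y) + fderiv ℝ u y (curl u y)) x) +
      ν * ∫ x, (fderiv ℝ (fun y => ζ y * angVortQuot u y) x (EuclideanSpace.single 0 1) ^ 2 +
        fderiv ℝ (fun y => ζ y * angVortQuot u y) x (EuclideanSpace.single 1 1) ^ 2 +
        fderiv ℝ (fun y => ζ y * angVortQuot u y) x (EuclideanSpace.single 2 1) ^ 2) ≤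
      (∫ x, ζ x * angVortQuot u x ^ 2 * fderiv ℝ ζ x (u x)) +
      ν * (∫ x, angVortQuot u x ^ 2 * (fderiv ℝ ζ x (EuclideanSpace.single 0 1) ^ 2 +
        fderiv ℝ ζ x (EuclideanSpace.single 1 1) ^ 2 + fderiv ℝ ζ x (EuclideanSpace.single 2 1) ^ 2)) -
      2 * ν * (∫ x, ζ x * angVortQuot u x ^ 2 * radDerivQuot ζ x) -
      2 * ∫ x, ζ x ^ 2 * angVortQuot u x * (angVelQuot u x * radVelQuot (curl u) x) := by
  set W : EuclideanSpace ℝ (Fin 3) → EuclideanSpace ℝ (Fin 3) := fun y =>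
    ν • (Δ (curl u)) y - fderiv ℝ (curl u) y (u y) + fderiv ℝ u y (curl u y) with hWdef
  have hv1 : ContDiff ℝ 1 u := hu.of_le (by norm_cast)
  have hv3 : ContDiff ℝ 3 u := hu.of_le (by norm_cast)
  have hv4 : ContDiff ℝ 4 u := hu.of_le (by norm_cast)
  have hv5 : ContDiff ℝ 5 u := hu.of_le (by norm_cast)
  have hω : ContDiff ℝ ∞ (curl u) := contDiff_curl (n := ⊤) (by exact_mod_cast hu)
  have hω4 : ContDiff ℝ 4 (curl u) := hω.of_le (by norm_cast)
  have hW : ContDiff ℝ ∞ W := contDiff_vorticityRHS hu ν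
  have hW4 : ContDiff ℝ 4 W := hW.of_le (by norm_cast)
  have hΩ2 : ContDiff ℝ 2 (angVortQuot u) := contDiff_angVortQuot (n := 2) hv5
  have hΩ1 : ContDiff ℝ 1 (angVortQuot u) := hΩ2.of_le (by norm_num)
  have hΩax : IsAxisymmetricScalar (angVortQuot u) := hax.isAxisymmetricScalar_angVortQuot hv3
  have hΩ' : ContDiff ℝ 2 (angVelQuot W) := contDiff_angVelQuot (n := 2) hW4
  have hΦ : ContDiff ℝ 2 (angVelQuot u) := contDiff_angVelQuot (n := 2) hv4
  have hJ : ContDiff ℝ 2 (radVelQuot (curl u)) := contDiff_radVelQuot (n := 2) hω4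
  have hR : Continuous fun x => (-2) * (angVelQuot u x * radVelQuot (curl u) x) :=
    continuous_const.mul (hΦ.continuous.mul hJ.continuous)
  have hb0 : ContDiff ℝ 1 (0 : EuclideanSpace ℝ (Fin 3) → EuclideanSpace ℝ (Fin 3)) := contDiff_const
  have hdiv0 : VectorCalculus.IsDivFree (0 : EuclideanSpace ℝ (Fin 3) → EuclideanSpace ℝ (Fin 3)) :=
    fun x => by simp [VectorCalculus.divergence]
  have heq : ∀ x, (angVelQuot W x + fderiv ℝ (angVortQuot u) x (u x)) +
      fderiv ℝ (angVortQuot u) x ((0 : EuclideanSpace ℝ (Fin 3) → EuclideanSpace ℝ (Fin 3)) x) =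
      ν * ((Δ (angVortQuot u)) x + 2 * radDerivQuot (angVortQuot u) x) +
        (-2) * (angVelQuot u x * radVelQuot (curl u) x) := fun x => by
    rw [Pi.zero_apply, map_zero, add_zero, angVelQuot_vorticityRHS_eq u ν hu hax x]
    ring
  have h := integral_cutoff_energy_le (G' := fun x => angVelQuot W x + fderiv ℝ (angVortQuot u) x (u x))
    hΩ2 hΩax hζ hζax hζc hν hR hb0 hdiv0 heq
  -- the zero-drift cut-off term vanishes, the transport term is local, the source is `B₃`
  have hz : ∫ x, ζ x * angVortQuot u x ^ 2 *
      fderiv ℝ ζ x ((0 : EuclideanSpace ℝ (Fin 3) → EuclideanSpace ℝ (Fin 3)) x) = 0 := by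
    simp
  have htr := integral_sq_mul_mul_fderiv_apply_of_divFreeOn (hζ.of_le (by norm_num)) hζc hΩ1 hv1 hdiv
  have iA : Integrable (fun x => ζ x ^ 2 * angVortQuot u x * angVelQuot W x) :=
    integrable_sq_mul_mul hζ.continuous hζc hΩ2.continuous hΩ'.continuous
  have iT : Integrable (fun x => ζ x ^ 2 * angVortQuot u x * fderiv ℝ (angVortQuot u) x (u x)) :=
    integrable_sq_mul_mul hζ.continuous hζc hΩ2.continuous
      ((hΩ2.continuous_fderiv two_ne_zero).clm_apply hu.continuous)
  have hsplit : ∫ x, ζ x ^ 2 * angVortQuot u x * (angVelQuot W x + fderiv ℝ (angVortQuot u) x (u x)) =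
      (∫ x, ζ x ^ 2 * angVortQuot u x * angVelQuot W x) +
        ∫ x, ζ x ^ 2 * angVortQuot u x * fderiv ℝ (angVortQuot u) x (u x) := by
    rw [← integral_add iA iT]
    exact integral_congr_ae (Eventually.of_forall fun x => by ring)
  have hsrc : ∫ x, ζ x ^ 2 * angVortQuot u x * ((-2) * (angVelQuot u x * radVelQuot (curl u) x)) =
      -2 * ∫ x, ζ x ^ 2 * angVortQuot u x * (angVelQuot u x * radVelQuot (curl u) x) := by
    rw [← MeasureTheory.integral_const_mul]
    exact integral_congr_ae (Eventually.of_forall fun x => by ring)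
  rw [hsplit, hz, hsrc] at h
  linarith

/-- **Seregin 2022, §2 Step 3, the localised energy inequality of `Φ = ω_r/r` at a fixed time,
for a smooth axisymmetric slice**: same setting as `angVortQuot_cutoff_energy_le_local`, with
`Φ = radVelQuot (curl u)`, `radVelQuot W` for `∂ₜΦ`, and the source `D(u_r/r)[ω]`:
`∫ ζ²Φ (radVelQuot W) + ν∫|∇(ζΦ)|² ≤ ∫ ζΦ² Dζ[u] + ν∫ Φ²|∇ζ|² − 2ν∫ ζΦ² q_ζ + ∫ ζ²Φ D(u_r/r)[ω]`.
[cite: Seregin2022LocalAxisym, §2 Step 3 (arXiv:2201.00153 p. 6, the identity for Φη⁶ with A₁, A₂, A₃)] -/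
theorem radVelQuot_curl_cutoff_energy_le_local (hu : ContDiff ℝ ∞ u) (hax : IsAxisymmetric u)
    (hν : 0 ≤ ν) (hζ : ContDiff ℝ 2 ζ) (hζax : IsAxisymmetricScalar ζ) (hζc : HasCompactSupport ζ)
    (hdiv : ∀ x, ζ x ≠ 0 → VectorCalculus.divergence u x = 0) :
    (∫ x, ζ x ^ 2 * radVelQuot (curl u) x * radVelQuot (fun y => ν • (Δ (curl u)) y -
        fderiv ℝ (curl u) y (u y) + fderiv ℝ u y (curl u y)) x) +
      ν * ∫ x, (fderiv ℝ (fun y => ζ y * radVelQuot (curl u) y) x (EuclideanSpace.single 0 1) ^ 2 +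
        fderiv ℝ (fun y => ζ y * radVelQuot (curl u) y) x (EuclideanSpace.single 1 1) ^ 2 +
        fderiv ℝ (fun y => ζ y * radVelQuot (curl u) y) x (EuclideanSpace.single 2 1) ^ 2) ≤
      (∫ x, ζ x * radVelQuot (curl u) x ^ 2 * fderiv ℝ ζ x (u x)) +
      ν * (∫ x, radVelQuot (curl u) x ^ 2 * (fderiv ℝ ζ x (EuclideanSpace.single 0 1) ^ 2 +
        fderiv ℝ ζ x (EuclideanSpace.single 1 1) ^ 2 + fderiv ℝ ζ x (EuclideanSpace.single 2 1) ^ 2)) -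
      2 * ν * (∫ x, ζ x * radVelQuot (curl u) x ^ 2 * radDerivQuot ζ x) +
      ∫ x, ζ x ^ 2 * radVelQuot (curl u) x * fderiv ℝ (radVelQuot u) x (curl u x) := by
  set W : EuclideanSpace ℝ (Fin 3) → EuclideanSpace ℝ (Fin 3) := fun y =>
    ν • (Δ (curl u)) y - fderiv ℝ (curl u) y (u y) + fderiv ℝ u y (curl u y) with hWdef
  have hv1 : ContDiff ℝ 1 u := hu.of_le (by norm_cast)
  have hv3 : ContDiff ℝ 3 u := hu.of_le (by norm_cast)
  have hvd : Differentiable ℝ u := hu.differentiable (by simp)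
  have hω : ContDiff ℝ ∞ (curl u) := contDiff_curl (n := ⊤) (by exact_mod_cast hu)
  have hω2 : ContDiff ℝ 2 (curl u) := hω.of_le (by norm_cast)
  have hω4 : ContDiff ℝ 4 (curl u) := hω.of_le (by norm_cast)
  have haxω : IsAxisymmetric (curl u) := hax.curl hvd
  have hW : ContDiff ℝ ∞ W := contDiff_vorticityRHS hu ν
  have hW3 : ContDiff ℝ 3 W := hW.of_le (by norm_cast)
  have hJ2 : ContDiff ℝ 2 (radVelQuot (curl u)) := contDiff_radVelQuot (n := 2) hω4
  have hJ1 : ContDiff ℝ 1 (radVelQuot (curl u)) := hJ2.of_le (by norm_num)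
  have hJax : IsAxisymmetricScalar (radVelQuot (curl u)) := haxω.isAxisymmetricScalar_radVelQuot hω2
  have hJ' : ContDiff ℝ 1 (radVelQuot W) := contDiff_radVelQuot (n := 1) hW3
  have hWr : ContDiff ℝ 1 (radVelQuot u) := contDiff_radVelQuot (n := 1) hv3
  have hR : Continuous fun x => fderiv ℝ (radVelQuot u) x (curl u x) :=
    (hWr.continuous_fderiv one_ne_zero).clm_apply hω.continuous
  have hb0 : ContDiff ℝ 1 (0 : EuclideanSpace ℝ (Fin 3) → EuclideanSpace ℝ (Fin 3)) := contDiff_const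
  have hdiv0 : VectorCalculus.IsDivFree (0 : EuclideanSpace ℝ (Fin 3) → EuclideanSpace ℝ (Fin 3)) :=
    fun x => by simp [VectorCalculus.divergence]
  have heq : ∀ x, (radVelQuot W x + fderiv ℝ (radVelQuot (curl u)) x (u x)) +
      fderiv ℝ (radVelQuot (curl u)) x ((0 : EuclideanSpace ℝ (Fin 3) → EuclideanSpace ℝ (Fin 3)) x) =
      ν * ((Δ (radVelQuot (curl u))) x + 2 * radDerivQuot (radVelQuot (curl u)) x) +
        fderiv ℝ (radVelQuot u) x (curl u x) := fun x => by
    rw [Pi.zero_apply, map_zero, add_zero, radVelQuot_vorticityRHS_eq u ν hu hax x]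
  have h := integral_cutoff_energy_le (G' := fun x => radVelQuot W x + fderiv ℝ (radVelQuot (curl u)) x (u x))
    hJ2 hJax hζ hζax hζc hν hR hb0 hdiv0 heq
  have hz : ∫ x, ζ x * radVelQuot (curl u) x ^ 2 *
      fderiv ℝ ζ x ((0 : EuclideanSpace ℝ (Fin 3) → EuclideanSpace ℝ (Fin 3)) x) = 0 := by
    simp
  have htr := integral_sq_mul_mul_fderiv_apply_of_divFreeOn (hζ.of_le (by norm_num)) hζc hJ1 hv1 hdiv
  have iA : Integrable (fun x => ζ x ^ 2 * radVelQuot (curl u) x * radVelQuot W x) :=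
    integrable_sq_mul_mul hζ.continuous hζc hJ2.continuous hJ'.continuous
  have iT : Integrable (fun x => ζ x ^ 2 * radVelQuot (curl u) x *
      fderiv ℝ (radVelQuot (curl u)) x (u x)) :=
    integrable_sq_mul_mul hζ.continuous hζc hJ2.continuous
      ((hJ2.continuous_fderiv two_ne_zero).clm_apply hu.continuous)
  have hsplit : ∫ x, ζ x ^ 2 * radVelQuot (curl u) x *
      (radVelQuot W x + fderiv ℝ (radVelQuot (curl u)) x (u x)) =
      (∫ x, ζ x ^ 2 * radVelQuot (curl u) x * radVelQuot W x) +
        ∫ x, ζ x ^ 2 * radVelQuot (curl u) x * fderiv ℝ (radVelQuot (curl u)) x (u x) := by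
    rw [← integral_add iA iT]
    exact integral_congr_ae (Eventually.of_forall fun x => by ring)
  rw [hsplit, hz] at h
  linarith

end FixedTime

end Literature.Analysis.SereginLogSwirlOrigin.EulerScaling

end Part4

/-!
## Part 5 — port of `Summits/NavierStokesRegularity/NavierStokesRegularity/Theorems/AxisymmetricExtremalityAxisymmetricKatoGlobalStubSereginLogSwirlOriginStep3LocalApriori.lean` (5 declarations kept)

# Seregin 2022, §2 Step 3 for the LOCAL smooth class (VI): absorption of `B₃` and the
# a-priori inequality behind the key estimate, for a family of smooth axisymmetric fields
# solving the vorticity equation near the cut-off — crux stmt-NavierStokesRegularity-15453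
# (`AxisymmetricExtremality.AxisymmetricKatoGlobal`), line registered, support for stub `stub_sereginLogSwirlOrigin`

Support file (`--supports stmt-NavierStokesRegularity-15453`; theorems only, everything proved)
toward the registered stub `stub_sereginLogSwirlOrigin` = the named fact
`Literature.Analysis.FluidPDE.seregin2022_logSwirl_regularAtOrigin` (G. Seregin, J. Math. Fluid
Mech. 24 (2022), Paper 27 = arXiv:2201.00153, §2). The sibling `…Step3Absorb` proves the
a-priori inequality of Step 3 (arXiv p. 7: "Combining all the estimates made on this step, we
shall have `½∂ₜ∫(Φη³)² + (Γη³)² + ∫(η³|∇Φ|)² + (η³|∇Γ|)² ≤ …`") for a whole-space classical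
solution `IsClassicalNSSolutionOn (Ioo T₀ T₁) ν 0 v q`. This file proves the same inequality —
same conclusion, same constants — for the input actually available after the first-singular-time
reduction of the fact: a family `v` of globally `C^∞` axisymmetric fields on the open slab
(a cut-off globalisation `χV` of the Seregin–Zajaczkowski representative) which, on an open set
`W` containing the compact `K` off which the cut-off `ζ = η³` vanishes, is divergence free and
solves the VORTICITY equation pointwise off the axis
(`d/ds curl (v s) x = νΔω − Dω[v] + Dv[ω]`, `…Step3LocalClass`), with the time regularity that
class has: `Γ = ω_θ/r`, `Φ = ω_r/r`, their gradients and the quotients `angVelQuot W`,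
`radVelQuot W` of the vorticity right-hand side `W` jointly continuous on the slab (hypotheses;
for `χV` they follow from the joint continuity of the spatial derivatives of `V`).

* `integral_cutoff_sq_sub_eq_of_ae_on` — the energy balance `E(t₂) − E(t₁) = ∫_{t₁}^{t₂}(…)` of
  `…Step3LocalBalance` with the a.e. time derivative required only on `W ⊇ K` (Urysohn `θ`);
* `continuousOn_integral_gradSq_cutoff_of_continuousOn` — continuity in time of the localised
  dissipation `∫|∇(ζG)|²` from joint continuity of `G`, `D_xG`;
* `cutoff_energy_apriori_local` (registered sub-goal) — **the a-priori inequality of Step 3 for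
  the local class**: with `E = ∫(ζΓ)² + ∫(ζΦ)²`, `D = ∫|∇(ζΓ)|² + ∫|∇(ζΦ)|²`, the hypotheses (2.2)
  (`|σ| ≤ C₁/ln³(e/r)`, `r < r₁`), the far-field bound `M`, the cut-off bound `Bcut` and the
  `A₃`-bound `2A₃ ≤ θ_A D + B_A` exactly as in `cutoff_energy_apriori`, for `t ∈ [t₁, t₂]`:
  `E(t) + (2ν − 8C₁/ln(e/r₁) − θ_A)∫_{t₁}^t D ≤ E(t₁) + (Bcut + B_A + 4M|B(0,2)|)(t − t₁)`
  (the fixed-time inequalities `…_cutoff_energy_le_local`, whose `∂ₜ`-terms `∫ζ²Γ(angVelQuot W)`,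
  `∫ζ²Φ(radVelQuot W)` ARE the densities of the balances by `hasDerivAt_angVortQuot_of_ne`,
  `hasDerivAt_radVelQuot_curl_of_ne` off the Lebesgue-null axis; `B₃` by
  `abs_integral_angVelQuot_mul_mul_le` = (2.2) + Lemma 2.2);
* `cutoff_energy_keyEstimate_local` (registered sub-goal) — **the key estimate for the local
  class** under the smallness `8C₁/ln(e/r₁) + θ_A < 2ν`: `sup_{[t₁,t₂]} E ≤ K₀`,
  `∫_{t₁}^{t₂} D ≤ K₀/(2ν − 8C₁/ln(e/r₁) − θ_A)`, `K₀ = E(t₁) + (Bcut + B_A + 4M|B(0,2)|)(t₂ − t₁)`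
  — verbatim the conclusion of `cutoff_energy_keyEstimate`.

## Mathlib / tree search

Tree: `cutoff_energy_apriori`, `cutoff_energy_keyEstimate`, `integral_horizontal_gradSq_le`
(`…Step3Absorb`), `abs_integral_angVelQuot_mul_mul_le`, `log_exp_div_eq` (`…Step3SwirlSource`),
`integral_cutoff_sq_sub_eq_of_ae` (`…Step3LocalBalance`), `angVortQuot_cutoff_energy_le_local`,
`radVelQuot_curl_cutoff_energy_le_local` (`…Step3LocalIntegrated`), `hasDerivAt_angVortQuot_of_ne`,
`hasDerivAt_radVelQuot_curl_of_ne`, `contDiff_vorticityRHS`, `isAxisymmetric_vorticityRHS`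
(`…Step3LocalEquations(Phi)`), `volume_axis_eq_zero` (`AxisymWeights`),
`exists_contDiff_one_nhdsSet_zero_nhdsSet`, `fderiv_eq_zero_of_forall_notMem`,
`fderiv_mul_apply_of_differentiableAt`, `continuousOn_integral_cutoff`.
`lean search 'apriori_local|keyEstimate_local' --decl`: no matches (2026-08-17).

## References

* G. Seregin, J. Math. Fluid Mech. 24 (2022), Paper No. 27 = arXiv:2201.00153, §2 Step 3
  (arXiv p. 7, the a-priori inequality and the key estimate). [`Seregin2022LocalAxisym`]
-/

section Part5

open _root_.MeasureTheory _root_.Set _root_.Filter _root_.Topology _root_.Function _root_.Metric intervalIntegral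
open scoped _root_.ENNReal _root_.ContDiff Laplacian
open Literature.Analysis.FluidPDE

namespace Literature.Analysis.SereginLogSwirlOrigin.EulerScaling

/-! ### Tools: localised balance, continuity of the dissipation, the axis is null -/

section Tools

variable {S : Set ℝ} {ζ G G' : ℝ → EuclideanSpace ℝ (Fin 3) → ℝ} {K W : Set (EuclideanSpace ℝ (Fin 3))}

/-- **The weighted energy balance with the a.e. time derivative required only near the cut-off**:
`integral_cutoff_sq_sub_eq_of_ae` with its hypothesis `d/ds G(s, x) = G'(s, x)` (a.e. `x`)
weakened to a.e. `x ∈ W`, `W` an open neighbourhood of the compact `K` off which `ζ` vanishes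
(apply the sibling to `θG`, `θG'` for a smooth Urysohn `θ`; each integrand carries a factor `ζ`).
[cite: Seregin2022LocalAxisym, §2 Step 3 (arXiv:2201.00153 p. 7, integration in time of the key differential inequality)] -/
theorem integral_cutoff_sq_sub_eq_of_ae_on (hS : IsOpen S) (hζ : IsSmoothSpaceTimeOn S ζ)
    (hK : IsCompact K) (hsupp : ∀ t ∈ S, ∀ x ∉ K, ζ t x = 0) (hW : IsOpen W) (hKW : K ⊆ W)
    (hG : ContinuousOn (uncurry G) (S ×ˢ univ)) (hG' : ContinuousOn (uncurry G') (S ×ˢ univ))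
    (hder : ∀ᵐ x ∂(volume : Measure (EuclideanSpace ℝ (Fin 3))), x ∈ W → ∀ s ∈ S,
      HasDerivAt (fun s' => G s' x) (G' s x) s)
    {t₁ t₂ : ℝ} (h12 : t₁ ≤ t₂) (hsub : Icc t₁ t₂ ⊆ S) :
    ContinuousOn (fun t => 2 * (∫ x, ζ t x * timeDerivWithin S ζ t x * G t x ^ 2) +
        2 * ∫ x, ζ t x ^ 2 * G t x * G' t x) S ∧
    (∫ x, (ζ t₂ x * G t₂ x) ^ 2) - ∫ x, (ζ t₁ x * G t₁ x) ^ 2 =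
      ∫ t in t₁..t₂, (2 * (∫ x, ζ t x * timeDerivWithin S ζ t x * G t x ^ 2) +
        2 * ∫ x, ζ t x ^ 2 * G t x * G' t x) := by
  obtain ⟨θ, hθ, hθ1, hθ0⟩ := exists_contDiff_one_nhdsSet_zero_nhdsSet hK hW hKW
  have hθK : ∀ x ∈ K, θ x = 1 := fun x hx => hθ1.self_of_nhdsSet x hx
  have hθW : ∀ x ∉ W, θ x = 0 := fun x hx => hθ0.self_of_nhdsSet x hx
  have eE : ∀ s ∈ S, ∀ y, ζ s y * (θ y * G s y) = ζ s y * G s y := by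
    intro s hs y
    by_cases hy : y ∈ K
    · rw [hθK y hy, one_mul]
    · simp [hsupp s hs y hy]
  have e0 : ∀ s ∈ S, ∀ x, ζ s x * timeDerivWithin S ζ s x * (θ x * G s x) ^ 2 =
      ζ s x * timeDerivWithin S ζ s x * G s x ^ 2 := by
    intro s hs x
    by_cases hx : x ∈ K
    · rw [hθK x hx, one_mul]
    · simp [hsupp s hs x hx]
  have e5 : ∀ s ∈ S, ∀ x, ζ s x ^ 2 * (θ x * G s x) * (θ x * G' s x) = ζ s x ^ 2 * G s x * G' s x := by
    intro s hs x
    by_cases hx : x ∈ K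
    · rw [hθK x hx, one_mul, one_mul]
    · simp [hsupp s hs x hx]
  have hGt : ContinuousOn (uncurry fun s x => θ x * G s x) (S ×ˢ univ) :=
    ((hθ.continuous.comp continuous_snd).continuousOn.mul hG).congr fun z _ => rfl
  have hG't : ContinuousOn (uncurry fun s x => θ x * G' s x) (S ×ˢ univ) :=
    ((hθ.continuous.comp continuous_snd).continuousOn.mul hG').congr fun z _ => rfl
  have hdert : ∀ᵐ x ∂(volume : Measure (EuclideanSpace ℝ (Fin 3))), ∀ s ∈ S,
      HasDerivAt (fun s' => θ x * G s' x) (θ x * G' s x) s := by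
    filter_upwards [hder] with x hx s hs
    by_cases hxW : x ∈ W
    · exact (hx hxW s hs).const_mul (θ x)
    · simp only [hθW x hxW, zero_mul]
      exact hasDerivAt_const s 0
  obtain ⟨hdens, hbal⟩ := integral_cutoff_sq_sub_eq_of_ae hS hζ hK hsupp hGt hG't hdert h12 hsub
  refine ⟨hdens.congr fun t ht => ?_, ?_⟩
  · simp only [e0 t ht, e5 t ht]
  · have hI : ∀ t ∈ uIcc t₁ t₂, t ∈ S := fun t ht => hsub (by rwa [uIcc_of_le h12] at ht)
    simp only [eE t₁ (hsub ⟨le_rfl, h12⟩), eE t₂ (hsub ⟨h12, le_rfl⟩)] at hbal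
    rw [hbal]
    exact intervalIntegral.integral_congr fun t ht => by simp only [e0 t (hI t ht), e5 t (hI t ht)]

/-- **Continuity in time of the localised dissipation `∫|∇(ζG)|²`** for `ζ` jointly smooth on the
open `S` vanishing off the compact `K` and `G` with differentiable slices, `G` and `(t, x) ↦ D(G t)(x)`
jointly continuous (`D(ζG) = ζDG + GDζ`). [folklore]
[cite: Seregin2022LocalAxisym, §2 proof of Thm. 1.2, Step 3 (arXiv:2201.00153 pp. 4–7) (source of the ARGUMENT this module implements; this declaration is the cell’s own lemma or plumbing, NOT a printed statement)] -/
theorem continuousOn_integral_gradSq_cutoff_of_continuousOn (hS : IsOpen S) (hζ : IsSmoothSpaceTimeOn S ζ)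
    (hK : IsCompact K) (hsupp : ∀ t ∈ S, ∀ x ∉ K, ζ t x = 0)
    (hG : ContinuousOn (uncurry G) (S ×ˢ univ)) (hGd : ∀ t ∈ S, Differentiable ℝ (G t))
    (hDG : ContinuousOn (fun z : ℝ × EuclideanSpace ℝ (Fin 3) => fderiv ℝ (G z.1) z.2) (S ×ˢ univ)) :
    ContinuousOn (fun t => ∫ x,
      (fderiv ℝ (fun y => ζ t y * G t y) x (EuclideanSpace.single 0 1) ^ 2 +
        fderiv ℝ (fun y => ζ t y * G t y) x (EuclideanSpace.single 1 1) ^ 2 +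
        fderiv ℝ (fun y => ζ t y * G t y) x (EuclideanSpace.single 2 1) ^ 2)) S := by
  have hU : UniqueDiffOn ℝ S := hS.uniqueDiffOn
  have hζc : ContinuousOn (uncurry ζ) (S ×ˢ univ) := hζ.continuousOn
  have hζi : ∀ i : Fin 3, ContinuousOn (uncurry fun s x => fderiv ℝ (ζ s) x (EuclideanSpace.single i 1))
      (S ×ˢ univ) := fun i => (hζ.fderiv_slice_apply hU _).continuousOn
  have hGi : ∀ i : Fin 3, ContinuousOn (fun z : ℝ × EuclideanSpace ℝ (Fin 3) =>
      fderiv ℝ (G z.1) z.2 (EuclideanSpace.single i 1)) (S ×ˢ univ) := fun i =>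
    hDG.clm_apply continuousOn_const
  have hζsd : ∀ t ∈ S, Differentiable ℝ (ζ t) := fun t ht =>
    (hζ.contDiff_slice ht).differentiable (by simp)
  have hDi : ∀ i : Fin 3, ContinuousOn (uncurry fun s x =>
      fderiv ℝ (fun y => ζ s y * G s y) x (EuclideanSpace.single i 1)) (S ×ˢ univ) := by
    intro i
    refine ((hζc.mul (hGi i)).add (hG.mul (hζi i))).congr fun z hz => ?_
    exact fderiv_mul_apply_of_differentiableAt (hζsd z.1 hz.1 z.2) (hGd z.1 hz.1 z.2) _
  have hP0 : ∀ s ∈ S, ∀ x ∉ K, ζ s x * G s x = 0 := fun s hs x hx => by simp [hsupp s hs x hx]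
  have h := (((hDi 0).pow 2).add ((hDi 1).pow 2)).add ((hDi 2).pow 2)
  refine continuousOn_integral_cutoff (Ψ := fun t x =>
    fderiv ℝ (fun y => ζ t y * G t y) x (EuclideanSpace.single 0 1) ^ 2 +
      fderiv ℝ (fun y => ζ t y * G t y) x (EuclideanSpace.single 1 1) ^ 2 +
      fderiv ℝ (fun y => ζ t y * G t y) x (EuclideanSpace.single 2 1) ^ 2) hK
    (h.congr fun z _ => by simp only [uncurry, Pi.add_apply, Pi.pow_apply]) fun t ht x hx => ?_
  have h0 : fderiv ℝ (fun y => ζ t y * G t y) x = 0 :=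
    fderiv_eq_zero_of_forall_notMem hK.isClosed (hP0 t ht) hx
  simp [h0]

/-- Almost every point of `ℝ³` is off the axis (`volume_axis_eq_zero`). [folklore]
[cite: Seregin2022LocalAxisym, §2 proof of Thm. 1.2, Step 3 (arXiv:2201.00153 pp. 4–7) (source of the ARGUMENT this module implements; this declaration is the cell’s own lemma or plumbing, NOT a printed statement)] -/
theorem ae_cylRadius_ne_zero' : ∀ᵐ x ∂(volume : Measure (EuclideanSpace ℝ (Fin 3))), cylRadius x ≠ 0 := by
  rw [ae_iff]
  refine measure_mono_null (fun y hy => ?_) volume_axis_eq_zero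
  have hy' : cylRadius y = 0 := not_not.1 hy
  rw [cylRadius_eq_zero_iff] at hy'
  show y 0 ^ 2 + y 1 ^ 2 = 0
  simp [hy'.1, hy'.2]

end Tools

/-! ### The a-priori inequality and the key estimate for the local class -/

section Apriori

set_option maxHeartbeats 800000 in
/-- **Seregin 2022, §2 Step 3 — the a-priori inequality behind the key estimate, for the LOCAL
smooth class** (arXiv p. 7: "Combining all the estimates made on this step, we shall have
`½∂ₜ∫(Φη³)² + (Γη³)² + ∫(η³|∇Φ|)² + (η³|∇Γ|)² ≤ (cC₁/ln(e/r₁) + cC₁²/ln⁴(e/r₁))‖η³∇Γ‖‖η³∇Φ‖ + …`").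
The statement of `cutoff_energy_apriori` with the classical solution replaced by: a family `v`
of globally `C^∞` axisymmetric fields on the open slab `(T₀, T₁)`, a compact `K` off which the
cut-off `ζ = η³` vanishes and an open `W ⊇ K` on which `div v = 0` and the vorticity equation
holds pointwise off the axis (`d/ds curl (v s) x = νΔω − Dω[v] + Dv[ω]`), and joint continuity on
the slab of `Γ`, `DΓ`, `angVelQuot W` and `Φ`, `DΦ`, `radVelQuot W` (`W` the vorticity right-hand
side). Conclusion, hypotheses (2.2)/`M`/`Bcut`/`θ_A, B_A` and constants verbatim as there:
`E(t) + (2ν − 8C₁/ln(e/r₁) − θ_A)∫_{t₁}^t D ≤ E(t₁) + (Bcut + B_A + 4M|B(0,2)|)(t − t₁)` for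
`t ∈ [t₁, t₂]`. Registered sub-goal toward `stub_sereginLogSwirlOrigin`.
[cite: Seregin2022LocalAxisym, §2 Step 3 (arXiv:2201.00153 p. 7, "Combining all the estimates made on this step")] -/
theorem cutoff_energy_apriori_local : ∀ (T₀ T₁ ν : ℝ) (v : ℝ → EuclideanSpace ℝ (Fin 3) → EuclideanSpace ℝ (Fin 3)) (ζ : ℝ → EuclideanSpace ℝ (Fin 3) → ℝ) (K W : Set (EuclideanSpace ℝ (Fin 3))) (t₁ t₂ C₁ r₁ M θA BA Bcut : ℝ), (∀ s ∈ Ioo T₀ T₁, ContDiff ℝ (⊤ : ℕ∞) (v s)) → (∀ s ∈ Ioo T₀ T₁, IsAxisymmetric (v s)) → 0 ≤ ν → IsSmoothSpaceTimeOn (Ioo T₀ T₁) ζ → (∀ s ∈ Ioo T₀ T₁, IsAxisymmetricScalar (ζ s)) → (∀ s ∈ Ioo T₀ T₁, tsupport (ζ s) ⊆ SereginSverak2009.spaceCyl 0 1) → Icc t₁ t₂ ⊆ Ioo T₀ T₁ → IsCompact K → (∀ s ∈ Ioo T₀ T₁, ∀ x ∉ K, ζ s x = 0) → IsOpen W → K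 ⊆ W → (∀ s ∈ Ioo T₀ T₁, ∀ x ∈ W, VectorCalculus.divergence (v s) x = 0) → (∀ s ∈ Ioo T₀ T₁, ∀ x ∈ W, cylRadius x ≠ 0 → HasDerivAt (fun s' => curl (v s') x) (ν • (Δ (curl (v s))) x - fderiv ℝ (curl (v s)) x (v s x) + fderiv ℝ (v s) x (curl (v s) x)) s) → ContinuousOn (fun z : ℝ × EuclideanSpace ℝ (Fin 3) => angVortQuot (v z.1) z.2) (Ioo T₀ T₁ ×ˢ univ) → ContinuousOn (fun z : ℝ × EuclideanSpace ℝ (Fin 3) => angVelQuot (fun y => ν • (Δ (curl (v z.1))) y - fderiv ℝ (curl (v z.1)) y (v z.1 y) + fderiv ℝ (v z.1) y (curl (v z.1) y)) z.2) (Ioo T₀ T₁ ×ˢ univ) → ContinuousOn (fun z : ℝ × EuclideanSpace ℝ (Fin 3) => fderiv ℝ (angVortQuot (v z.1)) z.2) (Ioo T₀ T₁ ×ˢ univ) → ContinuousOn (fun z : ℝ × EuclideanSpace ℝ (Fin 3) => radVelQuot (curl (v z.1)) z.2) (Ioo T₀ T₁ ×ˢ univ) → ContinuousOn (fun z : ℝ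 × EuclideanSpace ℝ (Fin 3) => radVelQuot (fun y => ν • (Δ (curl (v z.1))) y - fderiv ℝ (curl (v z.1)) y (v z.1 y) + fderiv ℝ (v z.1) y (curl (v z.1) y)) z.2) (Ioo T₀ T₁ ×ˢ univ) → ContinuousOn (fun z : ℝ × EuclideanSpace ℝ (Fin 3) => fderiv ℝ (radVelQuot (curl (v z.1))) z.2) (Ioo T₀ T₁ ×ˢ univ) → 0 ≤ C₁ → 0 < r₁ → r₁ < 1 → 0 ≤ M → (∀ t ∈ Icc t₁ t₂, ∀ x, 0 < cylRadius x → cylRadius x < r₁ → |swirl (v t) x| ≤ C₁ / Real.log (Real.exp 1 / cylRadius x) ^ 3) → (∀ t ∈ Icc t₁ t₂, ∀ x, r₁ ≤ cylRadius x → |angVelQuot (v t) x * (ζ t x * angVortQuot (v t) x) * (ζ t x * radVelQuot (curl (v t)) x)| ≤ M) → (∀ t ∈ Icc t₁ t₂, (2 * (∫ x, ζ t x * timeDerivWithin (Ioo T₀ T₁) ζ t x * angVortQuot (v t) x ^ 2) + 2 * (∫ x, ζ t x * angVortQuot (v t) x ^ 2 * fderiv ℝ (ζ t) x (v t x)) +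 2 * ν * (∫ x, angVortQuot (v t) x ^ 2 * (fderiv ℝ (ζ t) x (EuclideanSpace.single 0 1) ^ 2 + fderiv ℝ (ζ t) x (EuclideanSpace.single 1 1) ^ 2 + fderiv ℝ (ζ t) x (EuclideanSpace.single 2 1) ^ 2)) - 4 * ν * (∫ x, ζ t x * angVortQuot (v t) x ^ 2 * radDerivQuot (ζ t) x)) + (2 * (∫ x, ζ t x * timeDerivWithin (Ioo T₀ T₁) ζ t x * radVelQuot (curl (v t)) x ^ 2) + 2 * (∫ x, ζ t x * radVelQuot (curl (v t)) x ^ 2 * fderiv ℝ (ζ t) x (v t x)) + 2 * ν * (∫ x, radVelQuot (curl (v t)) x ^ 2 * (fderiv ℝ (ζ t) x (EuclideanSpace.single 0 1) ^ 2 + fderiv ℝ (ζ t) x (EuclideanSpace.single 1 1) ^ 2 + fderiv ℝ (ζ t) x (EuclideanSpace.single 2 1) ^ 2)) - 4 * ν * (∫ x, ζ t x * radVelQuot (curl (v t)) x ^ 2 * radDerivQuot (ζ t) x)) ≤ Bcut) → (∀ t ∈ Icc t₁ t₂, 2 * (∫ x, ζ t x ^ 2 * radVelQuot (curl (v t)) x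 * fderiv ℝ (radVelQuot (v t)) x (curl (v t) x)) ≤ θA * ((∫ x, (fderiv ℝ (fun y => ζ t y * angVortQuot (v t) y) x (EuclideanSpace.single 0 1) ^ 2 + fderiv ℝ (fun y => ζ t y * angVortQuot (v t) y) x (EuclideanSpace.single 1 1) ^ 2 + fderiv ℝ (fun y => ζ t y * angVortQuot (v t) y) x (EuclideanSpace.single 2 1) ^ 2)) + (∫ x, (fderiv ℝ (fun y => ζ t y * radVelQuot (curl (v t)) y) x (EuclideanSpace.single 0 1) ^ 2 + fderiv ℝ (fun y => ζ t y * radVelQuot (curl (v t)) y) x (EuclideanSpace.single 1 1) ^ 2 + fderiv ℝ (fun y => ζ t y * radVelQuot (curl (v t)) y) x (EuclideanSpace.single 2 1) ^ 2))) + BA) → ∀ t ∈ Icc t₁ t₂, (∫ x, (ζ t x * angVortQuot (v t) x) ^ 2) + (∫ x, (ζ t x * radVelQuot (curl (v t)) x) ^ 2) + (2 * ν - 8 * C₁ / Real.log (Real.exp 1 / r₁) - θA) * ∫ s in t₁..t, ((∫ x, (fderiv ℝ (fun y => ζ s y * angVortQuot (v s) y) x (EuclideanSpace.single 0 1) ^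 2 + fderiv ℝ (fun y => ζ s y * angVortQuot (v s) y) x (EuclideanSpace.single 1 1) ^ 2 + fderiv ℝ (fun y => ζ s y * angVortQuot (v s) y) x (EuclideanSpace.single 2 1) ^ 2)) + (∫ x, (fderiv ℝ (fun y => ζ s y * radVelQuot (curl (v s)) y) x (EuclideanSpace.single 0 1) ^ 2 + fderiv ℝ (fun y => ζ s y * radVelQuot (curl (v s)) y) x (EuclideanSpace.single 1 1) ^ 2 + fderiv ℝ (fun y => ζ s y * radVelQuot (curl (v s)) y) x (EuclideanSpace.single 2 1) ^ 2))) ≤ (∫ x, (ζ t₁ x * angVortQuot (v t₁) x) ^ 2) + (∫ x, (ζ t₁ x * radVelQuot (curl (v t₁)) x) ^ 2) + (Bcut + BA + 4 * M * volume.real (closedBall (0 : EuclideanSpace ℝ (Fin 3)) 2)) * (t - t₁) := by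
  intro T₀ T₁ ν v ζ K W t₁ t₂ C₁ r₁ M θA BA Bcut hu hax hν hζ hζax hζs hsub hK hsupp hWo hKW hdiv hvort hΓc hΓ'c hDΓc hJc hJ'c hDJc hC₁ hr₁ hr₁1 hM hσ hfar hcut hA3 t ht
  set S : Set ℝ := Ioo T₀ T₁ with hSdef
  have hS : IsOpen S := isOpen_Ioo
  have hv3 : ∀ s ∈ S, ContDiff ℝ 3 (v s) := fun s hs => (hu s hs).of_le (by norm_cast)
  have hW2 : ∀ s ∈ S, ContDiff ℝ 2 (fun y => ν • (Δ (curl (v s))) y - fderiv ℝ (curl (v s)) y (v s y) + fderiv ℝ (v s) y (curl (v s) y)) := fun s hs =>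
    (contDiff_vorticityRHS (hu s hs) ν).of_le (by norm_cast)
  have hWax : ∀ s ∈ S, IsAxisymmetric (fun y => ν • (Δ (curl (v s))) y - fderiv ℝ (curl (v s)) y (v s y) + fderiv ℝ (v s) y (curl (v s) y)) := fun s hs =>
    isAxisymmetric_vorticityRHS (hax s hs) ((hu s hs).of_le (by norm_cast)) ν
  -- name the two time-derivative families `Γ' = angVelQuot W`, `Φ' = radVelQuot W`
  obtain ⟨Γ', hΓ'def⟩ : ∃ Γ' : ℝ → EuclideanSpace ℝ (Fin 3) → ℝ, ∀ s x, Γ' s x = angVelQuot (fun y => ν • (Δ (curl (v s))) y - fderiv ℝ (curl (v s)) y (v s y) + fderiv ℝ (v s) y (curl (v s) y)) x :=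
    ⟨_, fun _ _ => rfl⟩
  obtain ⟨Φ', hΦ'def⟩ : ∃ Φ' : ℝ → EuclideanSpace ℝ (Fin 3) → ℝ, ∀ s x, Φ' s x = radVelQuot (fun y => ν • (Δ (curl (v s))) y - fderiv ℝ (curl (v s)) y (v s y) + fderiv ℝ (v s) y (curl (v s) y)) x :=
    ⟨_, fun _ _ => rfl⟩
  have hΓcU : ContinuousOn (uncurry fun s x => angVortQuot (v s) x) (S ×ˢ univ) := by
    rw [Function.uncurry_def]; exact hΓc
  have hJcU : ContinuousOn (uncurry fun s x => radVelQuot (curl (v s)) x) (S ×ˢ univ) := by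
    rw [Function.uncurry_def]; exact hJc
  have hΓ'cU : ContinuousOn (uncurry Γ') (S ×ˢ univ) := by
    have e : uncurry Γ' = fun z : ℝ × EuclideanSpace ℝ (Fin 3) => angVelQuot (fun y => ν • (Δ (curl (v z.1))) y - fderiv ℝ (curl (v z.1)) y (v z.1 y) + fderiv ℝ (v z.1) y (curl (v z.1) y)) z.2 := by
      funext z; exact hΓ'def z.1 z.2
    rw [e]; exact hΓ'c
  have hΦ'cU : ContinuousOn (uncurry Φ') (S ×ˢ univ) := by
    have e : uncurry Φ' = fun z : ℝ × EuclideanSpace ℝ (Fin 3) => radVelQuot (fun y => ν • (Δ (curl (v z.1))) y - fderiv ℝ (curl (v z.1)) y (v z.1 y) + fderiv ℝ (v z.1) y (curl (v z.1) y)) z.2 := by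
      funext z; exact hΦ'def z.1 z.2
    rw [e]; exact hJ'c
  -- the a.e. time derivatives of `Γ`, `Φ` off the axis, on `W`
  have hderΓ : ∀ᵐ x ∂(volume : Measure (EuclideanSpace ℝ (Fin 3))), x ∈ W → ∀ s ∈ S,
      HasDerivAt (fun s' => angVortQuot (v s') x) (Γ' s x) s := by
    filter_upwards [ae_cylRadius_ne_zero'] with x hx hxW s hs
    rw [hΓ'def]
    exact hasDerivAt_angVortQuot_of_ne hS hv3 hax hs hx (hW2 s hs) (hWax s hs) (hvort s hs x hxW hx)
  have hderJ : ∀ᵐ x ∂(volume : Measure (EuclideanSpace ℝ (Fin 3))), x ∈ W → ∀ s ∈ S,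
      HasDerivAt (fun s' => radVelQuot (curl (v s')) x) (Φ' s x) s := by
    filter_upwards [ae_cylRadius_ne_zero'] with x hx hxW s hs
    rw [hΦ'def]
    exact hasDerivAt_radVelQuot_curl_of_ne hS hv3 hax hs hx (hW2 s hs) (hWax s hs) (hvort s hs x hxW hx)
  have ht1S : Icc t₁ t ⊆ S := (Icc_subset_Icc_right ht.2).trans hsub
  -- the energy balances on `[t₁, t]`
  obtain ⟨hdensΓ, hbalΓ⟩ : ContinuousOn (fun s => 2 * (∫ x, ζ s x * timeDerivWithin S ζ s x * angVortQuot (v s) x ^ 2) +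
      2 * ∫ x, ζ s x ^ 2 * angVortQuot (v s) x * Γ' s x) S ∧
      (∫ x, (ζ t x * angVortQuot (v t) x) ^ 2) - (∫ x, (ζ t₁ x * angVortQuot (v t₁) x) ^ 2) =
        ∫ s in t₁..t, (2 * (∫ x, ζ s x * timeDerivWithin S ζ s x * angVortQuot (v s) x ^ 2) +
          2 * ∫ x, ζ s x ^ 2 * angVortQuot (v s) x * Γ' s x) :=
    integral_cutoff_sq_sub_eq_of_ae_on (G := fun s x => angVortQuot (v s) x)
      (G' := Γ') hS hζ hK hsupp hWo hKW hΓcU hΓ'cU hderΓ ht.1 ht1S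
  obtain ⟨hdensJ, hbalJ⟩ : ContinuousOn (fun s => 2 * (∫ x, ζ s x * timeDerivWithin S ζ s x * radVelQuot (curl (v s)) x ^ 2) +
      2 * ∫ x, ζ s x ^ 2 * radVelQuot (curl (v s)) x * Φ' s x) S ∧
      (∫ x, (ζ t x * radVelQuot (curl (v t)) x) ^ 2) - (∫ x, (ζ t₁ x * radVelQuot (curl (v t₁)) x) ^ 2) =
        ∫ s in t₁..t, (2 * (∫ x, ζ s x * timeDerivWithin S ζ s x * radVelQuot (curl (v s)) x ^ 2) +
          2 * ∫ x, ζ s x ^ 2 * radVelQuot (curl (v s)) x * Φ' s x) :=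
    integral_cutoff_sq_sub_eq_of_ae_on (G := fun s x => radVelQuot (curl (v s)) x)
      (G' := Φ') hS hζ hK hsupp hWo hKW hJcU hΦ'cU hderJ ht.1 ht1S
  -- continuity of the dissipations
  have hΓd : ∀ s ∈ S, Differentiable ℝ (angVortQuot (v s)) := fun s hs =>
    (contDiff_angVortQuot (n := 1) ((hu s hs).of_le (by norm_cast))).differentiable one_ne_zero
  have hJd : ∀ s ∈ S, Differentiable ℝ (radVelQuot (curl (v s))) := fun s hs =>
    (contDiff_radVelQuot (n := 1) (contDiff_curl (n := 3) ((hu s hs).of_le (by norm_cast)))).differentiable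
      one_ne_zero
  have cDΓ : ContinuousOn (fun s => (∫ x, (fderiv ℝ (fun y => ζ s y * angVortQuot (v s) y) x (EuclideanSpace.single 0 1) ^ 2 + fderiv ℝ (fun y => ζ s y * angVortQuot (v s) y) x (EuclideanSpace.single 1 1) ^ 2 + fderiv ℝ (fun y => ζ s y * angVortQuot (v s) y) x (EuclideanSpace.single 2 1) ^ 2))) S :=
    continuousOn_integral_gradSq_cutoff_of_continuousOn (G := fun s x => angVortQuot (v s) x)
      hS hζ hK hsupp hΓcU hΓd hDΓc
  have cDJ : ContinuousOn (fun s => (∫ x, (fderiv ℝ (fun y => ζ s y * radVelQuot (curl (v s)) y) x (EuclideanSpace.single 0 1) ^ 2 + fderiv ℝ (fun y => ζ s y * radVelQuot (curl (v s)) y) x (EuclideanSpace.single 1 1) ^ 2 + fderiv ℝ (fun y => ζ s y * radVelQuot (curl (v s)) y) x (EuclideanSpace.single 2 1) ^ 2))) S :=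
    continuousOn_integral_gradSq_cutoff_of_continuousOn (G := fun s x => radVelQuot (curl (v s)) x)
      hS hζ hK hsupp hJcU hJd hDJc
  -- the pointwise-in-time inequality
  have hpt : ∀ s ∈ Icc t₁ t,
      (2 * (∫ x, ζ s x * timeDerivWithin S ζ s x * angVortQuot (v s) x ^ 2) +
        2 * ∫ x, ζ s x ^ 2 * angVortQuot (v s) x * Γ' s x) +
      (2 * (∫ x, ζ s x * timeDerivWithin S ζ s x * radVelQuot (curl (v s)) x ^ 2) +
        2 * ∫ x, ζ s x ^ 2 * radVelQuot (curl (v s)) x * Φ' s x) +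
      (2 * ν - 8 * C₁ / Real.log (Real.exp 1 / r₁) - θA) * ((∫ x, (fderiv ℝ (fun y => ζ s y * angVortQuot (v s) y) x (EuclideanSpace.single 0 1) ^ 2 + fderiv ℝ (fun y => ζ s y * angVortQuot (v s) y) x (EuclideanSpace.single 1 1) ^ 2 + fderiv ℝ (fun y => ζ s y * angVortQuot (v s) y) x (EuclideanSpace.single 2 1) ^ 2)) + (∫ x, (fderiv ℝ (fun y => ζ s y * radVelQuot (curl (v s)) y) x (EuclideanSpace.single 0 1) ^ 2 + fderiv ℝ (fun y => ζ s y * radVelQuot (curl (v s)) y) x (EuclideanSpace.single 1 1) ^ 2 + fderiv ℝ (fun y => ζ s y * radVelQuot (curl (v s)) y) x (EuclideanSpace.single 2 1) ^ 2))) ≤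
      Bcut + BA + 4 * M * volume.real (closedBall (0 : EuclideanSpace ℝ (Fin 3)) 2) := by
    intro s hs1
    have hs12 : s ∈ Icc t₁ t₂ := ⟨hs1.1, hs1.2.trans ht.2⟩
    have hs : s ∈ S := hsub hs12
    have hvs : ContDiff ℝ ∞ (v s) := hu s hs
    have hv2 : ContDiff ℝ 2 (v s) := hvs.of_le (by norm_cast)
    have hζ2 : ContDiff ℝ 2 (ζ s) := (hζ.contDiff_slice hs).of_le (by norm_cast)
    have hζ1 : ContDiff ℝ 1 (ζ s) := (hζ.contDiff_slice hs).of_le (by norm_cast)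
    have hζc : HasCompactSupport (ζ s) := HasCompactSupport.intro hK (hsupp s hs)
    have hΓ1 : ContDiff ℝ 1 (angVortQuot (v s)) := contDiff_angVortQuot (n := 1) (hvs.of_le (by norm_cast))
    have hJ1 : ContDiff ℝ 1 (radVelQuot (curl (v s))) :=
      contDiff_radVelQuot (n := 1) (contDiff_curl (n := 3) (hvs.of_le (by norm_cast)))
    have hdivs : ∀ x, ζ s x ≠ 0 → VectorCalculus.divergence (v s) x = 0 := fun x hx =>
      hdiv s hs x (hKW (by_contra fun h => hx (hsupp s hs x h)))
    -- fixed-time inequalities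
    have hfixΓ := angVortQuot_cutoff_energy_le_local (ν := ν) hvs (hax s hs) hν hζ2 (hζax s hs) hζc hdivs
    have hfixJ := radVelQuot_curl_cutoff_energy_le_local (ν := ν) hvs (hax s hs) hν hζ2 (hζax s hs) hζc hdivs
    have heΓ : (∫ x, ζ s x ^ 2 * angVortQuot (v s) x * Γ' s x) =
        ∫ x, ζ s x ^ 2 * angVortQuot (v s) x * angVelQuot (fun y => ν • (Δ (curl (v s))) y - fderiv ℝ (curl (v s)) y (v s y) + fderiv ℝ (v s) y (curl (v s) y)) x :=
      integral_congr_ae (Eventually.of_forall fun x => by simp only [hΓ'def])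
    have heJ : (∫ x, ζ s x ^ 2 * radVelQuot (curl (v s)) x * Φ' s x) =
        ∫ x, ζ s x ^ 2 * radVelQuot (curl (v s)) x * radVelQuot (fun y => ν • (Δ (curl (v s))) y - fderiv ℝ (curl (v s)) y (v s y) + fderiv ℝ (v s) y (curl (v s) y)) x :=
      integral_congr_ae (Eventually.of_forall fun x => by simp only [hΦ'def])
    -- the `B₃` bound
    have hfΓ : ContDiff ℝ 1 fun x => ζ s x * angVortQuot (v s) x := hζ1.mul hΓ1
    have hfJ : ContDiff ℝ 1 fun x => ζ s x * radVelQuot (curl (v s)) x := hζ1.mul hJ1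
    have hsΓ : tsupport (fun x => ζ s x * angVortQuot (v s) x) ⊆ SereginSverak2009.spaceCyl 0 1 :=
      tsupport_mul_subset_left.trans (hζs s hs)
    have hsJ : tsupport (fun x => ζ s x * radVelQuot (curl (v s)) x) ⊆ SereginSverak2009.spaceCyl 0 1 :=
      tsupport_mul_subset_left.trans (hζs s hs)
    have hB3 := abs_integral_angVelQuot_mul_mul_le (v s) _ _ C₁ r₁ M (hax s hs) hv2 hfΓ hfJ hsΓ hsJ
      hC₁ hr₁ hr₁1 hM (hσ s hs12) (hfar s hs12)
    have hB3eq : ∫ x, ζ s x ^ 2 * angVortQuot (v s) x * (angVelQuot (v s) x * radVelQuot (curl (v s)) x) =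
        ∫ x, angVelQuot (v s) x * (ζ s x * angVortQuot (v s) x) * (ζ s x * radVelQuot (curl (v s)) x) :=
      integral_congr_ae (Eventually.of_forall fun x => by ring)
    -- horizontal gradients are bounded by full gradients
    have hHΓ : ∫ x, (fderiv ℝ (fun y => ζ s y * angVortQuot (v s) y) x (EuclideanSpace.single 0 1) ^ 2 + fderiv ℝ (fun y => ζ s y * angVortQuot (v s) y) x (EuclideanSpace.single 1 1) ^ 2) ≤ (∫ x, (fderiv ℝ (fun y => ζ s y * angVortQuot (v s) y) x (EuclideanSpace.single 0 1) ^ 2 + fderiv ℝ (fun y => ζ s y * angVortQuot (v s) y) x (EuclideanSpace.single 1 1) ^ 2 + fderiv ℝ (fun y => ζ s y * angVortQuot (v s) y) x (EuclideanSpace.single 2 1) ^ 2)) :=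
      integral_horizontal_gradSq_le hfΓ (hζc.mul_right)
    have hHJ : ∫ x, (fderiv ℝ (fun y => ζ s y * radVelQuot (curl (v s)) y) x (EuclideanSpace.single 0 1) ^ 2 + fderiv ℝ (fun y => ζ s y * radVelQuot (curl (v s)) y) x (EuclideanSpace.single 1 1) ^ 2) ≤ (∫ x, (fderiv ℝ (fun y => ζ s y * radVelQuot (curl (v s)) y) x (EuclideanSpace.single 0 1) ^ 2 + fderiv ℝ (fun y => ζ s y * radVelQuot (curl (v s)) y) x (EuclideanSpace.single 1 1) ^ 2 + fderiv ℝ (fun y => ζ s y * radVelQuot (curl (v s)) y) x (EuclideanSpace.single 2 1) ^ 2)) :=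
      integral_horizontal_gradSq_le hfJ (hζc.mul_right)
    have hL₁0 : 0 < Real.log (Real.exp 1 / r₁) := by
      rw [log_exp_div_eq r₁ hr₁]; linarith [Real.log_neg hr₁ hr₁1]
    have hcoef : 0 ≤ 2 * C₁ / Real.log (Real.exp 1 / r₁) := by positivity
    have hB3' : |∫ x, angVelQuot (v s) x * (ζ s x * angVortQuot (v s) x) * (ζ s x * radVelQuot (curl (v s)) x)| ≤
        2 * C₁ / Real.log (Real.exp 1 / r₁) * ((∫ x, (fderiv ℝ (fun y => ζ s y * angVortQuot (v s) y) x (EuclideanSpace.single 0 1) ^ 2 + fderiv ℝ (fun y => ζ s y * angVortQuot (v s) y) x (EuclideanSpace.single 1 1) ^ 2 + fderiv ℝ (fun y => ζ s y * angVortQuot (v s) y) x (EuclideanSpace.single 2 1) ^ 2)) + (∫ x, (fderiv ℝ (fun y => ζ s y * radVelQuot (curl (v s)) y) x (EuclideanSpace.single 0 1) ^ 2 + fderiv ℝ (fun y => ζ s y * radVelQuot (curl (v s)) y) x (EuclideanSpace.single 1 1) ^ 2 + fderiv ℝ (fun y => ζ s y * radVelQuot (curl (v s)) y) x (EuclideanSpace.single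 2 1) ^ 2))) +
          M * volume.real (closedBall (0 : EuclideanSpace ℝ (Fin 3)) 2) := by
      refine hB3.trans ?_
      gcongr
    have habs := abs_le.1 hB3'
    have hcut' := hcut s hs12
    have hA3' := hA3 s hs12
    rw [hB3eq] at hfixΓ
    have h8 : 8 * C₁ / Real.log (Real.exp 1 / r₁) * ((∫ x, (fderiv ℝ (fun y => ζ s y * angVortQuot (v s) y) x (EuclideanSpace.single 0 1) ^ 2 + fderiv ℝ (fun y => ζ s y * angVortQuot (v s) y) x (EuclideanSpace.single 1 1) ^ 2 + fderiv ℝ (fun y => ζ s y * angVortQuot (v s) y) x (EuclideanSpace.single 2 1) ^ 2)) + (∫ x, (fderiv ℝ (fun y => ζ s y * radVelQuot (curl (v s)) y) x (EuclideanSpace.single 0 1) ^ 2 + fderiv ℝ (fun y => ζ s y * radVelQuot (curl (v s)) y) x (EuclideanSpace.single 1 1) ^ 2 + fderiv ℝ (fun y => ζ s y * radVelQuot (curl (v s)) y) x (EuclideanSpace.single 2 1) ^ 2))) =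
        4 * (2 * C₁ / Real.log (Real.exp 1 / r₁) * ((∫ x, (fderiv ℝ (fun y => ζ s y * angVortQuot (v s) y) x (EuclideanSpace.single 0 1) ^ 2 + fderiv ℝ (fun y => ζ s y * angVortQuot (v s) y) x (EuclideanSpace.single 1 1) ^ 2 + fderiv ℝ (fun y => ζ s y * angVortQuot (v s) y) x (EuclideanSpace.single 2 1) ^ 2)) + (∫ x, (fderiv ℝ (fun y => ζ s y * radVelQuot (curl (v s)) y) x (EuclideanSpace.single 0 1) ^ 2 + fderiv ℝ (fun y => ζ s y * radVelQuot (curl (v s)) y) x (EuclideanSpace.single 1 1) ^ 2 + fderiv ℝ (fun y => ζ s y * radVelQuot (curl (v s)) y) x (EuclideanSpace.single 2 1) ^ 2)))) := by ring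
    rw [heΓ, heJ]
    nlinarith [hfixΓ, hfixJ, habs.1, habs.2, hcut', hA3', h8]
  -- integrate over `[t₁, t]`
  have hIdensΓ := (hdensΓ.mono ht1S).intervalIntegrable_of_Icc (μ := volume) ht.1
  have hIdensJ := (hdensJ.mono ht1S).intervalIntegrable_of_Icc (μ := volume) ht.1
  have hID : IntervalIntegrable (fun s => (∫ x, (fderiv ℝ (fun y => ζ s y * angVortQuot (v s) y) x (EuclideanSpace.single 0 1) ^ 2 + fderiv ℝ (fun y => ζ s y * angVortQuot (v s) y) x (EuclideanSpace.single 1 1) ^ 2 + fderiv ℝ (fun y => ζ s y * angVortQuot (v s) y) x (EuclideanSpace.single 2 1) ^ 2)) + (∫ x, (fderiv ℝ (fun y => ζ s y * radVelQuot (curl (v s)) y) x (EuclideanSpace.single 0 1) ^ 2 + fderiv ℝ (fun y => ζ s y * radVelQuot (curl (v s)) y) x (EuclideanSpace.single 1 1) ^ 2 + fderiv ℝ (fun y => ζ s y * radVelQuot (curl (v s)) y) x (EuclideanSpace.single 2 1) ^ 2))) volume t₁ t :=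
    ((cDΓ.add cDJ).mono ht1S).intervalIntegrable_of_Icc (μ := volume) ht.1
  have hmono := intervalIntegral.integral_mono_on ht.1
    ((hIdensΓ.add hIdensJ).add (hID.const_mul (2 * ν - 8 * C₁ / Real.log (Real.exp 1 / r₁) - θA)))
    intervalIntegrable_const hpt
  rw [intervalIntegral.integral_add (hIdensΓ.add hIdensJ)
      (hID.const_mul (2 * ν - 8 * C₁ / Real.log (Real.exp 1 / r₁) - θA)),
    intervalIntegral.integral_add hIdensΓ hIdensJ, intervalIntegral.integral_const_mul,
    intervalIntegral.integral_const, smul_eq_mul] at hmono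
  linarith [hbalΓ, hbalJ, hmono]

/-- **Seregin 2022, §2 Step 3 — the key estimate, for the LOCAL smooth class** (arXiv p. 7:
"the key estimate can be derived by more or less standard arguments. It is as follows:
`sup_{-1<t<0}∫_𝒞 η⁶(|Γ|² + |Φ|²)dx + ∫_Q (η³|∇Φ|)² + (η³|∇Γ|)² dxdt ≤ C(v,η,r₁)`"). Under the
hypotheses of `cutoff_energy_apriori_local` and the smallness `8C₁/ln(e/r₁) + θ_A < 2ν`, with
`K₀ = E(t₁) + (Bcut + B_A + 4M|B(0,2)|)(t₂ − t₁)`: `sup_{t ∈ [t₁,t₂]} E(t) ≤ K₀` and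
`∫_{t₁}^{t₂} D ≤ K₀/(2ν − 8C₁/ln(e/r₁) − θ_A)` — verbatim the conclusion of the classical
`cutoff_energy_keyEstimate`. Registered sub-goal toward `stub_sereginLogSwirlOrigin`.
[cite: Seregin2022LocalAxisym, §2 Step 3 (arXiv:2201.00153 p. 7, the key estimate)] -/
theorem cutoff_energy_keyEstimate_local : ∀ (T₀ T₁ ν : ℝ) (v : ℝ → EuclideanSpace ℝ (Fin 3) → EuclideanSpace ℝ (Fin 3)) (ζ : ℝ → EuclideanSpace ℝ (Fin 3) → ℝ) (K W : Set (EuclideanSpace ℝ (Fin 3))) (t₁ t₂ C₁ r₁ M θA BA Bcut : ℝ), (∀ s ∈ Ioo T₀ T₁, ContDiff ℝ (⊤ : ℕ∞) (v s)) → (∀ s ∈ Ioo T₀ T₁, IsAxisymmetric (v s)) → 0 ≤ ν → IsSmoothSpaceTimeOn (Ioo T₀ T₁) ζ → (∀ s ∈ Ioo T₀ T₁, IsAxisymmetricScalar (ζ s)) → (∀ s ∈ Ioo T₀ T₁, tsupport (ζ s) ⊆ SereginSverak2009.spaceCyl 0 1) → Icc t₁ t₂ ⊆ Ioo T₀ T₁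 → IsCompact K → (∀ s ∈ Ioo T₀ T₁, ∀ x ∉ K, ζ s x = 0) → IsOpen W → K ⊆ W → (∀ s ∈ Ioo T₀ T₁, ∀ x ∈ W, VectorCalculus.divergence (v s) x = 0) → (∀ s ∈ Ioo T₀ T₁, ∀ x ∈ W, cylRadius x ≠ 0 → HasDerivAt (fun s' => curl (v s') x) (ν • (Δ (curl (v s))) x - fderiv ℝ (curl (v s)) x (v s x) + fderiv ℝ (v s) x (curl (v s) x)) s) → ContinuousOn (fun z : ℝ × EuclideanSpace ℝ (Fin 3) => angVortQuot (v z.1) z.2) (Ioo T₀ T₁ ×ˢ univ) → ContinuousOn (fun z : ℝ × EuclideanSpace ℝ (Fin 3) => angVelQuot (fun y => ν • (Δ (curl (v z.1))) y - fderiv ℝ (curl (v z.1)) y (v z.1 y) + fderiv ℝ (v z.1) y (curl (v z.1) y)) z.2) (Ioo T₀ T₁ ×ˢ univ) → ContinuousOn (fun z : ℝ × EuclideanSpace ℝ (Fin 3) => fderiv ℝ (angVortQuot (v z.1)) z.2) (Ioo T₀ T₁ ×ˢ univ) → ContinuousOn (fun z : ℝ × EuclideanSpace ℝ (Fin 3)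 => radVelQuot (curl (v z.1)) z.2) (Ioo T₀ T₁ ×ˢ univ) → ContinuousOn (fun z : ℝ × EuclideanSpace ℝ (Fin 3) => radVelQuot (fun y => ν • (Δ (curl (v z.1))) y - fderiv ℝ (curl (v z.1)) y (v z.1 y) + fderiv ℝ (v z.1) y (curl (v z.1) y)) z.2) (Ioo T₀ T₁ ×ˢ univ) → ContinuousOn (fun z : ℝ × EuclideanSpace ℝ (Fin 3) => fderiv ℝ (radVelQuot (curl (v z.1))) z.2) (Ioo T₀ T₁ ×ˢ univ) → 0 ≤ C₁ → 0 < r₁ → r₁ < 1 → 0 ≤ M → (∀ t ∈ Icc t₁ t₂, ∀ x, 0 < cylRadius x → cylRadius x < r₁ → |swirl (v t) x| ≤ C₁ / Real.log (Real.exp 1 / cylRadius x) ^ 3) → (∀ t ∈ Icc t₁ t₂, ∀ x, r₁ ≤ cylRadius x → |angVelQuot (v t) x * (ζ t x * angVortQuot (v t) x) * (ζ t x * radVelQuot (curl (v t)) x)| ≤ M) → (∀ t ∈ Icc t₁ t₂, (2 * (∫ x, ζ t x * timeDerivWithin (Ioo T₀ T₁) ζ t x * angVortQuot (v t) x ^ 2)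 + 2 * (∫ x, ζ t x * angVortQuot (v t) x ^ 2 * fderiv ℝ (ζ t) x (v t x)) + 2 * ν * (∫ x, angVortQuot (v t) x ^ 2 * (fderiv ℝ (ζ t) x (EuclideanSpace.single 0 1) ^ 2 + fderiv ℝ (ζ t) x (EuclideanSpace.single 1 1) ^ 2 + fderiv ℝ (ζ t) x (EuclideanSpace.single 2 1) ^ 2)) - 4 * ν * (∫ x, ζ t x * angVortQuot (v t) x ^ 2 * radDerivQuot (ζ t) x)) + (2 * (∫ x, ζ t x * timeDerivWithin (Ioo T₀ T₁) ζ t x * radVelQuot (curl (v t)) x ^ 2) + 2 * (∫ x, ζ t x * radVelQuot (curl (v t)) x ^ 2 * fderiv ℝ (ζ t) x (v t x)) + 2 * ν * (∫ x, radVelQuot (curl (v t)) x ^ 2 * (fderiv ℝ (ζ t) x (EuclideanSpace.single 0 1) ^ 2 + fderiv ℝ (ζ t) x (EuclideanSpace.single 1 1) ^ 2 + fderiv ℝ (ζ t) x (EuclideanSpace.single 2 1) ^ 2)) - 4 * ν * (∫ x, ζ t x * radVelQuot (curl (v t)) x ^ 2 * radDerivQuot (ζ t) x)) ≤ Bcut)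 → (∀ t ∈ Icc t₁ t₂, 2 * (∫ x, ζ t x ^ 2 * radVelQuot (curl (v t)) x * fderiv ℝ (radVelQuot (v t)) x (curl (v t) x)) ≤ θA * ((∫ x, (fderiv ℝ (fun y => ζ t y * angVortQuot (v t) y) x (EuclideanSpace.single 0 1) ^ 2 + fderiv ℝ (fun y => ζ t y * angVortQuot (v t) y) x (EuclideanSpace.single 1 1) ^ 2 + fderiv ℝ (fun y => ζ t y * angVortQuot (v t) y) x (EuclideanSpace.single 2 1) ^ 2)) + (∫ x, (fderiv ℝ (fun y => ζ t y * radVelQuot (curl (v t)) y) x (EuclideanSpace.single 0 1) ^ 2 + fderiv ℝ (fun y => ζ t y * radVelQuot (curl (v t)) y) x (EuclideanSpace.single 1 1) ^ 2 + fderiv ℝ (fun y => ζ t y * radVelQuot (curl (v t)) y) x (EuclideanSpace.single 2 1) ^ 2))) + BA) → 0 ≤ Bcut → 0 ≤ BA → 8 * C₁ / Real.log (Real.exp 1 / r₁) + θA < 2 * ν → t₁ ≤ t₂ → (∀ t ∈ Icc t₁ t₂, (∫ x, (ζ t x * angVortQuot (v t) x) ^ 2) + (∫ x, (ζ t x * radVelQuot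 (curl (v t)) x) ^ 2) ≤ (∫ x, (ζ t₁ x * angVortQuot (v t₁) x) ^ 2) + (∫ x, (ζ t₁ x * radVelQuot (curl (v t₁)) x) ^ 2) + (Bcut + BA + 4 * M * volume.real (closedBall (0 : EuclideanSpace ℝ (Fin 3)) 2)) * (t₂ - t₁)) ∧ ∫ s in t₁..t₂, ((∫ x, (fderiv ℝ (fun y => ζ s y * angVortQuot (v s) y) x (EuclideanSpace.single 0 1) ^ 2 + fderiv ℝ (fun y => ζ s y * angVortQuot (v s) y) x (EuclideanSpace.single 1 1) ^ 2 + fderiv ℝ (fun y => ζ s y * angVortQuot (v s) y) x (EuclideanSpace.single 2 1) ^ 2)) + (∫ x, (fderiv ℝ (fun y => ζ s y * radVelQuot (curl (v s)) y) x (EuclideanSpace.single 0 1) ^ 2 + fderiv ℝ (fun y => ζ s y * radVelQuot (curl (v s)) y) x (EuclideanSpace.single 1 1) ^ 2 + fderiv ℝ (fun y => ζ s y * radVelQuot (curl (v s)) y) x (EuclideanSpace.single 2 1) ^ 2))) ≤ ((∫ x, (ζ t₁ x * angVortQuot (v t₁) x) ^ 2) + (∫ x, (ζ t₁ x * radVelQuot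 (curl (v t₁)) x) ^ 2) + (Bcut + BA + 4 * M * volume.real (closedBall (0 : EuclideanSpace ℝ (Fin 3)) 2)) * (t₂ - t₁)) / (2 * ν - 8 * C₁ / Real.log (Real.exp 1 / r₁) - θA) := by
  intro T₀ T₁ ν v ζ K W t₁ t₂ C₁ r₁ M θA BA Bcut hu hax hν hζ hζax hζs hsub hK hsupp hWo hKW hdiv hvort hΓc hΓ'c hDΓc hJc hJ'c hDJc hC₁ hr₁ hr₁1 hM hσ hfar hcut hA3 hBcut hBA hsmall h12
  have hap := cutoff_energy_apriori_local T₀ T₁ ν v ζ K W t₁ t₂ C₁ r₁ M θA BA Bcut hu hax hν hζ hζax hζs hsub hK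
    hsupp hWo hKW hdiv hvort hΓc hΓ'c hDΓc hJc hJ'c hDJc hC₁ hr₁ hr₁1 hM hσ hfar hcut hA3
  have hVOL : 0 ≤ volume.real (closedBall (0 : EuclideanSpace ℝ (Fin 3)) 2) := measureReal_nonneg
  have hB : 0 ≤ Bcut + BA + 4 * M * volume.real (closedBall (0 : EuclideanSpace ℝ (Fin 3)) 2) := by positivity
  have hpos : 0 < 2 * ν - 8 * C₁ / Real.log (Real.exp 1 / r₁) - θA := by linarith
  have hDnn : ∀ s, 0 ≤ (∫ x, (fderiv ℝ (fun y => ζ s y * angVortQuot (v s) y) x (EuclideanSpace.single 0 1) ^ 2 + fderiv ℝ (fun y => ζ s y * angVortQuot (v s) y) x (EuclideanSpace.single 1 1) ^ 2 + fderiv ℝ (fun y => ζ s y * angVortQuot (v s) y) x (EuclideanSpace.single 2 1) ^ 2)) + (∫ x, (fderiv ℝ (fun y => ζ s y * radVelQuot (curl (v s)) y) x (EuclideanSpace.single 0 1) ^ 2 + fderiv ℝ (fun y => ζ s y * radVelQuot (curl (v s)) y) x (EuclideanSpace.single 1 1) ^ 2 + fderiv ℝ (fun y => ζ s y * radVelQuot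 (curl (v s)) y) x (EuclideanSpace.single 2 1) ^ 2)) := fun s =>
    add_nonneg (integral_nonneg fun x => by positivity) (integral_nonneg fun x => by positivity)
  have hIDnn : ∀ t, t₁ ≤ t → 0 ≤ ∫ s in t₁..t, ((∫ x, (fderiv ℝ (fun y => ζ s y * angVortQuot (v s) y) x (EuclideanSpace.single 0 1) ^ 2 + fderiv ℝ (fun y => ζ s y * angVortQuot (v s) y) x (EuclideanSpace.single 1 1) ^ 2 + fderiv ℝ (fun y => ζ s y * angVortQuot (v s) y) x (EuclideanSpace.single 2 1) ^ 2)) + (∫ x, (fderiv ℝ (fun y => ζ s y * radVelQuot (curl (v s)) y) x (EuclideanSpace.single 0 1) ^ 2 + fderiv ℝ (fun y => ζ s y * radVelQuot (curl (v s)) y) x (EuclideanSpace.single 1 1) ^ 2 + fderiv ℝ (fun y => ζ s y * radVelQuot (curl (v s)) y) x (EuclideanSpace.single 2 1) ^ 2))) := fun t ht =>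
    intervalIntegral.integral_nonneg ht fun s _ => hDnn s
  refine ⟨fun t ht => ?_, ?_⟩
  · have h := hap t ht
    have h1 : (Bcut + BA + 4 * M * volume.real (closedBall (0 : EuclideanSpace ℝ (Fin 3)) 2)) * (t - t₁) ≤ (Bcut + BA + 4 * M * volume.real (closedBall (0 : EuclideanSpace ℝ (Fin 3)) 2)) * (t₂ - t₁) :=
      mul_le_mul_of_nonneg_left (by linarith [ht.2]) hB
    nlinarith [hIDnn t ht.1, mul_nonneg hpos.le (hIDnn t ht.1)]
  · have h := hap t₂ ⟨h12, le_rfl⟩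
    have hE : 0 ≤ (∫ x, (ζ t₂ x * angVortQuot (v t₂) x) ^ 2) + (∫ x, (ζ t₂ x * radVelQuot (curl (v t₂)) x) ^ 2) :=
      add_nonneg (integral_nonneg fun x => by positivity) (integral_nonneg fun x => by positivity)
    rw [le_div_iff₀ hpos]
    nlinarith [hIDnn t₂ h12]

end Apriori

end Literature.Analysis.SereginLogSwirlOrigin.EulerScaling

end Part5

/-!
## Part 6 — port of `Summits/NavierStokesRegularity/NavierStokesRegularity/Theorems/AxisymmetricExtremalityAxisymmetricKatoGlobalStubSereginLogSwirlOriginStep3LocalKeyEstimate0.lean` (2 declarations kept)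

# Seregin 2022, §2 Step 3 for the LOCAL smooth class (VII): the key estimate with the `A₃`-bound
# and Lemma 2.1 (ii) discharged, for a family of smooth axisymmetric fields solving the vorticity
# equation near the cut-off — crux stmt-NavierStokesRegularity-15453
# (`AxisymmetricExtremality.AxisymmetricKatoGlobal`), line registered, support for stub `stub_sereginLogSwirlOrigin`

Support file (`--supports stmt-NavierStokesRegularity-15453`; theorems only, everything proved)
toward the registered stub `stub_sereginLogSwirlOrigin` = the named fact
`Literature.Analysis.FluidPDE.seregin2022_logSwirl_regularAtOrigin` (G. Seregin, J. Math. Fluid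
Mech. 24 (2022), Paper 27 = arXiv:2201.00153, §2), sequel of `…Step3LocalApriori`. The siblings
`…Step3KeyEstimate` (`cutoff_energy_keyEstimate_of_lemma21`) and `…Step3KeyUnconditional`
(`cutoff_energy_keyEstimate_unconditional`) turn the key estimate in `θ_A/B_A` form into the
final Step-3 output for a whole-space classical solution: the `A₃` bound
`2A₃ ≤ (C₁(1+4c_L)/ln²(e/r₁) + 4ε)D + B_A` (`two_mul_integral_sourcePhi_le`, a fixed-time statement
about a smooth axisymmetric slice) and Lemma 2.1 (ii) in numeric form
(`integral_hessianSq_cutoff_radVelQuot_le_of_pointwise`, likewise fixed-time, with `div v = 0`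
only on `tsupport ζ`). Both inputs being slice-wise, the same two passages apply verbatim to the
local class of `cutoff_energy_keyEstimate_local` (a family of globally `C^∞` axisymmetric
fields, divergence free and solving the vorticity equation on an open `W ⊇ K ⊇ supp ζ`, with
`Γ, DΓ, ∂ₜΓ, Φ, DΦ, ∂ₜΦ` jointly continuous):

* `cutoff_energy_keyEstimate_local_of_lemma21` — the key estimate for the local class with the
  `A₃` bound discharged, Lemma 2.1 (ii) as the numeric hypothesis
  `∫|∇²(ζv_r/r)|² ≤ c_L∫|∇(ζΓ)|² + C_L`; conclusion and constants verbatim those of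
  `cutoff_energy_keyEstimate_of_lemma21`;
* `cutoff_energy_keyEstimate_local_unconditional` — **the Step-3 output for the local class**:
  Lemma 2.1 (ii) discharged (`c_L = 3`, `C_L = 3(P₃² + P₄²)V`); hypotheses (2.2), `M`, `Bcut`,
  `P₀, …, P₄`, `V`, the smallness `8C₁/ln(e/r₁) + 13C₁/ln²(e/r₁) + 4ε < 2ν`, conclusion
  `sup_{[t₁,t₂]} E ≤ K`, `∫_{t₁}^{t₂} D ≤ K/(2ν − 8C₁/L − (13C₁/L² + 4ε))` and the constant `K`
  VERBATIM those of `cutoff_energy_keyEstimate_unconditional` — only the solution class differs.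

The sequel `…Step3LocalKeyEstimate` derives the joint-continuity hypotheses from the joint
continuity of the spatial derivatives and specialises to the Seregin–Zajaczkowski representative.

## Mathlib / tree search

Tree: `cutoff_energy_keyEstimate_of_lemma21` (`…Step3KeyEstimate`),
`cutoff_energy_keyEstimate_unconditional`, `integral_hessianSq_cutoff_radVelQuot_le_of_pointwise`
(`…Step3KeyUnconditional`), `two_mul_integral_sourcePhi_le` (`…Step3SourcePhi`),
`cutoff_energy_keyEstimate_local` (`…Step3LocalApriori`), `log_exp_div_eq`.
`lean search 'keyEstimate_local' --decl`: only `…Step3LocalApriori` (2026-08-17).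

## References

* G. Seregin, J. Math. Fluid Mech. 24 (2022), Paper No. 27 = arXiv:2201.00153, §2 Step 3
  (arXiv p. 7, the key estimate) and Lemma 2.1 (p. 5). [`Seregin2022LocalAxisym`]
-/

section Part6

open _root_.MeasureTheory _root_.Set _root_.Filter _root_.Topology _root_.Function _root_.Metric intervalIntegral
open scoped _root_.ENNReal _root_.ContDiff Laplacian
open Literature.Analysis.FluidPDE

namespace Literature.Analysis.SereginLogSwirlOrigin.EulerScaling

/-- **Seregin 2022, §2 Step 3, the key estimate for the LOCAL smooth class with the `A₃`-bound
discharged, assuming Lemma 2.1 (ii) in numeric form** — the statement of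
`cutoff_energy_keyEstimate_of_lemma21` with the classical solution replaced by the local class of
`cutoff_energy_keyEstimate_local` (family of globally `C^∞` axisymmetric fields; `div v = 0` and
the pointwise vorticity equation off the axis on an open `W ⊇ K ⊇ supp ζ`; joint continuity of
`Γ, ∂ₜΓ, DΓ, Φ, ∂ₜΦ, DΦ`). Conclusion and constants verbatim.
[cite: Seregin2022LocalAxisym, §2 Step 3 (arXiv:2201.00153 p. 7, the key estimate "sup ∫η⁶(|Γ|²+|Φ|²) + ∫∫(η³|∇Φ|)²+(η³|∇Γ|)² ≤ C(v,η,r₁)")] -/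
theorem cutoff_energy_keyEstimate_local_of_lemma21 : ∀ (a b ν : ℝ) (v : ℝ → EuclideanSpace ℝ (Fin 3) → EuclideanSpace ℝ (Fin 3)) (ζ : ℝ → EuclideanSpace ℝ (Fin 3) → ℝ) (K W : Set (EuclideanSpace ℝ (Fin 3))) (t₁ t₂ C₁ r₁ M Bcut ε P₀ P₁ P₂ cL CL V : ℝ), (∀ s ∈ Ioo a b, ContDiff ℝ (⊤ : ℕ∞) (v s)) → (∀ s ∈ Ioo a b, IsAxisymmetric (v s)) → 0 ≤ ν → IsSmoothSpaceTimeOn (Ioo a b) ζ → (∀ s ∈ Ioo a b, IsAxisymmetricScalar (ζ s)) → (∀ s ∈ Ioo a b, tsupport (ζ s) ⊆ SereginSverak2009.spaceCyl 0 1) → Icc t₁ t₂ ⊆ Ioo a b → IsCompact K → (∀ s ∈ Ioo a b, ∀ x ∉ K, ζ s x = 0) → IsOpen W → K ⊆ W → (∀ s ∈ Ioo a b, ∀ x ∈ W, VectorCalculus.divergence (v s) x = 0) → (∀ s ∈ Ioo a b, ∀ x ∈ W, cylRadius x ≠ 0 → HasDerivAt (fun s' => curl (v s') x) (ν • (Δ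 (curl (v s))) x - fderiv ℝ (curl (v s)) x (v s x) + fderiv ℝ (v s) x (curl (v s) x)) s) → ContinuousOn (fun z : ℝ × EuclideanSpace ℝ (Fin 3) => angVortQuot (v z.1) z.2) (Ioo a b ×ˢ univ) → ContinuousOn (fun z : ℝ × EuclideanSpace ℝ (Fin 3) => angVelQuot (fun y => ν • (Δ (curl (v z.1))) y - fderiv ℝ (curl (v z.1)) y (v z.1 y) + fderiv ℝ (v z.1) y (curl (v z.1) y)) z.2) (Ioo a b ×ˢ univ) → ContinuousOn (fun z : ℝ × EuclideanSpace ℝ (Fin 3) => fderiv ℝ (angVortQuot (v z.1)) z.2) (Ioo a b ×ˢ univ) → ContinuousOn (fun z : ℝ × EuclideanSpace ℝ (Fin 3) => radVelQuot (curl (v z.1)) z.2) (Ioo a b ×ˢ univ) → ContinuousOn (fun z : ℝ × EuclideanSpace ℝ (Fin 3) => radVelQuot (fun y => ν • (Δ (curl (v z.1))) y - fderiv ℝ (curl (v z.1)) y (v z.1 y) + fderiv ℝ (v z.1) y (curl (v z.1) y)) z.2) (Ioo a b ×ˢ univ) → ContinuousOn (fun z : ℝ × EuclideanSpace ℝ (Fin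 3) => fderiv ℝ (radVelQuot (curl (v z.1))) z.2) (Ioo a b ×ˢ univ) → t₁ ≤ t₂ → 0 ≤ C₁ → 0 < r₁ → r₁ < 1 → 0 ≤ M → 0 ≤ Bcut → 0 < ε → 0 ≤ P₂ → 0 ≤ cL → 0 ≤ CL → volume.real (closedBall (0 : EuclideanSpace ℝ (Fin 3)) 2) ≤ V → (∀ t ∈ Icc t₁ t₂, ∀ x, 0 < cylRadius x → cylRadius x < r₁ → |swirl (v t) x| ≤ C₁ / Real.log (Real.exp 1 / cylRadius x) ^ 3) → (∀ t ∈ Icc t₁ t₂, ∀ x, r₁ ≤ cylRadius x → |angVelQuot (v t) x * (ζ t x * angVortQuot (v t) x) * (ζ t x * radVelQuot (curl (v t)) x)| ≤ M) → (∀ t ∈ Icc t₁ t₂, (2 * (∫ x, ζ t x * timeDerivWithin (Ioo a b) ζ t x * angVortQuot (v t) x ^ 2) + 2 * (∫ x, ζ t x * angVortQuot (v t) x ^ 2 * fderiv ℝ (ζ t) x (v t x)) + 2 * ν * (∫ x, angVortQuot (v t) x ^ 2 * (fderiv ℝ (ζ t) x (EuclideanSpace.single 0 1) ^ 2 + fderiv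 ℝ (ζ t) x (EuclideanSpace.single 1 1) ^ 2 + fderiv ℝ (ζ t) x (EuclideanSpace.single 2 1) ^ 2)) - 4 * ν * (∫ x, ζ t x * angVortQuot (v t) x ^ 2 * radDerivQuot (ζ t) x)) + (2 * (∫ x, ζ t x * timeDerivWithin (Ioo a b) ζ t x * radVelQuot (curl (v t)) x ^ 2) + 2 * (∫ x, ζ t x * radVelQuot (curl (v t)) x ^ 2 * fderiv ℝ (ζ t) x (v t x)) + 2 * ν * (∫ x, radVelQuot (curl (v t)) x ^ 2 * (fderiv ℝ (ζ t) x (EuclideanSpace.single 0 1) ^ 2 + fderiv ℝ (ζ t) x (EuclideanSpace.single 1 1) ^ 2 + fderiv ℝ (ζ t) x (EuclideanSpace.single 2 1) ^ 2)) - 4 * ν * (∫ x, ζ t x * radVelQuot (curl (v t)) x ^ 2 * radDerivQuot (ζ t) x)) ≤ Bcut) → (∀ t ∈ Icc t₁ t₂, ∀ x, r₁ ≤ cylRadius x → |swirlVelocity (v t) x| * ‖fderiv ℝ (fun y => ζ t y * radVelQuot (v t) y) x‖ ≤ P₀) → (∀ t ∈ Icc t₁ t₂, ∀ x, |radVelQuot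 (v t) x| * |swirlVelocity (v t) x| * ‖fderiv ℝ (ζ t) x‖ ≤ P₁) → (∀ t ∈ Icc t₁ t₂, ∀ x, |ζ t x * radVelQuot (curl (v t)) x| * |swirlVelocity (v t) x| * (‖fderiv ℝ (ζ t) x‖ * ‖fderiv ℝ (radVelQuot (v t)) x‖) ≤ P₂) → (∀ t ∈ Icc t₁ t₂, (∫ x, ∑ i : Fin 3, ∑ j : Fin 3, (fderiv ℝ (fun y => fderiv ℝ (fun y => ζ t y * radVelQuot (v t) y) y (EuclideanSpace.single i 1)) x (EuclideanSpace.single j 1)) ^ 2) ≤ cL * (∫ x, (fderiv ℝ (fun y => ζ t y * angVortQuot (v t) y) x (EuclideanSpace.single 0 1) ^ 2 + fderiv ℝ (fun y => ζ t y * angVortQuot (v t) y) x (EuclideanSpace.single 1 1) ^ 2 + fderiv ℝ (fun y => ζ t y * angVortQuot (v t) y) x (EuclideanSpace.single 2 1) ^ 2)) + CL) → 8 * C₁ / Real.log (Real.exp 1 / r₁) + (C₁ * (1 + 4 * cL) / Real.log (Real.exp 1 / r₁) ^ 2 + 4 * ε) < 2 * ν → (∀ t ∈ Icc t₁ t₂,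 (∫ x, (ζ t x * angVortQuot (v t) x) ^ 2) + (∫ x, (ζ t x * radVelQuot (curl (v t)) x) ^ 2) ≤ (∫ x, (ζ t₁ x * angVortQuot (v t₁) x) ^ 2) + (∫ x, (ζ t₁ x * radVelQuot (curl (v t₁)) x) ^ 2) + (Bcut + (4 * C₁ * CL / Real.log (Real.exp 1 / r₁) ^ 2 + ((P₀ ^ 2 + P₁ ^ 2) / (2 * ε) + 2 * P₂) * V) + 4 * M * V) * (t₂ - t₁)) ∧ ∫ s in t₁..t₂, ((∫ x, (fderiv ℝ (fun y => ζ s y * angVortQuot (v s) y) x (EuclideanSpace.single 0 1) ^ 2 + fderiv ℝ (fun y => ζ s y * angVortQuot (v s) y) x (EuclideanSpace.single 1 1) ^ 2 + fderiv ℝ (fun y => ζ s y * angVortQuot (v s) y) x (EuclideanSpace.single 2 1) ^ 2)) + (∫ x, (fderiv ℝ (fun y => ζ s y * radVelQuot (curl (v s)) y) x (EuclideanSpace.single 0 1) ^ 2 + fderiv ℝ (fun y => ζ s y * radVelQuot (curl (v s)) y) x (EuclideanSpace.single 1 1) ^ 2 + fderiv ℝ (fun y => ζ s y * radVelQuot (curl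 (v s)) y) x (EuclideanSpace.single 2 1) ^ 2))) ≤ ((∫ x, (ζ t₁ x * angVortQuot (v t₁) x) ^ 2) + (∫ x, (ζ t₁ x * radVelQuot (curl (v t₁)) x) ^ 2) + (Bcut + (4 * C₁ * CL / Real.log (Real.exp 1 / r₁) ^ 2 + ((P₀ ^ 2 + P₁ ^ 2) / (2 * ε) + 2 * P₂) * V) + 4 * M * V) * (t₂ - t₁)) / (2 * ν - 8 * C₁ / Real.log (Real.exp 1 / r₁) - (C₁ * (1 + 4 * cL) / Real.log (Real.exp 1 / r₁) ^ 2 + 4 * ε)) := by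
  intro a b ν v ζ K W t₁ t₂ C₁ r₁ M Bcut ε P₀ P₁ P₂ cL CL V hu hax hν hζ hζax hζs hsub hK hsupp hWo hKW hdiv hvort hΓc hΓ'c hDΓc hJc hJ'c hDJc h12 hC₁ hr₁ hr₁1 hM hBcut hε hP₂ hcL hCL hV hσ hfar hcut hP0 hP1 hP2 hL21 hsmall
  have hVOL : 0 ≤ volume.real (closedBall (0 : EuclideanSpace ℝ (Fin 3)) 2) := measureReal_nonneg
  have hL₁0 : 0 < Real.log (Real.exp 1 / r₁) := by
    rw [log_exp_div_eq r₁ hr₁]; linarith [Real.log_neg hr₁ hr₁1]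
  have hBA : 0 ≤ (4 * C₁ * CL / Real.log (Real.exp 1 / r₁) ^ 2 + ((P₀ ^ 2 + P₁ ^ 2) / (2 * ε) + 2 * P₂) * volume.real (closedBall (0 : EuclideanSpace ℝ (Fin 3)) 2)) := by positivity
  have hA3 : ∀ t ∈ Icc t₁ t₂, 2 * (∫ x, ζ t x ^ 2 * radVelQuot (curl (v t)) x * fderiv ℝ (radVelQuot (v t)) x (curl (v t) x)) ≤
      (C₁ * (1 + 4 * cL) / Real.log (Real.exp 1 / r₁) ^ 2 + 4 * ε) * ((∫ x, (fderiv ℝ (fun y => ζ t y * angVortQuot (v t) y) x (EuclideanSpace.single 0 1) ^ 2 + fderiv ℝ (fun y => ζ t y * angVortQuot (v t) y) x (EuclideanSpace.single 1 1) ^ 2 + fderiv ℝ (fun y => ζ t y * angVortQuot (v t) y) x (EuclideanSpace.single 2 1) ^ 2)) + (∫ x, (fderiv ℝ (fun y => ζ t y * radVelQuot (curl (v t)) y) x (EuclideanSpace.single 0 1) ^ 2 + fderiv ℝ (fun y => ζ t y * radVelQuot (curl (v t)) y) x (EuclideanSpace.single 1 1) ^ 2 + fderiv ℝ (fun y =>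 ζ t y * radVelQuot (curl (v t)) y) x (EuclideanSpace.single 2 1) ^ 2))) + (4 * C₁ * CL / Real.log (Real.exp 1 / r₁) ^ 2 + ((P₀ ^ 2 + P₁ ^ 2) / (2 * ε) + 2 * P₂) * volume.real (closedBall (0 : EuclideanSpace ℝ (Fin 3)) 2)) := by
    intro t ht
    have hts : t ∈ Ioo a b := hsub ht
    have hv4 : ContDiff ℝ 4 (v t) := (hu t hts).of_le (by norm_cast)
    have hζ2 : ContDiff ℝ 2 (ζ t) := (hζ.contDiff_slice hts).of_le (by norm_cast)
    exact two_mul_integral_sourcePhi_le (v t) (ζ t) C₁ r₁ ε P₀ P₁ P₂ cL CL (hax t hts) hv4 hζ2 (hζax t hts)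
      (hζs t hts) hC₁ hr₁ hr₁1 hε hP₂ hcL (hσ t ht) (hP0 t ht) (hP1 t ht) (hP2 t ht) (hL21 t ht)
  obtain ⟨hsup, hdiss⟩ := cutoff_energy_keyEstimate_local a b ν v ζ K W t₁ t₂ C₁ r₁ M (C₁ * (1 + 4 * cL) / Real.log (Real.exp 1 / r₁) ^ 2 + 4 * ε) (4 * C₁ * CL / Real.log (Real.exp 1 / r₁) ^ 2 + ((P₀ ^ 2 + P₁ ^ 2) / (2 * ε) + 2 * P₂) * volume.real (closedBall (0 : EuclideanSpace ℝ (Fin 3)) 2)) Bcut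
    hu hax hν hζ hζax hζs hsub hK hsupp hWo hKW hdiv hvort hΓc hΓ'c hDΓc hJc hJ'c hDJc hC₁ hr₁ hr₁1 hM hσ hfar hcut hA3 hBcut hBA hsmall h12
  -- replace the ball volume by its upper bound `V`
  have hcoef : 0 ≤ (P₀ ^ 2 + P₁ ^ 2) / (2 * ε) + 2 * P₂ := by positivity
  have hmono : (Bcut + (4 * C₁ * CL / Real.log (Real.exp 1 / r₁) ^ 2 + ((P₀ ^ 2 + P₁ ^ 2) / (2 * ε) + 2 * P₂) * volume.real (closedBall (0 : EuclideanSpace ℝ (Fin 3)) 2)) + 4 * M * volume.real (closedBall (0 : EuclideanSpace ℝ (Fin 3)) 2)) * (t₂ - t₁) ≤ (Bcut + (4 * C₁ * CL / Real.log (Real.exp 1 / r₁) ^ 2 + ((P₀ ^ 2 + P₁ ^ 2) / (2 * ε) + 2 * P₂) * V) + 4 * M * V) * (t₂ - t₁) := by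
    apply mul_le_mul_of_nonneg_right _ (by linarith)
    nlinarith [mul_le_mul_of_nonneg_left hV hcoef, mul_le_mul_of_nonneg_left hV hM]
  have hpos : 0 < 2 * ν - 8 * C₁ / Real.log (Real.exp 1 / r₁) - (C₁ * (1 + 4 * cL) / Real.log (Real.exp 1 / r₁) ^ 2 + 4 * ε) := by linarith
  refine ⟨fun t ht => (hsup t ht).trans (by linarith), hdiss.trans ?_⟩
  exact div_le_div_of_nonneg_right (by linarith) hpos.le

/-- **Seregin 2022, §2 Step 3, the key estimate for the LOCAL smooth class, unconditional form**
(the Step-3 output consumed by Step 4): the statement of `cutoff_energy_keyEstimate_unconditional`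
with the whole-space classical solution `IsClassicalNSSolutionOn (Ioo a b) ν 0 v q` replaced by
a family `v` of globally `C^∞` axisymmetric fields on `(a, b)` which is divergence free and solves
the vorticity equation pointwise off the axis on an open `W` containing the compact `K` off which
`ζ` vanishes (`d/ds curl (v s) x = νΔω − Dω[v] + Dv[ω]`), together with the joint continuity on
the slab of `Γ = angVortQuot`, `Φ = radVelQuot ∘ curl`, their gradients and the quotients
`angVelQuot W`, `radVelQuot W` of the vorticity right-hand side (their time derivatives off the
axis). Hypotheses (2.2)/`M`/`Bcut`/`P₀…P₄`/`V`, the smallness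
`8C₁/ln(e/r₁) + 13C₁/ln²(e/r₁) + 4ε < 2ν`, the conclusion `sup_{[t₁,t₂]}(∫(ζΓ)² + ∫(ζΦ)²) ≤ K`,
`∫_{t₁}^{t₂}(∫|∇(ζΓ)|² + ∫|∇(ζΦ)|²) ≤ K/(2ν − 8C₁/L − (13C₁/L² + 4ε))` and the constant
`K = E(t₁) + (Bcut + (12C₁(P₃² + P₄²)V/L² + ((P₀² + P₁²)/(2ε) + 2P₂)V) + 4MV)(t₂ − t₁)` are
verbatim those of the classical version. [cite: Seregin2022LocalAxisym, §2 Step 3 (arXiv:2201.00153 p. 7, the key estimate) and Lemma 2.1 (p. 5)] -/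
theorem cutoff_energy_keyEstimate_local_unconditional : ∀ (a b ν : ℝ) (v : ℝ → EuclideanSpace ℝ (Fin 3) → EuclideanSpace ℝ (Fin 3)) (ζ : ℝ → EuclideanSpace ℝ (Fin 3) → ℝ) (K W : Set (EuclideanSpace ℝ (Fin 3))) (t₁ t₂ C₁ r₁ M Bcut ε P₀ P₁ P₂ P₃ P₄ V : ℝ), (∀ s ∈ Ioo a b, ContDiff ℝ (⊤ : ℕ∞) (v s)) → (∀ s ∈ Ioo a b, IsAxisymmetric (v s)) → 0 ≤ ν → IsSmoothSpaceTimeOn (Ioo a b) ζ → (∀ s ∈ Ioo a b, IsAxisymmetricScalar (ζ s)) → (∀ s ∈ Ioo a b, tsupport (ζ s) ⊆ SereginSverak2009.spaceCyl 0 1) → Icc t₁ t₂ ⊆ Ioo a b → IsCompact K → (∀ s ∈ Ioo a b, ∀ x ∉ K, ζ s x = 0) → IsOpen W → K ⊆ W → (∀ s ∈ Ioo a b, ∀ x ∈ W, VectorCalculus.divergence (v s) x = 0) → (∀ s ∈ Ioo a b, ∀ x ∈ W, cylRadius x ≠ 0 → HasDerivAt (fun s' => curl (v s') x) (ν • (Δ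 (curl (v s))) x - fderiv ℝ (curl (v s)) x (v s x) + fderiv ℝ (v s) x (curl (v s) x)) s) → ContinuousOn (fun z : ℝ × EuclideanSpace ℝ (Fin 3) => angVortQuot (v z.1) z.2) (Ioo a b ×ˢ univ) → ContinuousOn (fun z : ℝ × EuclideanSpace ℝ (Fin 3) => angVelQuot (fun y => ν • (Δ (curl (v z.1))) y - fderiv ℝ (curl (v z.1)) y (v z.1 y) + fderiv ℝ (v z.1) y (curl (v z.1) y)) z.2) (Ioo a b ×ˢ univ) → ContinuousOn (fun z : ℝ × EuclideanSpace ℝ (Fin 3) => fderiv ℝ (angVortQuot (v z.1)) z.2) (Ioo a b ×ˢ univ) → ContinuousOn (fun z : ℝ × EuclideanSpace ℝ (Fin 3) => radVelQuot (curl (v z.1)) z.2) (Ioo a b ×ˢ univ) → ContinuousOn (fun z : ℝ × EuclideanSpace ℝ (Fin 3) => radVelQuot (fun y => ν • (Δ (curl (v z.1))) y - fderiv ℝ (curl (v z.1)) y (v z.1 y) + fderiv ℝ (v z.1) y (curl (v z.1) y)) z.2) (Ioo a b ×ˢ univ) → ContinuousOn (fun z : ℝ × EuclideanSpace ℝ (Fin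 3) => fderiv ℝ (radVelQuot (curl (v z.1))) z.2) (Ioo a b ×ˢ univ) → t₁ ≤ t₂ → 0 ≤ C₁ → 0 < r₁ → r₁ < 1 → 0 ≤ M → 0 ≤ Bcut → 0 < ε → 0 ≤ P₂ → volume.real (closedBall (0 : EuclideanSpace ℝ (Fin 3)) 2) ≤ V → (∀ t ∈ Icc t₁ t₂, ∀ x, 0 < cylRadius x → cylRadius x < r₁ → |swirl (v t) x| ≤ C₁ / Real.log (Real.exp 1 / cylRadius x) ^ 3) → (∀ t ∈ Icc t₁ t₂, ∀ x, r₁ ≤ cylRadius x → |angVelQuot (v t) x * (ζ t x * angVortQuot (v t) x) * (ζ t x * radVelQuot (curl (v t)) x)| ≤ M) → (∀ t ∈ Icc t₁ t₂, (2 * (∫ x, ζ t x * timeDerivWithin (Ioo a b) ζ t x * angVortQuot (v t) x ^ 2) + 2 * (∫ x, ζ t x * angVortQuot (v t) x ^ 2 * fderiv ℝ (ζ t) x (v t x)) + 2 * ν * (∫ x, angVortQuot (v t) x ^ 2 * (fderiv ℝ (ζ t) x (EuclideanSpace.single 0 1) ^ 2 + fderiv ℝ (ζ t) x (EuclideanSpace.single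 1 1) ^ 2 + fderiv ℝ (ζ t) x (EuclideanSpace.single 2 1) ^ 2)) - 4 * ν * (∫ x, ζ t x * angVortQuot (v t) x ^ 2 * radDerivQuot (ζ t) x)) + (2 * (∫ x, ζ t x * timeDerivWithin (Ioo a b) ζ t x * radVelQuot (curl (v t)) x ^ 2) + 2 * (∫ x, ζ t x * radVelQuot (curl (v t)) x ^ 2 * fderiv ℝ (ζ t) x (v t x)) + 2 * ν * (∫ x, radVelQuot (curl (v t)) x ^ 2 * (fderiv ℝ (ζ t) x (EuclideanSpace.single 0 1) ^ 2 + fderiv ℝ (ζ t) x (EuclideanSpace.single 1 1) ^ 2 + fderiv ℝ (ζ t) x (EuclideanSpace.single 2 1) ^ 2)) - 4 * ν * (∫ x, ζ t x * radVelQuot (curl (v t)) x ^ 2 * radDerivQuot (ζ t) x)) ≤ Bcut) → (∀ t ∈ Icc t₁ t₂, ∀ x, r₁ ≤ cylRadius x → |swirlVelocity (v t) x| * ‖fderiv ℝ (fun y => ζ t y * radVelQuot (v t) y) x‖ ≤ P₀) → (∀ t ∈ Icc t₁ t₂, ∀ x, |radVelQuot (v t) x| * |swirlVelocity (v t) x|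 * ‖fderiv ℝ (ζ t) x‖ ≤ P₁) → (∀ t ∈ Icc t₁ t₂, ∀ x, |ζ t x * radVelQuot (curl (v t)) x| * |swirlVelocity (v t) x| * (‖fderiv ℝ (ζ t) x‖ * ‖fderiv ℝ (radVelQuot (v t)) x‖) ≤ P₂) → (∀ t ∈ Icc t₁ t₂, ∀ x, fderiv ℝ (ζ t) x ≠ 0 → |fderiv ℝ (fun y => fderiv ℝ (ζ t) y (EuclideanSpace.single 2 1) * radVelQuot (v t) y - radDerivQuot (ζ t) y * v t y 2) x (EuclideanSpace.single 2 1)| ≤ P₃) → (∀ t ∈ Icc t₁ t₂, ∀ x, fderiv ℝ (ζ t) x ≠ 0 → |radDerivQuot (fun y => fderiv ℝ (ζ t) y (v t y)) x| ≤ P₄) → 8 * C₁ / Real.log (Real.exp 1 / r₁) + (13 * C₁ / Real.log (Real.exp 1 / r₁) ^ 2 + 4 * ε) < 2 * ν → (∀ t ∈ Icc t₁ t₂, (∫ x, (ζ t x * angVortQuot (v t) x) ^ 2) + (∫ x, (ζ t x * radVelQuot (curl (v t)) x) ^ 2) ≤ (∫ x, (ζ t₁ x * angVortQuot (v t₁)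 x) ^ 2) + (∫ x, (ζ t₁ x * radVelQuot (curl (v t₁)) x) ^ 2) + (Bcut + (12 * C₁ * (P₃ ^ 2 + P₄ ^ 2) * V / Real.log (Real.exp 1 / r₁) ^ 2 + ((P₀ ^ 2 + P₁ ^ 2) / (2 * ε) + 2 * P₂) * V) + 4 * M * V) * (t₂ - t₁)) ∧ ∫ s in t₁..t₂, ((∫ x, (fderiv ℝ (fun y => ζ s y * angVortQuot (v s) y) x (EuclideanSpace.single 0 1) ^ 2 + fderiv ℝ (fun y => ζ s y * angVortQuot (v s) y) x (EuclideanSpace.single 1 1) ^ 2 + fderiv ℝ (fun y => ζ s y * angVortQuot (v s) y) x (EuclideanSpace.single 2 1) ^ 2)) + (∫ x, (fderiv ℝ (fun y => ζ s y * radVelQuot (curl (v s)) y) x (EuclideanSpace.single 0 1) ^ 2 + fderiv ℝ (fun y => ζ s y * radVelQuot (curl (v s)) y) x (EuclideanSpace.single 1 1) ^ 2 + fderiv ℝ (fun y => ζ s y * radVelQuot (curl (v s)) y) x (EuclideanSpace.single 2 1) ^ 2))) ≤ ((∫ x, (ζ t₁ x * angVortQuot (v t₁) x) ^ 2) + (∫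 x, (ζ t₁ x * radVelQuot (curl (v t₁)) x) ^ 2) + (Bcut + (12 * C₁ * (P₃ ^ 2 + P₄ ^ 2) * V / Real.log (Real.exp 1 / r₁) ^ 2 + ((P₀ ^ 2 + P₁ ^ 2) / (2 * ε) + 2 * P₂) * V) + 4 * M * V) * (t₂ - t₁)) / (2 * ν - 8 * C₁ / Real.log (Real.exp 1 / r₁) - (13 * C₁ / Real.log (Real.exp 1 / r₁) ^ 2 + 4 * ε)) := by
  intro a b ν v ζ K W t₁ t₂ C₁ r₁ M Bcut ε P₀ P₁ P₂ P₃ P₄ V hu hax hν hζ hζax hζs hsub hK hsupp hWo hKW hdiv hvort hΓc hΓ'c hDΓc hJc hJ'c hDJc h12 hC₁ hr₁ hr₁1 hM hBcut hε hP₂ hV hσ hfar hcut hP0 hP1 hP2 hP3 hP4 hsmall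
  have hVOL : 0 ≤ volume.real (closedBall (0 : EuclideanSpace ℝ (Fin 3)) 2) := measureReal_nonneg
  have hV0 : 0 ≤ V := hVOL.trans hV
  have hCL : 0 ≤ 3 * (P₃ ^ 2 + P₄ ^ 2) * V := mul_nonneg (by positivity) hV0
  -- Lemma 2.1 (ii), numeric form, at every `t ∈ [t₁, t₂]`
  have hL21 : ∀ t ∈ Icc t₁ t₂, (∫ x, ∑ i : Fin 3, ∑ j : Fin 3, (fderiv ℝ (fun y => fderiv ℝ (fun y => ζ t y * radVelQuot (v t) y) y (EuclideanSpace.single i 1)) x (EuclideanSpace.single j 1)) ^ 2) ≤ 3 * (∫ x, (fderiv ℝ (fun y => ζ t y * angVortQuot (v t) y) x (EuclideanSpace.single 0 1) ^ 2 + fderiv ℝ (fun y => ζ t y * angVortQuot (v t) y) x (EuclideanSpace.single 1 1) ^ 2 + fderiv ℝ (fun y => ζ t y * angVortQuot (v t) y) x (EuclideanSpace.single 2 1) ^ 2)) + 3 * (P₃ ^ 2 + P₄ ^ 2) * V := by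
    intro t ht
    have hts : t ∈ Ioo a b := hsub ht
    have hv5 : ContDiff ℝ 5 (v t) := (hu t hts).of_le (by norm_cast)
    have hζ5 : ContDiff ℝ 5 (ζ t) := (hζ.contDiff_slice hts).of_le (by norm_cast)
    have hKt : tsupport (ζ t) ⊆ K :=
      closure_minimal (fun y hy => by_contra fun h => hy (hsupp t hts y h)) hK.isClosed
    have hdivt : ∀ y ∈ tsupport (ζ t), VectorCalculus.divergence (v t) y = 0 := fun y hy =>
      hdiv t hts y (hKW (hKt hy))
    exact integral_hessianSq_cutoff_radVelQuot_le_of_pointwise hζ5 (hζax t hts) (hζs t hts) hv5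
      (hax t hts) hdivt hV (hP3 t ht) (hP4 t ht)
  have hsmall' : 8 * C₁ / Real.log (Real.exp 1 / r₁) + (C₁ * (1 + 4 * 3) / Real.log (Real.exp 1 / r₁) ^ 2 + 4 * ε) < 2 * ν := by
    have e : C₁ * (1 + 4 * 3) = 13 * C₁ := by ring
    rw [e]; exact hsmall
  obtain ⟨hsup, hdiss⟩ := cutoff_energy_keyEstimate_local_of_lemma21 a b ν v ζ K W t₁ t₂ C₁ r₁ M Bcut ε P₀ P₁ P₂ 3 (3 * (P₃ ^ 2 + P₄ ^ 2) * V) V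
    hu hax hν hζ hζax hζs hsub hK hsupp hWo hKW hdiv hvort hΓc hΓ'c hDΓc hJc hJ'c hDJc h12 hC₁ hr₁ hr₁1 hM hBcut hε hP₂ (by norm_num) hCL hV hσ hfar hcut hP0 hP1 hP2 hL21 hsmall'
  have e1 : C₁ * (1 + 4 * 3) = 13 * C₁ := by ring
  have e2 : 4 * C₁ * (3 * (P₃ ^ 2 + P₄ ^ 2) * V) = 12 * C₁ * (P₃ ^ 2 + P₄ ^ 2) * V := by ring
  simp only [e1, e2] at hsup hdiss
  exact ⟨hsup, hdiss⟩

end Literature.Analysis.SereginLogSwirlOrigin.EulerScaling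

end Part6

/-!
## Part 7 — port of `Summits/NavierStokesRegularity/NavierStokesRegularity/Theorems/AxisymmetricExtremalityAxisymmetricKatoGlobalStubSereginLogSwirlOriginStep3LocalFamilies.lean` (8 declarations kept)

# Seregin 2022, §2 Step 3 for the LOCAL smooth class (VIII): joint continuity of the smooth
# radial quotients `Γ = ω_θ/r`, `Φ = ω_r/r`, … of a family of smooth fields from uniform-in-`x`
# time moduli of its `x`-derivatives — crux stmt-NavierStokesRegularity-15453
# (`AxisymmetricExtremality.AxisymmetricKatoGlobal`), line registered, support for stub `stub_sereginLogSwirlOrigin`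

Support file (`--supports stmt-NavierStokesRegularity-15453`; theorems only, everything proved)
toward the registered stub `stub_sereginLogSwirlOrigin` = the named fact
`Literature.Analysis.FluidPDE.seregin2022_logSwirl_regularAtOrigin` (G. Seregin, J. Math. Fluid
Mech. 24 (2022), Paper 27 = arXiv:2201.00153, §2). The key estimate of Step 3 for the local
class (`cutoff_energy_keyEstimate_local_unconditional`, sibling `…Step3LocalKeyEstimate0`) asks
for the joint continuity on the slab of the smooth quotients `Γ = angVortQuot (v t)`,
`Φ = radVelQuot (curl (v t))`, of their gradients and of `angVelQuot W`, `radVelQuot W` (`W` the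
vorticity right-hand side). For the cut-off globalisation `χV` of the Seregin–Zajaczkowski
representative the available time regularity is that of the class: all spatial derivatives
jointly continuous, which — `χV` having its support in a fixed compact set — is the uniform-in-`x`
continuity in time of every `D_xᵏ(χV)` (the `hunif` moduli of the tree's no-swirl maximum
principle, `AxisymNoSwirlLocalMaxPrinciple`). This file transfers such moduli through the
LINEAR operations building the quotients, with the sup bounds of the tree:

* `radDerivQuot_sub`, `radQuot_sub` — linearity of the smooth radial quotients
  `(∂ᵣS)/r = hadamardQuotFst (∂₀S)`, `S/r² = radQuot S`;
* `radQuot_sub_bounds` — `|radQuot S₁ − radQuot S₂| ≤ D₂/2`, `‖D(radQuot S₁) − D(radQuot S₂)‖ ≤ D₃/2`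
  from `‖D²S₁ − D²S₂‖ ≤ D₂`, `‖D³S₁ − D³S₂‖ ≤ D₃` (`abs_radQuot_le`, `norm_fderiv_radQuot_le`,
  `norm_fderiv_hadamardQuotFst_le`);
* `continuousOn_radQuot_family` (registered sub-goal) — **a scalar family `F` with smooth slices
  and uniform-in-`x` time moduli of `D²F`, `D³F` on `S` has `(t, x) ↦ radQuot (F t) x` and
  `(t, x) ↦ D(radQuot (F t))(x)` jointly continuous on `S × ℝ³`** (`continuousOn_prod_of_unifTime`);
* `unifTime_mono_order` — moduli for all orders at once up to `k`;
* `unifTime_curl` — the moduli pass to `curl` (`‖Dⁿ curl f‖ ≤ ‖curlCLM‖‖Dⁿ⁺¹f‖`);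
* `unifTime_bilinear` — and through a continuous bilinear pairing `B (f t y) (g t y)` of two
  families with moduli, the second supported in a fixed ball (Leibniz bound
  `ContinuousLinearMap.norm_iteratedFDeriv_le_of_bilinear`; off the ball everything vanishes) —
  covering `swirl w = ⟪Jy, w⟫`, `⟪y_h, w⟫`, and the products `Dω[u]`, `Du[ω]` of `W`.

## Mathlib / tree search

Tree: `continuousOn_prod_of_unifTime`, `curl_apply_one_unifTime`, `scalar_family_continuousOn`
(`AxisymNoSwirlLocalMaxPrinciple`, the same transfer for `hadamardQuotFst (curl W)₁`),
`hadamardQuotFst_sub`, `hadamardQuotFst_liftData_sub_bounds`, `norm_iteratedFDeriv_clm_apply_fderiv_le`,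
`norm_fderiv_fderiv_apply_le_of_smooth`, `fderiv_apply_sub_of_smooth` (`KNSSThm52Assembly`),
`abs_radQuot_le`, `abs_radDerivQuot_le`, `norm_fderiv_radQuot_le`, `hasFDerivAt_radQuot`,
`continuous_scaleH_left` (`AxisymRadialQuotient`), `norm_fderiv_hadamardQuotFst_le` (`HadamardQuotient`).
Mathlib: `ContinuousLinearMap.norm_iteratedFDeriv_le_of_bilinear`, `ContinuousLinearMap.iteratedFDeriv_comp_left`,
`norm_iteratedFDeriv_fderiv`, `Filter.EventuallyEq.iteratedFDeriv`, `iteratedFDeriv_sub_apply`.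
`lean search 'radQuot_sub|unifTime_bilinear|radQuot_family' --decl`: no matches (2026-08-17).

## References

* G. Seregin, J. Math. Fluid Mech. 24 (2022), Paper No. 27 = arXiv:2201.00153, §2 Step 3
  (arXiv pp. 6–7). [`Seregin2022LocalAxisym`]
-/

section Part7

open _root_.MeasureTheory _root_.Set _root_.Filter _root_.Topology _root_.Function _root_.Metric
open scoped _root_.ContDiff RealInnerProductSpace
open Literature.Analysis.FluidPDE

namespace Literature.Analysis.SereginLogSwirlOrigin.EulerScaling

/-! ### Linearity and Lipschitz bounds of the smooth radial quotients -/

section RadQuot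

variable {S₁ S₂ : EuclideanSpace ℝ (Fin 3) → ℝ}

/-- Linearity of the radial derivative quotient `(∂ᵣS)/r = hadamardQuotFst (∂₀S)`. [folklore]
[cite: Seregin2022LocalAxisym, §2 proof of Thm. 1.2, Step 3 (arXiv:2201.00153 pp. 4–7) (source of the ARGUMENT this module implements; this declaration is the cell’s own lemma or plumbing, NOT a printed statement)] -/
theorem radDerivQuot_sub (hS₁ : ContDiff ℝ ∞ S₁) (hS₂ : ContDiff ℝ ∞ S₂) :
    radDerivQuot (S₁ - S₂) = radDerivQuot S₁ - radDerivQuot S₂ := by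
  unfold radDerivQuot
  rw [fderiv_apply_sub_of_smooth hS₁ hS₂]
  exact hadamardQuotFst_sub ((contDiff_infty_fderiv_apply hS₁ _).of_le (by norm_cast))
    ((contDiff_infty_fderiv_apply hS₂ _).of_le (by norm_cast))

/-- Linearity of the radial quotient `S/r² = radQuot S`. [folklore]
[cite: Seregin2022LocalAxisym, §2 proof of Thm. 1.2, Step 3 (arXiv:2201.00153 pp. 4–7) (source of the ARGUMENT this module implements; this declaration is the cell’s own lemma or plumbing, NOT a printed statement)] -/
theorem radQuot_sub (hS₁ : ContDiff ℝ ∞ S₁) (hS₂ : ContDiff ℝ ∞ S₂) (x : EuclideanSpace ℝ (Fin 3)) :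
    radQuot (S₁ - S₂) x = radQuot S₁ x - radQuot S₂ x := by
  have hint : ∀ {S : EuclideanSpace ℝ (Fin 3) → ℝ}, ContDiff ℝ ∞ S →
      IntervalIntegrable (fun s : ℝ => s * radDerivQuot S (scaleH s x)) volume 0 1 := fun hS =>
    (continuous_id.mul ((continuous_radDerivQuot (hS.of_le (by norm_cast))).comp
      (continuous_scaleH_left x))).intervalIntegrable 0 1
  unfold radQuot
  rw [radDerivQuot_sub hS₁ hS₂, ← intervalIntegral.integral_sub (hint hS₁) (hint hS₂)]
  refine intervalIntegral.integral_congr fun s _ => ?_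
  simp only [Pi.sub_apply]
  ring

/-- **Lipschitz dependence of `radQuot S` and its gradient on `D²S`, `D³S`**: for smooth `S₁, S₂`
with `‖D²S₁ − D²S₂‖ ≤ D₂`, `‖D³S₁ − D³S₂‖ ≤ D₃` everywhere,
`|radQuot S₁ x − radQuot S₂ x| ≤ D₂/2` and `‖D(radQuot S₁)(x) − D(radQuot S₂)(x)‖ ≤ D₃/2`
(everything is linear in `S`; `abs_radQuot_le`, `norm_fderiv_radQuot_le`). [folklore]
[cite: Seregin2022LocalAxisym, §2 proof of Thm. 1.2, Step 3 (arXiv:2201.00153 pp. 4–7) (source of the ARGUMENT this module implements; this declaration is the cell’s own lemma or plumbing, NOT a printed statement)] -/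
theorem radQuot_sub_bounds (hS₁ : ContDiff ℝ ∞ S₁) (hS₂ : ContDiff ℝ ∞ S₂) {D₂ D₃ : ℝ}
    (h2 : ∀ y, ‖iteratedFDeriv ℝ 2 S₁ y - iteratedFDeriv ℝ 2 S₂ y‖ ≤ D₂)
    (h3 : ∀ y, ‖iteratedFDeriv ℝ 3 S₁ y - iteratedFDeriv ℝ 3 S₂ y‖ ≤ D₃)
    (x : EuclideanSpace ℝ (Fin 3)) :
    |radQuot S₁ x - radQuot S₂ x| ≤ D₂ / 2 ∧
    ‖fderiv ℝ (radQuot S₁) x - fderiv ℝ (radQuot S₂) x‖ ≤ D₃ / 2 := by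
  set S : EuclideanSpace ℝ (Fin 3) → ℝ := S₁ - S₂ with hSdef
  have hS : ContDiff ℝ ∞ S := hS₁.sub hS₂
  have hiter : ∀ (k : ℕ) (y : EuclideanSpace ℝ (Fin 3)),
      iteratedFDeriv ℝ k S y = iteratedFDeriv ℝ k S₁ y - iteratedFDeriv ℝ k S₂ y := fun k y =>
    iteratedFDeriv_sub_apply (hS₁.of_le (natCast_le_contDiff_infty k)).contDiffAt
      (hS₂.of_le (natCast_le_contDiff_infty k)).contDiffAt
  have h2' : ∀ y, ‖iteratedFDeriv ℝ 2 S y‖ ≤ D₂ := fun y => by rw [hiter]; exact h2 y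
  have h3' : ∀ y, ‖iteratedFDeriv ℝ 3 S y‖ ≤ D₃ := fun y => by rw [hiter]; exact h3 y
  have he : ‖(EuclideanSpace.single (0 : Fin 3) (1 : ℝ))‖ = 1 := by rw [PiLp.norm_single, norm_one]
  -- `|radDerivQuot S| ≤ D₂`
  have hB2 : ∀ y, ‖fderiv ℝ (fun y => fderiv ℝ S y (EuclideanSpace.single 0 1)) y‖ ≤ D₂ := fun y => by
    have h := norm_fderiv_fderiv_apply_le_of_smooth hS y (EuclideanSpace.single 0 1)
    rw [he, one_mul] at h
    exact h.trans (h2' y)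
  have hq : ∀ y, |radDerivQuot S y| ≤ D₂ := abs_radDerivQuot_le hB2
  -- `‖D(radDerivQuot S)‖ ≤ D₃`
  set w : EuclideanSpace ℝ (Fin 3) → ℝ := fun y => fderiv ℝ S y (EuclideanSpace.single 0 1) with hw
  have hwS : ContDiff ℝ ∞ w := contDiff_infty_fderiv_apply hS _
  have hB3 : ∀ y, ‖fderiv ℝ (fun y => fderiv ℝ w y (EuclideanSpace.single 0 1)) y‖ ≤ D₃ := fun y => by
    have h := norm_fderiv_fderiv_apply_le_of_smooth hwS y (EuclideanSpace.single 0 1)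
    rw [he, one_mul] at h
    refine h.trans ?_
    have h' := norm_iteratedFDeriv_clm_apply_fderiv_le
      (ContinuousLinearMap.apply ℝ ℝ (EuclideanSpace.single (0 : Fin 3) (1 : ℝ))) hS 2 y
    simp only [ContinuousLinearMap.apply_apply] at h'
    have hΛ : ‖ContinuousLinearMap.apply ℝ ℝ (EuclideanSpace.single (0 : Fin 3) (1 : ℝ))‖ ≤ 1 := by
      refine ContinuousLinearMap.opNorm_le_bound _ zero_le_one fun L => ?_
      rw [ContinuousLinearMap.apply_apply, one_mul]
      simpa [he] using L.le_opNorm (EuclideanSpace.single (0 : Fin 3) (1 : ℝ))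
    calc ‖iteratedFDeriv ℝ 2 w y‖ ≤ ‖ContinuousLinearMap.apply ℝ ℝ (EuclideanSpace.single (0 : Fin 3) (1 : ℝ))‖ *
          ‖iteratedFDeriv ℝ 3 S y‖ := h'
      _ ≤ 1 * D₃ := mul_le_mul hΛ (h3' y) (norm_nonneg _) zero_le_one
      _ = D₃ := one_mul _
  have hDq : ∀ y, ‖fderiv ℝ (radDerivQuot S) y‖ ≤ D₃ := fun y =>
    norm_fderiv_hadamardQuotFst_le (hwS.of_le (by norm_cast)) hB3 y
  -- linearity
  have hsub : radQuot S = radQuot S₁ - radQuot S₂ := funext fun y => radQuot_sub hS₁ hS₂ y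
  have hr₁ : ContDiff ℝ ∞ (radQuot S₁) := contDiff_radQuot (n := ⊤) (by exact_mod_cast hS₁)
  have hr₂ : ContDiff ℝ ∞ (radQuot S₂) := contDiff_radQuot (n := ⊤) (by exact_mod_cast hS₂)
  refine ⟨?_, ?_⟩
  · have h := abs_radQuot_le hq x
    rwa [hsub, Pi.sub_apply] at h
  · have h := norm_fderiv_radQuot_le (hS.of_le (by norm_cast)) hDq x
    rwa [hsub, fderiv_sub ((hr₁.differentiable (by simp)) x) ((hr₂.differentiable (by simp)) x)] at h

end RadQuot

/-! ### Joint continuity of radial quotients from uniform-in-`x` time moduli -/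

section Family

variable {S : Set ℝ} {F : ℝ → EuclideanSpace ℝ (Fin 3) → ℝ}

/-- **Joint continuity of `radQuot (F t) x` and of its gradient from uniform-in-`x` time
moduli.** If every slice `F t`, `t ∈ S`, is smooth and the derivatives `D²F`, `D³F` are
continuous in `t` uniformly in `x` on `S` (`‖DᵏF(t', y) − DᵏF(t, y)‖ ≤ ε` for `|t' − t| < δ`,
all `y`, `k = 2, 3`), then `(t, x) ↦ radQuot (F t) x` and `(t, x) ↦ D(radQuot (F t))(x)` are
continuous on `S × ℝ³` (`radQuot_sub_bounds` and `continuousOn_prod_of_unifTime`). For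
`F t = swirl (curl (v t))` this is the joint continuity of `Γ = ω_θ/r` and `∇Γ`, for
`F t = ⟪x_h, curl (v t)⟫` that of `Φ = ω_r/r` and `∇Φ`, for `F t = swirl W(t)`, `⟪x_h, W(t)⟫`
(`W` the vorticity right-hand side) that of the time derivatives `∂ₜΓ`, `∂ₜΦ` of Step 3 for the
local smooth class. Registered sub-goal toward `stub_sereginLogSwirlOrigin`. [folklore]
[cite: Seregin2022LocalAxisym, §2 proof of Thm. 1.2, Step 3 (arXiv:2201.00153 pp. 4–7) (source of the ARGUMENT this module implements; this declaration is the cell’s own lemma or plumbing, NOT a printed statement)] -/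
theorem continuousOn_radQuot_family : ∀ (S : Set ℝ) (F : ℝ → EuclideanSpace ℝ (Fin 3) → ℝ), (∀ t ∈ S, ContDiff ℝ (⊤ : ℕ∞) (F t)) → (∀ k : ℕ, k = 2 ∨ k = 3 → ∀ t ∈ S, ∀ ε > 0, ∃ δ > 0, ∀ t' ∈ S, |t' - t| < δ → ∀ y, ‖iteratedFDeriv ℝ k (F t') y - iteratedFDeriv ℝ k (F t) y‖ ≤ ε) → ContinuousOn (fun z : ℝ × EuclideanSpace ℝ (Fin 3) => radQuot (F z.1) z.2) (S ×ˢ univ) ∧ ContinuousOn (fun z : ℝ × EuclideanSpace ℝ (Fin 3) => fderiv ℝ (radQuot (F z.1)) z.2) (S ×ˢ univ) := by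
  intro S F hF hU
  have hmod : ∀ t ∈ S, ∀ ε > 0, ∃ δ > 0, ∀ t' ∈ S, |t' - t| < δ → ∀ x,
      |radQuot (F t') x - radQuot (F t) x| ≤ ε ∧
      ‖fderiv ℝ (radQuot (F t')) x - fderiv ℝ (radQuot (F t)) x‖ ≤ ε := by
    intro t ht ε hε
    obtain ⟨δ₂, hδ₂, h₂⟩ := hU 2 (Or.inl rfl) t ht ε hε
    obtain ⟨δ₃, hδ₃, h₃⟩ := hU 3 (Or.inr rfl) t ht ε hε
    refine ⟨min δ₂ δ₃, lt_min hδ₂ hδ₃, fun t' ht' hlt x => ?_⟩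
    have hb := radQuot_sub_bounds (hF t' ht') (hF t ht)
      (h₂ t' ht' (hlt.trans_le (min_le_left _ _))) (h₃ t' ht' (hlt.trans_le (min_le_right _ _))) x
    exact ⟨hb.1.trans (by linarith), hb.2.trans (by linarith)⟩
  have hsl : ∀ t ∈ S, ContDiff ℝ ∞ (radQuot (F t)) := fun t ht =>
    contDiff_radQuot (n := ⊤) (by exact_mod_cast hF t ht)
  refine ⟨?_, ?_⟩
  · refine continuousOn_prod_of_unifTime (ψ := fun t x => radQuot (F t) x) (fun t ht ε hε => ?_)
      fun t ht => (hsl t ht).continuous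
    obtain ⟨δ, hδ, h⟩ := hmod t ht ε hε
    exact ⟨δ, hδ, fun t' ht' hlt x => by rw [Real.norm_eq_abs]; exact (h t' ht' hlt x).1⟩
  · refine continuousOn_prod_of_unifTime (ψ := fun t x => fderiv ℝ (radQuot (F t)) x)
      (fun t ht ε hε => ?_) fun t ht => (hsl t ht).continuous_fderiv (by simp)
    obtain ⟨δ, hδ, h⟩ := hmod t ht ε hε
    exact ⟨δ, hδ, fun t' ht' hlt x => (h t' ht' hlt x).2⟩

end Family

/-! ### Transfer of uniform-in-`x` time moduli through linear and bilinear operations -/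

section Transfer

variable {S : Set ℝ}

/-- Moduli for all orders `≤ k` at once. [folklore]
[cite: Seregin2022LocalAxisym, §2 proof of Thm. 1.2, Step 3 (arXiv:2201.00153 pp. 4–7) (source of the ARGUMENT this module implements; this declaration is the cell’s own lemma or plumbing, NOT a printed statement)] -/
theorem unifTime_mono_order {E : Type*} [NormedAddCommGroup E] [NormedSpace ℝ E]
    {f : ℝ → EuclideanSpace ℝ (Fin 3) → E}
    (hU : ∀ k : ℕ, ∀ t ∈ S, ∀ ε > 0, ∃ δ > 0, ∀ t' ∈ S, |t' - t| < δ → ∀ y,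
      ‖iteratedFDeriv ℝ k (f t') y - iteratedFDeriv ℝ k (f t) y‖ ≤ ε)
    (k : ℕ) {t : ℝ} (ht : t ∈ S) {ε : ℝ} (hε : 0 < ε) :
    ∃ δ > 0, ∀ j ≤ k, ∀ t' ∈ S, |t' - t| < δ → ∀ y,
      ‖iteratedFDeriv ℝ j (f t') y - iteratedFDeriv ℝ j (f t) y‖ ≤ ε := by
  induction k with
  | zero =>
    obtain ⟨δ, hδ, h⟩ := hU 0 t ht ε hε
    exact ⟨δ, hδ, fun j hj => by obtain rfl : j = 0 := Nat.le_zero.1 hj; exact h⟩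
  | succ k ih =>
    obtain ⟨δ₁, hδ₁, h₁⟩ := ih
    obtain ⟨δ₂, hδ₂, h₂⟩ := hU (k + 1) t ht ε hε
    refine ⟨min δ₁ δ₂, lt_min hδ₁ hδ₂, fun j hj t' ht' hlt y => ?_⟩
    rcases Nat.of_le_succ hj with hj' | rfl
    · exact h₁ j hj' t' ht' (hlt.trans_le (min_le_left _ _)) y
    · exact h₂ t' ht' (hlt.trans_le (min_le_right _ _)) y

/-- **The moduli pass to the curl**: `‖Dⁿ curl f‖ ≤ ‖curlCLM‖ ‖Dⁿ⁺¹ f‖` and linearity. [folklore]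
[cite: Seregin2022LocalAxisym, §2 proof of Thm. 1.2, Step 3 (arXiv:2201.00153 pp. 4–7) (source of the ARGUMENT this module implements; this declaration is the cell’s own lemma or plumbing, NOT a printed statement)] -/
theorem unifTime_curl {u : ℝ → EuclideanSpace ℝ (Fin 3) → EuclideanSpace ℝ (Fin 3)}
    (hu : ∀ t ∈ S, ContDiff ℝ ∞ (u t))
    (hU : ∀ k : ℕ, ∀ t ∈ S, ∀ ε > 0, ∃ δ > 0, ∀ t' ∈ S, |t' - t| < δ → ∀ y,
      ‖iteratedFDeriv ℝ k (u t') y - iteratedFDeriv ℝ k (u t) y‖ ≤ ε) :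
    ∀ k : ℕ, ∀ t ∈ S, ∀ ε > 0, ∃ δ > 0, ∀ t' ∈ S, |t' - t| < δ → ∀ y,
      ‖iteratedFDeriv ℝ k (curl (u t')) y - iteratedFDeriv ℝ k (curl (u t)) y‖ ≤ ε := by
  intro k t ht ε hε
  obtain ⟨δ, hδ, h⟩ := hU (k + 1) t ht (ε / (‖curlCLM‖ + 1)) (by positivity)
  refine ⟨δ, hδ, fun t' ht' hlt y => ?_⟩
  have hd : ContDiff ℝ ∞ (u t' - u t) := (hu t' ht').sub (hu t ht)
  have hcurl : curl (u t') - curl (u t) = curl (u t' - u t) := by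
    funext z
    show curlCLM (fderiv ℝ (u t') z) - curlCLM (fderiv ℝ (u t) z) = curlCLM (fderiv ℝ (u t' - u t) z)
    rw [fderiv_sub (((hu t' ht').differentiable (by simp)) z) (((hu t ht).differentiable (by simp)) z),
      map_sub]
  have hc' : ∀ s ∈ S, ContDiff ℝ k (curl (u s)) := fun s hs =>
    contDiff_curl (n := k) ((hu s hs).of_le (by exact_mod_cast le_top))
  rw [← iteratedFDeriv_sub_apply (hc' t' ht').contDiffAt (hc' t ht).contDiffAt, hcurl]
  -- `‖Dᵏ curl d‖ ≤ ‖curlCLM‖ ‖Dᵏ⁺¹ d‖`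
  have hD : ContDiff ℝ k (fderiv ℝ (u t' - u t)) := hd.fderiv_right (m := k) (by exact_mod_cast le_top)
  have hle : ‖iteratedFDeriv ℝ k (curl (u t' - u t)) y‖ ≤ ‖curlCLM‖ * ‖iteratedFDeriv ℝ (k + 1) (u t' - u t) y‖ := by
    rw [show curl (u t' - u t) = curlCLM ∘ fderiv ℝ (u t' - u t) from rfl,
      curlCLM.iteratedFDeriv_comp_left hD.contDiffAt (i := k) (by exact_mod_cast le_rfl),
      ← norm_iteratedFDeriv_fderiv]
    exact ContinuousLinearMap.norm_compContinuousMultilinearMap_le _ _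
  rw [iteratedFDeriv_sub_apply ((hu t' ht').of_le (natCast_le_contDiff_infty _)).contDiffAt
    ((hu t ht).of_le (natCast_le_contDiff_infty _)).contDiffAt] at hle
  refine hle.trans ?_
  have h0 : 0 ≤ ‖curlCLM‖ := norm_nonneg curlCLM
  calc ‖curlCLM‖ * ‖iteratedFDeriv ℝ (k + 1) (u t') y - iteratedFDeriv ℝ (k + 1) (u t) y‖
      ≤ ‖curlCLM‖ * (ε / (‖curlCLM‖ + 1)) := mul_le_mul_of_nonneg_left (h t' ht' hlt y) h0
    _ ≤ ε := by rw [mul_div_assoc', div_le_iff₀ (by positivity)]; nlinarith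

/-- A uniform bound for the derivatives of order `≤ k` of a smooth function on a closed ball.
[folklore]
[cite: Seregin2022LocalAxisym, §2 proof of Thm. 1.2, Step 3 (arXiv:2201.00153 pp. 4–7) (source of the ARGUMENT this module implements; this declaration is the cell’s own lemma or plumbing, NOT a printed statement)] -/
theorem exists_forall_norm_iteratedFDeriv_le_closedBall {H : Type*} [NormedAddCommGroup H] [NormedSpace ℝ H]
    {φ : EuclideanSpace ℝ (Fin 3) → H} (hφ : ContDiff ℝ ∞ φ) (R : ℝ) (k : ℕ) :
    ∃ C, 0 ≤ C ∧ ∀ j ≤ k, ∀ y ∈ closedBall (0 : EuclideanSpace ℝ (Fin 3)) R, ‖iteratedFDeriv ℝ j φ y‖ ≤ C := by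
  have hone : ∀ j : ℕ, ∃ C, ∀ y ∈ closedBall (0 : EuclideanSpace ℝ (Fin 3)) R, ‖iteratedFDeriv ℝ j φ y‖ ≤ C :=
    fun j => (isCompact_closedBall _ _).exists_bound_of_continuousOn
      ((hφ.continuous_iteratedFDeriv (by exact_mod_cast le_top)).continuousOn)
  induction k with
  | zero =>
    obtain ⟨C, hC⟩ := hone 0
    exact ⟨max C 0, le_max_right _ _, fun j hj y hy => by
      obtain rfl : j = 0 := Nat.le_zero.1 hj; exact (hC y hy).trans (le_max_left _ _)⟩
  | succ k ih =>
    obtain ⟨C₁, hC₁0, hC₁⟩ := ih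
    obtain ⟨C₂, hC₂⟩ := hone (k + 1)
    refine ⟨max C₁ C₂, le_max_of_le_left hC₁0, fun j hj y hy => ?_⟩
    rcases Nat.of_le_succ hj with hj' | rfl
    · exact (hC₁ j hj' y hy).trans (le_max_left _ _)
    · exact (hC₂ y hy).trans (le_max_right _ _)

/-- **The moduli pass through a continuous bilinear pairing** `B (f t y) (g t y)` of two families
with smooth slices and uniform-in-`y` time moduli of all `y`-derivatives on `S`, the second family
supported in a fixed ball `B̄(0, R)` (off which the pairing vanishes identically): for every `k`,
`‖Dᵏ(B f g)(t', y) − Dᵏ(B f g)(t, y)‖ ≤ ε` for `|t' − t| < δ`, all `y`. Leibniz bound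
(`ContinuousLinearMap.norm_iteratedFDeriv_le_of_bilinear`) for `B (f'−f) g' + B f (g'−g)`, the
derivatives of `f`, `g'` being bounded on the ball uniformly for `t'` near `t`. Covers
`swirl w = ⟪Jy, w y⟫`, `⟪y_h, w y⟫` (constant left family) and the products `Dω[u]`, `Du[ω]`.
[folklore]
[cite: Seregin2022LocalAxisym, §2 proof of Thm. 1.2, Step 3 (arXiv:2201.00153 pp. 4–7) (source of the ARGUMENT this module implements; this declaration is the cell’s own lemma or plumbing, NOT a printed statement)] -/
theorem unifTime_bilinear {E F G : Type*} [NormedAddCommGroup E] [NormedSpace ℝ E]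
    [NormedAddCommGroup F] [NormedSpace ℝ F] [NormedAddCommGroup G] [NormedSpace ℝ G]
    (B : E →L[ℝ] F →L[ℝ] G) {f : ℝ → EuclideanSpace ℝ (Fin 3) → E}
    {g : ℝ → EuclideanSpace ℝ (Fin 3) → F} {R : ℝ}
    (hf : ∀ t ∈ S, ContDiff ℝ ∞ (f t)) (hg : ∀ t ∈ S, ContDiff ℝ ∞ (g t))
    (hgR : ∀ t ∈ S, ∀ y, R < ‖y‖ → g t y = 0)
    (hUf : ∀ k : ℕ, ∀ t ∈ S, ∀ ε > 0, ∃ δ > 0, ∀ t' ∈ S, |t' - t| < δ → ∀ y,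
      ‖iteratedFDeriv ℝ k (f t') y - iteratedFDeriv ℝ k (f t) y‖ ≤ ε)
    (hUg : ∀ k : ℕ, ∀ t ∈ S, ∀ ε > 0, ∃ δ > 0, ∀ t' ∈ S, |t' - t| < δ → ∀ y,
      ‖iteratedFDeriv ℝ k (g t') y - iteratedFDeriv ℝ k (g t) y‖ ≤ ε) :
    ∀ k : ℕ, ∀ t ∈ S, ∀ ε > 0, ∃ δ > 0, ∀ t' ∈ S, |t' - t| < δ → ∀ y,
      ‖iteratedFDeriv ℝ k (fun y => B (f t' y) (g t' y)) y -
        iteratedFDeriv ℝ k (fun y => B (f t y) (g t y)) y‖ ≤ ε := by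
  intro k t ht ε hε
  -- bounds for `Dʲ f t`, `Dʲ g t`, `j ≤ k`, on the ball `B̄(0, R)`
  obtain ⟨Cf, hCf0, hCf⟩ := exists_forall_norm_iteratedFDeriv_le_closedBall (hf t ht) R k
  obtain ⟨Cg, hCg0, hCg⟩ := exists_forall_norm_iteratedFDeriv_le_closedBall (hg t ht) R k
  -- the constant of the Leibniz bound
  set M : ℝ := ‖B‖ * (2 ^ k * ((Cg + 1) + Cf)) + 1 with hM
  have hMpos : 0 < M := by positivity
  obtain ⟨δf, hδf, hmf⟩ := unifTime_mono_order hUf k ht (ε := ε / M) (by positivity)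
  obtain ⟨δg, hδg, hmg⟩ := unifTime_mono_order hUg k ht (ε := min (ε / M) 1) (by positivity)
  refine ⟨min δf δg, lt_min hδf hδg, fun t' ht' hlt y => ?_⟩
  have hltf : |t' - t| < δf := hlt.trans_le (min_le_left _ _)
  have hltg : |t' - t| < δg := hlt.trans_le (min_le_right _ _)
  have hcast : ∀ m : ℕ, ((m : ℕ∞) : WithTop ℕ∞) ≤ ((⊤ : ℕ∞) : WithTop ℕ∞) := fun m => by exact_mod_cast le_top
  -- the difference as a sum of two pairings
  have hP : ∀ s ∈ S, ContDiff ℝ ∞ fun y => B (f s y) (g s y) := fun s hs =>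
    B.isBoundedBilinearMap.contDiff.comp ((hf s hs).prodMk (hg s hs))
  have hdf : ContDiff ℝ ∞ fun y => f t' y - f t y := (hf t' ht').sub (hf t ht)
  have hdg : ContDiff ℝ ∞ fun y => g t' y - g t y := (hg t' ht').sub (hg t ht)
  have hP1 : ContDiff ℝ ∞ fun y => B (f t' y - f t y) (g t' y) :=
    B.isBoundedBilinearMap.contDiff.comp (hdf.prodMk (hg t' ht'))
  have hP2 : ContDiff ℝ ∞ fun y => B (f t y) (g t' y - g t y) :=
    B.isBoundedBilinearMap.contDiff.comp ((hf t ht).prodMk hdg)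
  have hsplit : (fun y => B (f t' y) (g t' y)) - (fun y => B (f t y) (g t y)) =
      (fun y => B (f t' y - f t y) (g t' y)) + fun y => B (f t y) (g t' y - g t y) := by
    funext z
    simp only [Pi.sub_apply, Pi.add_apply, map_sub, _root_.sub_apply]
    abel
  rw [← iteratedFDeriv_sub_apply ((hP t' ht').of_le (hcast k)).contDiffAt ((hP t ht).of_le (hcast k)).contDiffAt,
    hsplit]
  by_cases hy : R < ‖y‖
  · -- off the ball both pairings vanish near `y`
    have hopen : IsOpen {z : EuclideanSpace ℝ (Fin 3) | R < ‖z‖} := isOpen_lt continuous_const continuous_norm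
    have hz : (fun y => B (f t' y - f t y) (g t' y)) + (fun y => B (f t y) (g t' y - g t y)) =ᶠ[𝓝 y]
        fun _ => 0 := by
      filter_upwards [hopen.mem_nhds hy] with z hz
      simp [hgR t' ht' z hz, hgR t ht z hz]
    rw [(hz.iteratedFDeriv ℝ k).self_of_nhds, iteratedFDeriv_fun_zero, Pi.zero_apply, norm_zero]
    exact hε.le
  · -- on the ball: Leibniz for both pairings
    have hyR : y ∈ closedBall (0 : EuclideanSpace ℝ (Fin 3)) R := mem_closedBall_zero_iff.2 (not_lt.1 hy)
    have hsum : ∑ i ∈ Finset.range (k + 1), (k.choose i : ℝ) = 2 ^ k := by exact_mod_cast Nat.sum_range_choose k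
    -- first pairing: `‖Dⁱ(f' − f)‖ ≤ ε/M`, `‖Dᵏ⁻ⁱ g'‖ ≤ Cg + 1`
    have hg' : ∀ j ≤ k, ‖iteratedFDeriv ℝ j (g t') y‖ ≤ Cg + 1 := fun j hj => by
      have h1 := hmg j hj t' ht' hltg y
      have h2 := hCg j hj y hyR
      calc ‖iteratedFDeriv ℝ j (g t') y‖
          = ‖(iteratedFDeriv ℝ j (g t') y - iteratedFDeriv ℝ j (g t) y) + iteratedFDeriv ℝ j (g t) y‖ := by
            rw [sub_add_cancel]
        _ ≤ ‖iteratedFDeriv ℝ j (g t') y - iteratedFDeriv ℝ j (g t) y‖ + ‖iteratedFDeriv ℝ j (g t) y‖ :=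
            norm_add_le _ _
        _ ≤ 1 + Cg := add_le_add (h1.trans (min_le_right _ _)) h2
        _ = Cg + 1 := add_comm _ _
    have hdf' : ∀ j ≤ k, ‖iteratedFDeriv ℝ j (fun y => f t' y - f t y) y‖ ≤ ε / M := fun j hj => by
      rw [show (fun y => f t' y - f t y) = f t' - f t from rfl,
        iteratedFDeriv_sub_apply ((hf t' ht').of_le (hcast j)).contDiffAt ((hf t ht).of_le (hcast j)).contDiffAt]
      exact hmf j hj t' ht' hltf y
    have hdg' : ∀ j ≤ k, ‖iteratedFDeriv ℝ j (fun y => g t' y - g t y) y‖ ≤ ε / M := fun j hj => by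
      rw [show (fun y => g t' y - g t y) = g t' - g t from rfl,
        iteratedFDeriv_sub_apply ((hg t' ht').of_le (hcast j)).contDiffAt ((hg t ht).of_le (hcast j)).contDiffAt]
      exact (hmg j hj t' ht' hltg y).trans (min_le_left _ _)
    have hL1 := B.norm_iteratedFDeriv_le_of_bilinear hdf (hg t' ht') y (n := k) (by exact_mod_cast le_top)
    have hL2 := B.norm_iteratedFDeriv_le_of_bilinear (hf t ht) hdg y (n := k) (by exact_mod_cast le_top)
    have hT1 : ∑ i ∈ Finset.range (k + 1), (k.choose i : ℝ) * ‖iteratedFDeriv ℝ i (fun y => f t' y - f t y) y‖ *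
        ‖iteratedFDeriv ℝ (k - i) (g t') y‖ ≤ ∑ i ∈ Finset.range (k + 1), (k.choose i : ℝ) * (ε / M) * (Cg + 1) := by
      refine Finset.sum_le_sum fun i hi => ?_
      have hik : i ≤ k := Nat.lt_succ_iff.1 (Finset.mem_range.1 hi)
      have h1 := hdf' i hik
      have h2 := hg' (k - i) (Nat.sub_le _ _)
      have h0 : 0 ≤ (k.choose i : ℝ) := by positivity
      calc (k.choose i : ℝ) * ‖iteratedFDeriv ℝ i (fun y => f t' y - f t y) y‖ * ‖iteratedFDeriv ℝ (k - i) (g t') y‖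
          ≤ (k.choose i : ℝ) * (ε / M) * ‖iteratedFDeriv ℝ (k - i) (g t') y‖ :=
            mul_le_mul_of_nonneg_right (mul_le_mul_of_nonneg_left h1 h0) (norm_nonneg _)
        _ ≤ (k.choose i : ℝ) * (ε / M) * (Cg + 1) :=
            mul_le_mul_of_nonneg_left h2 (by positivity)
    have hT2 : ∑ i ∈ Finset.range (k + 1), (k.choose i : ℝ) * ‖iteratedFDeriv ℝ i (f t) y‖ *
        ‖iteratedFDeriv ℝ (k - i) (fun y => g t' y - g t y) y‖ ≤ ∑ i ∈ Finset.range (k + 1), (k.choose i : ℝ) * Cf * (ε / M) := by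
      refine Finset.sum_le_sum fun i hi => ?_
      have hik : i ≤ k := Nat.lt_succ_iff.1 (Finset.mem_range.1 hi)
      have h1 := hCf i hik y hyR
      have h2 := hdg' (k - i) (Nat.sub_le _ _)
      have h0 : 0 ≤ (k.choose i : ℝ) := by positivity
      calc (k.choose i : ℝ) * ‖iteratedFDeriv ℝ i (f t) y‖ * ‖iteratedFDeriv ℝ (k - i) (fun y => g t' y - g t y) y‖
          ≤ (k.choose i : ℝ) * Cf * ‖iteratedFDeriv ℝ (k - i) (fun y => g t' y - g t y) y‖ :=
            mul_le_mul_of_nonneg_right (mul_le_mul_of_nonneg_left h1 h0) (norm_nonneg _)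
        _ ≤ (k.choose i : ℝ) * Cf * (ε / M) := mul_le_mul_of_nonneg_left h2 (by positivity)
    rw [← Finset.sum_mul, ← Finset.sum_mul, hsum] at hT1 hT2
    have hB0 : 0 ≤ ‖B‖ := norm_nonneg B
    have hadd : ‖iteratedFDeriv ℝ k ((fun y => B (f t' y - f t y) (g t' y)) + fun y => B (f t y) (g t' y - g t y)) y‖ ≤
        ‖B‖ * (2 ^ k * (ε / M) * (Cg + 1)) + ‖B‖ * (2 ^ k * Cf * (ε / M)) := by
      rw [iteratedFDeriv_add_apply (hP1.of_le (hcast k)).contDiffAt (hP2.of_le (hcast k)).contDiffAt]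
      refine (norm_add_le _ _).trans (add_le_add ?_ ?_)
      · exact hL1.trans (mul_le_mul_of_nonneg_left hT1 hB0)
      · exact hL2.trans (mul_le_mul_of_nonneg_left hT2 hB0)
    refine hadd.trans ?_
    have hkey : ‖B‖ * (2 ^ k * (ε / M) * (Cg + 1)) + ‖B‖ * (2 ^ k * Cf * (ε / M)) =
        (‖B‖ * (2 ^ k * ((Cg + 1) + Cf))) * (ε / M) := by ring
    rw [hkey, mul_div_assoc', div_le_iff₀ hMpos, hM]
    nlinarith [mul_nonneg hB0 (show (0:ℝ) ≤ 2 ^ k * ((Cg + 1) + Cf) by positivity)]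
end Transfer

end Literature.Analysis.SereginLogSwirlOrigin.EulerScaling

end Part7

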